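import Literature.Barriers.ABC.UniformABCDiscriminantSharp
import HarnessLib

/-!
# Masser's theorem `UniformABCDiscriminantSharp`: proof in every degree not coprime to `6`

Sibling proof file for `Literature/Barriers/ABC/UniformABCDiscriminantSharp.lean`
[cite: Masser2002, Theorem and §3] (D. W. Masser, *On abc and discriminants*, Proc. Amer. Math.
Soc. 130 (2002) 3141–3150, §3, (3.4)–(3.10); read in full).

## Main results

* `uniformABCDiscriminantSharp_of_not_coprime_six`: the statement of the named fact
  `UniformABCDiscriminantSharp` **for every degree `n ≥ 2` with `gcd(n,6) ≠ 1`** (all `λ ≥ 1`,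
  `ν < 1/(λn+1)`, `C`), fully proved; it combines
* `uniformABCDiscriminantSharp_even` (every even `n`, base degree `2`) and
* `uniformABCDiscriminantSharp_three` (every `n` divisible by `3`, base degree `3`).

## Why only degrees with `gcd(n,6) ≠ 1` (what blocks the full discharge)

Masser's proof (§3) takes `ξ` a root of `X^n − n ũ^{(n−1)f} X + (n−1) u^{nf}` for a pigeonholed
pair of smooth numbers `u ≡ ũ (mod 2^d)` and needs `[ℚ(ξ):ℚ] = n`, i.e. irreducibility, which he
obtains (§2, Proposition) from Hilbert irreducibility proved **via Faltings' theorem** (genus `≥ 2`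
coverings `C^{(f)}`), with an ineffective finite exceptional set. No elementary substitute is known
in general: the degenerate trinomial is never Eisenstein (the `p`-adic bookkeeping of its
discriminant `h (ũ^{N} − u^{N})` is incompatible with `v_p(constant) = 1`), and auxiliary-prime
variants need quantitative Dirichlet/PNT input that Mathlib lacks. In base degree `N ≤ 3` the
obstruction disappears (a cubic or quadratic is irreducible or has a rational root, and a rational
root yields a rational smooth triple, for which any degree-`n` field works). This file carries out
the cases `N = 2` (`X² − 2vX + u²`, `ω = (ξ−v)/M`) and `N = 3` (`X³ − 3v²X + 2u³`,
`ω = (ξ−v)(ξ+2v)/M`, `disc(1,ξ,ω) = 108(v⁶−u⁶)/M²`) and reaches every `n = Ne` by the base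
change `K ↦ K(r^{1/e})`; the degrees `n` with `gcd(n, 6) = 1` remain out of reach of the
elementary method (they would need the Proposition of §2, i.e. Faltings).

## Contents (all proved; the `def`s are auxiliary polynomials/fields, no `Prop` facts)

* Height step (3.7): `mulHeight_eq_prod_infinitePlace_of_span_eq_top`,
  `abs_norm_le_mulHeight_of_span_eq_top`, `pow_le_mulHeight_trinomialTriple`.
* Support step (3.8): `prod_absNorm_pow_ramificationIdx` (`∏_{𝔓∣p} N𝔓^{e(𝔓)} = p^{[K:ℚ]}`),
  `masserSupport_le_rad_pow`, `masserSupport_trinomial_le`.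
* Discriminant step (replacing Hensel's bound in (3.9) by an explicit integral element):
  `exists_discr_eq_sq_mul_discr`, `abs_discr_le_abs_discr_of_isIntegral`, `discr_dvd_of_isIntegral`;
  the quadratic field `MasserQuadField u v = ℚ[X]/(X² − 2vX + u²)` with `ω = (ξ − v)/M ∈ 𝓞_K`
  for `M² ∣ v² − u²` and `|D_K| ≤ 4 (v² − u²)/M²` (`abs_discr_masserQuadField_le`).
* Base change: `BaseChangeField K e r = K[X]/(X^e − r)` for a prime `r ∤ D_K` (Eisenstein at an
  unramified prime, `irreducible_rootPoly`), relative different and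
  `|D_L| ≤ e^{[L:ℚ]} r^{[K:ℚ](e−1)} |D_K|^e` (`natAbs_discr_baseChangeField_le`).
* Algebraic core: `exists_masserTriple`, `exists_field_even_core`.
* Pigeonhole on the box of smooth numbers (3.4)–(3.5): `exists_coprime_smooth_pair`;
  `exists_odd_prime_not_dvd`; bookkeeping `log_modulus_ge`; Chebyshev input
  (`eventually_theta_ge_half`, `theta_le_log_two_add`) — only Chebyshev-strength bounds are
  needed because `ν < 1/(λn+1)` leaves slack, whereas Masser's Lemma at the exact exponent
  `η = 1/(λn+1)` uses second-order prime-counting asymptotics.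
* Assembly: `even_assembly`, `exists_good_params`, `uniformABCDiscriminantSharp_even`.
* Base degree `3`: `MasserCubicField`, `norm_cubRoot_sub` (`N(ξ − t) = −F(t)`), `cubOmega`,
  `cubBasis`, `discr_cubBasis`, `abs_discr_masserCubicField_le` (`|D_K| ≤ 108(v⁶−u⁶)/M²`),
  `exists_field_three_core`, `three_assembly`, `exists_good_params3`,
  `uniformABCDiscriminantSharp_three`, `uniformABCDiscriminantSharp_of_not_coprime_six`.
-/

noncomputable section

namespace Literature.Barriers.ABC

open NumberField IsDedekindDomain Height

section HeightStep

variable {K : Type*} [Field K] [NumberField K]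

/-- **Masser's height step** [cite: Masser2002, §3 (3.7)]: if algebraic integers `x i` generate
the unit ideal of `𝓞 K`, the finite part of the multiplicative height of the tuple is `1`, so the
height is the archimedean product `∏_w (max_i w(x_i))^{mult w}`. -/
theorem mulHeight_eq_prod_infinitePlace_of_span_eq_top {ι : Type*} [Fintype ι]
    {x : ι → 𝓞 K} (hx : Ideal.span (Set.range x) = ⊤) :
    mulHeight (fun i => (x i : K)) =
      ∏ w : InfinitePlace K, (⨆ i, w (x i)) ^ w.mult := by
  classical
  have hx0 : x ≠ 0 := by
    intro h
    have hbot : Ideal.span (Set.range x) = ⊥ :=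
      Ideal.span_eq_bot.mpr (fun y ⟨i, hi⟩ => by rw [← hi, h]; rfl)
    exact bot_ne_top (hbot.symm.trans hx)
  have hx0' : (fun i => (x i : K)) ≠ 0 := by
    intro h
    apply hx0
    funext i
    have := congrFun h i
    simpa using this
  have h1 := NumberField.absNorm_mul_finprod_finitePlace_eq_one (K := K) hx0
  rw [hx, Ideal.absNorm_top, Nat.cast_one, one_mul] at h1
  rw [NumberField.mulHeight_eq hx0', h1, mul_one]

/-- **Masser's height step, lower bound** [cite: Masser2002, §3 (3.7)]: under the same
hypothesis, `H_K(x) ≥ |N_{K/ℚ}(x_j)|` for every index `j` (keep only the `j`-th entry at each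
archimedean place and use `∏_w w(y)^{mult w} = |N(y)|`). -/
theorem abs_norm_le_mulHeight_of_span_eq_top {ι : Type*} [Fintype ι]
    {x : ι → 𝓞 K} (hx : Ideal.span (Set.range x) = ⊤) (j : ι) :
    |(Algebra.norm ℚ (x j : K) : ℝ)| ≤ mulHeight (fun i => (x i : K)) := by
  classical
  rw [mulHeight_eq_prod_infinitePlace_of_span_eq_top hx]
  have hprod := InfinitePlace.prod_eq_abs_norm (x j : K)
  have : |(Algebra.norm ℚ (x j : K) : ℝ)| = ∏ w : InfinitePlace K, w (x j) ^ w.mult := by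
    rw [hprod]; push_cast; rfl
  rw [this]
  apply Finset.prod_le_prod
  · intro w _; positivity
  · intro w _
    apply pow_le_pow_left₀ (apply_nonneg _ _)
    exact le_ciSup_of_le (Set.finite_range _).bddAbove j le_rfl

end HeightStep

/-! ### The support step (3.8): `∏_{𝔓 ∣ p} N𝔓^{e(𝔓)} = p^n` and `S_K ≤ rad(Q)^n` -/

section SupportStep

variable {K : Type*} [Field K] [NumberField K]

omit [NumberField K] in
/-- A nonzero prime of `𝓞 K` dividing `(p)` for a rational prime `p` lies over `pℤ`. [folklore] -/
theorem under_int_eq_span_of_dvd {p : ℕ} (hp : p.Prime) (v : HeightOneSpectrum (𝓞 K))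
    (hv : v.asIdeal ∣ Ideal.span {(p : 𝓞 K)}) :
    v.asIdeal.under ℤ = Ideal.span {(p : ℤ)} := by
  have hpZ : Prime (p : ℤ) := Nat.prime_iff_prime_int.mp hp
  have hmax : (Ideal.span {(p : ℤ)}).IsMaximal :=
    ((Ideal.span_singleton_prime hpZ.ne_zero).mpr hpZ).isMaximal
      (by simpa using hpZ.ne_zero)
  have hprime : (v.asIdeal.under ℤ).IsPrime := Ideal.IsPrime.under ℤ v.asIdeal
  refine (hmax.eq_of_le hprime.ne_top ?_).symm
  rw [Ideal.span_singleton_le_iff_mem, Ideal.mem_comap]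
  have hle : Ideal.span {(p : 𝓞 K)} ≤ v.asIdeal := Ideal.le_of_dvd hv
  have : ((p : ℤ) : 𝓞 K) ∈ Ideal.span {(p : 𝓞 K)} := by simp
  simpa using hle this

/-- For a rational prime `p`, the multiplicity of a prime `𝔓 ∣ (p)` of `𝓞 K` in `(p)` is its
ramification index over `ℤ`. [folklore] -/
theorem count_span_natCast_eq_ramificationIdx {p : ℕ} (hp : p.Prime)
    (v : HeightOneSpectrum (𝓞 K)) (hv : v.asIdeal ∣ Ideal.span {(p : 𝓞 K)}) :
    (Associates.mk v.asIdeal).count (Associates.mk (Ideal.span {(p : 𝓞 K)})).factors =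
      v.asIdeal.ramificationIdx ℤ := by
  classical
  have hI : Ideal.span {(p : 𝓞 K)} ≠ ⊥ := by
    simpa [Ideal.span_singleton_eq_bot] using hp.ne_zero
  rw [Ideal.count_associates_factors_eq hI v.isPrime v.ne_bot]
  have hunder := under_int_eq_span_of_dvd hp v hv
  haveI : v.asIdeal.LiesOver (Ideal.span {(p : ℤ)}) := ⟨hunder.symm⟩
  have hmap : (Ideal.span {(p : ℤ)}).map (algebraMap ℤ (𝓞 K)) = Ideal.span {(p : 𝓞 K)} := by
    rw [Ideal.map_span, Set.image_singleton, map_natCast]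
  have hp0 : (Ideal.span {(p : ℤ)}).map (algebraMap ℤ (𝓞 K)) ≠ ⊥ := by rwa [hmap]
  rw [Ideal.IsDedekindDomain.ramificationIdx_eq_normalizedFactors_count (Ideal.span {(p : ℤ)})
    v.asIdeal hp0, hmap]

/-- **Fundamental identity, norm form** [folklore]: for a rational prime `p`,
`∏_{𝔓 ∣ p} N𝔓^{e(𝔓)} = p^{[K:ℚ]}` (take absolute norms in `(p) = ∏ 𝔓^{e(𝔓)}`). -/
theorem prod_absNorm_pow_ramificationIdx {p : ℕ} (hp : p.Prime)
    (hfin : {v : HeightOneSpectrum (𝓞 K) | v.asIdeal ∣ Ideal.span {(p : 𝓞 K)}}.Finite) :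
    ∏ v ∈ hfin.toFinset, Ideal.absNorm v.asIdeal ^ v.asIdeal.ramificationIdx ℤ =
      p ^ Module.finrank ℚ K := by
  classical
  set I : Ideal (𝓞 K) := Ideal.span {(p : 𝓞 K)} with hIdef
  have hI : I ≠ ⊥ := by
    simpa [hIdef, Ideal.span_singleton_eq_bot] using hp.ne_zero
  have hnorm : Ideal.absNorm I = p ^ Module.finrank ℚ K := by
    rw [hIdef, Ideal.absNorm_span_natCast, RingOfIntegers.rank]
  rw [← hnorm]
  conv_rhs => rw [← Ideal.finprod_heightOneSpectrum_factorization hI]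
  rw [map_finprod Ideal.absNorm (Ideal.hasFiniteMulSupport hI)]
  have hsupp : Function.mulSupport (fun v : HeightOneSpectrum (𝓞 K) =>
      Ideal.absNorm (v.maxPowDividing I)) ⊆ hfin.toFinset := by
    intro v hv
    simp only [Function.mem_mulSupport] at hv
    simp only [Set.Finite.coe_toFinset, Set.mem_setOf_eq]
    by_contra hndvd
    apply hv
    have h0 : (Associates.mk v.asIdeal).count (Associates.mk I).factors = 0 := by
      have := (Associates.count_ne_zero_iff_dvd hI v.irreducible).not
      push Not at this
      simpa using this.mpr hndvd
    simp [IsDedekindDomain.HeightOneSpectrum.maxPowDividing, h0]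
  rw [finprod_eq_prod_of_mulSupport_subset _ hsupp]
  apply Finset.prod_congr rfl
  intro v hv
  simp only [Set.Finite.mem_toFinset, Set.mem_setOf_eq] at hv
  rw [IsDedekindDomain.HeightOneSpectrum.maxPowDividing, map_pow,
    count_span_natCast_eq_ramificationIdx hp v hv]

/-- A prime of `𝓞 K` divides `(Q)` iff it divides `(p)` for some prime `p ∣ Q`. [folklore] -/
theorem dvd_span_natCast_iff_exists_prime {Q : ℕ} (hQ : Q ≠ 0) (v : HeightOneSpectrum (𝓞 K)) :
    v.asIdeal ∣ Ideal.span {(Q : 𝓞 K)} ↔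
      ∃ p ∈ Q.primeFactors, v.asIdeal ∣ Ideal.span {(p : 𝓞 K)} := by
  constructor
  · intro hv
    have hmem : (Q : 𝓞 K) ∈ v.asIdeal := by
      have hle : Ideal.span {(Q : 𝓞 K)} ≤ v.asIdeal := Ideal.le_of_dvd hv
      exact hle (Ideal.mem_span_singleton_self _)
    rw [← Nat.prod_factorization_pow_eq_self hQ] at hmem
    push_cast [Finsupp.prod] at hmem
    rw [Ideal.IsPrime.prod_mem_iff] at hmem
    obtain ⟨p, hp, hpmem⟩ := hmem
    rw [Nat.support_factorization] at hp
    refine ⟨p, hp, ?_⟩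
    have hpmem' : (p : 𝓞 K) ∈ v.asIdeal := Ideal.IsPrime.mem_of_pow_mem inferInstance _ hpmem
    exact Ideal.dvd_iff_le.mpr ((Ideal.span_singleton_le_iff_mem _).mpr hpmem')
  · rintro ⟨p, hp, hv⟩
    refine dvd_trans hv ?_
    rw [Ideal.dvd_iff_le, Ideal.span_singleton_le_iff_mem, Ideal.mem_span_singleton]
    exact_mod_cast Nat.cast_dvd_cast (Nat.dvd_of_mem_primeFactors hp)

omit [NumberField K] in
/-- Distinct rational primes have no common prime of `𝓞 K` above them. [folklore] -/
theorem not_dvd_span_of_dvd_span_of_ne {p q : ℕ} (hp : p.Prime) (hq : q.Prime) (hpq : p ≠ q)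
    (v : HeightOneSpectrum (𝓞 K)) (hvp : v.asIdeal ∣ Ideal.span {(p : 𝓞 K)}) :
    ¬ v.asIdeal ∣ Ideal.span {(q : 𝓞 K)} := by
  intro hvq
  have hcop : Nat.Coprime p q := (Nat.coprime_primes hp hq).mpr hpq
  have hmp : (p : 𝓞 K) ∈ v.asIdeal := Ideal.le_of_dvd hvp (Ideal.mem_span_singleton_self _)
  have hmq : (q : 𝓞 K) ∈ v.asIdeal := Ideal.le_of_dvd hvq (Ideal.mem_span_singleton_self _)
  have h1 : (1 : 𝓞 K) ∈ v.asIdeal := by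
    have hbez := Nat.gcd_eq_gcd_ab p q
    rw [Nat.Coprime.gcd_eq_one hcop] at hbez
    have hcast : ((1 : ℕ) : 𝓞 K) = (p : 𝓞 K) * (Nat.gcdA p q : 𝓞 K) +
        (q : 𝓞 K) * (Nat.gcdB p q : 𝓞 K) := by
      have := congrArg (fun z : ℤ => (z : 𝓞 K)) hbez
      push_cast at this
      exact_mod_cast this
    rw [Nat.cast_one] at hcast
    rw [hcast]
    exact v.asIdeal.add_mem (v.asIdeal.mul_mem_right _ hmp) (v.asIdeal.mul_mem_right _ hmq)
  exact v.isPrime.ne_top ((Ideal.eq_top_iff_one _).mpr h1)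

/-- **Masser's support step, abstract form** [cite: Masser2002, §3 (3.8)]: if every prime at
which `a, b, c` have unequal valuations divides `(Q)`, then
`S_K(a,b,c) ≤ ∏_{p ∣ Q} ∏_{𝔓 ∣ p} N𝔓^{e(𝔓)} = rad(Q)^{[K:ℚ]}`. -/
theorem masserSupport_le_rad_pow {a b c : K} {Q : ℕ} (hQ : Q ≠ 0)
    (h : ∀ v ∈ Literature.NumberTheory.DiophantineGeometry.badPrimes a b c,
      v.asIdeal ∣ Ideal.span {(Q : 𝓞 K)}) :
    masserSupport a b c ≤ (∏ p ∈ Q.primeFactors, p) ^ Module.finrank ℚ K := by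
  classical
  have hfin : {v : HeightOneSpectrum (𝓞 K) | v.asIdeal ∣ Ideal.span {(Q : 𝓞 K)}}.Finite := by
    apply Ideal.finite_factors
    simpa [Ideal.span_singleton_eq_bot] using hQ
  have hfinp : ∀ p : ℕ, p.Prime →
      {v : HeightOneSpectrum (𝓞 K) | v.asIdeal ∣ Ideal.span {(p : 𝓞 K)}}.Finite := by
    intro p hp
    apply Ideal.finite_factors
    simpa [Ideal.span_singleton_eq_bot] using hp.ne_zero
  have hsub : Literature.NumberTheory.DiophantineGeometry.badPrimes a b c ⊆
      {v : HeightOneSpectrum (𝓞 K) | v.asIdeal ∣ Ideal.span {(Q : 𝓞 K)}} := fun v hv => h v hv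
  have hbadfin := hfin.subset hsub
  unfold masserSupport
  rw [finprod_mem_eq_finite_toFinset_prod _ hbadfin]
  calc ∏ v ∈ hbadfin.toFinset, Ideal.absNorm v.asIdeal ^ v.asIdeal.ramificationIdx ℤ
      ≤ ∏ v ∈ hfin.toFinset, Ideal.absNorm v.asIdeal ^ v.asIdeal.ramificationIdx ℤ := by
        apply Finset.prod_le_prod_of_subset_of_one_le'
        · intro v hv
          simp only [Set.Finite.mem_toFinset] at hv ⊢
          exact hsub hv
        · intro v _ _
          exact Nat.one_le_pow _ _ (Nat.pos_of_ne_zero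
            (Ideal.absNorm_eq_zero_iff.not.mpr v.ne_bot))
    _ = ∏ p ∈ Q.primeFactors.attach, (p : ℕ) ^ Module.finrank ℚ K := by
        have hT : hfin.toFinset = Q.primeFactors.attach.biUnion
            (fun p => (hfinp p.1 (Nat.prime_of_mem_primeFactors p.2)).toFinset) := by
          ext v
          simp only [Set.Finite.mem_toFinset, Set.mem_setOf_eq, Finset.mem_biUnion,
            Finset.mem_attach, true_and, Subtype.exists]
          rw [dvd_span_natCast_iff_exists_prime hQ v]
          constructor
          · rintro ⟨p, hp, hv⟩; exact ⟨p, hp, hv⟩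
          · rintro ⟨p, hp, hv⟩; exact ⟨p, hp, hv⟩
        rw [hT, Finset.prod_biUnion]
        · apply Finset.prod_congr rfl
          intro p _
          exact prod_absNorm_pow_ramificationIdx (Nat.prime_of_mem_primeFactors p.2) _
        · intro p _ q _ hpq
          simp only [Function.onFun]
          rw [Finset.disjoint_left]
          intro v hvp hvq
          simp only [Set.Finite.mem_toFinset, Set.mem_setOf_eq] at hvp hvq
          exact not_dvd_span_of_dvd_span_of_ne (Nat.prime_of_mem_primeFactors p.2)
            (Nat.prime_of_mem_primeFactors q.2) (fun heq => hpq (Subtype.ext heq)) v hvp hvq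
    _ = (∏ p ∈ Q.primeFactors, p) ^ Module.finrank ℚ K := by
        rw [Finset.prod_pow]
        congr 1
        exact Finset.prod_attach Q.primeFactors (fun p => p)

/-- **Masser's support step for the trinomial triple** [cite: Masser2002, §3 (3.8)]: if
`ξ ∈ 𝓞 K` satisfies `ξ^N = A ξ − B` with natural numbers `A, B`, then at every prime `𝔓` not
dividing `(AB)` the three algebraic integers `ξ^{N-1}, -A, A − ξ^{N-1}` (`= ξ^N/ξ, -Aξ/ξ, B/ξ`)
are `𝔓`-units, so every bad prime of this triple divides `(AB)`. -/
theorem badPrimes_trinomial_subset {N A B : ℕ} (ξ : 𝓞 K) (hξ : ξ ^ N = (A : 𝓞 K) * ξ - B)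
    (hN : 1 ≤ N) (v : HeightOneSpectrum (𝓞 K))
    (hv : v ∈ Literature.NumberTheory.DiophantineGeometry.badPrimes
      ((ξ : K) ^ (N - 1)) (-(A : K)) ((A : K) - (ξ : K) ^ (N - 1))) :
    v.asIdeal ∣ Ideal.span {((A * B : ℕ) : 𝓞 K)} := by
  classical
  by_contra hndvd
  have hQ : ((A * B : ℕ) : 𝓞 K) ∉ v.asIdeal := by
    intro hmem
    exact hndvd (Ideal.dvd_iff_le.mpr ((Ideal.span_singleton_le_iff_mem _).mpr hmem))
  have hA : (A : 𝓞 K) ∉ v.asIdeal := by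
    intro hmem; apply hQ; push_cast; exact v.asIdeal.mul_mem_right _ hmem
  have hB : (B : 𝓞 K) ∉ v.asIdeal := by
    intro hmem; apply hQ; push_cast; exact v.asIdeal.mul_mem_left _ hmem
  -- `B = ξ (A - ξ^{N-1})`
  have hfac : (B : 𝓞 K) = ξ * ((A : 𝓞 K) - ξ ^ (N - 1)) := by
    have : ξ ^ N = ξ * ξ ^ (N - 1) := by
      rw [← pow_succ']; congr 1; omega
    rw [mul_sub, ← this, hξ]; ring
  have hξv : ξ ∉ v.asIdeal := by
    intro hmem; apply hB; rw [hfac]; exact v.asIdeal.mul_mem_right _ hmem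
  have hdiff : ((A : 𝓞 K) - ξ ^ (N - 1)) ∉ v.asIdeal := by
    intro hmem; apply hB; rw [hfac]; exact v.asIdeal.mul_mem_left _ hmem
  apply hv
  have key : ∀ r : 𝓞 K, r ∉ v.asIdeal → v.valuation K (algebraMap (𝓞 K) K r) = 1 :=
    fun r hr => (v.valuation_eq_one_iff_notMem (K := K)).mpr hr
  have e1 : v.valuation K ((ξ : K) ^ (N - 1)) = 1 := by
    rw [map_pow]
    have : v.valuation K (ξ : K) = 1 := key ξ hξv
    rw [this, one_pow]
  have e2 : v.valuation K (-(A : K)) = 1 := by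
    rw [Valuation.map_neg]
    have := key (A : 𝓞 K) hA
    simpa using this
  have e3 : v.valuation K ((A : K) - (ξ : K) ^ (N - 1)) = 1 := by
    have := key _ hdiff
    simpa using this
  exact ⟨e1.trans e2.symm, e2.trans e3.symm⟩

/-- **Masser's support bound for the trinomial triple** [cite: Masser2002, §3 (3.8)]:
with `ξ^N = Aξ − B` as above and `A, B ≠ 0`,
`S_K(ξ^{N-1}, −A, A − ξ^{N-1}) ≤ rad(AB)^{[K:ℚ]}`. -/
theorem masserSupport_trinomial_le {N A B : ℕ} (ξ : 𝓞 K) (hξ : ξ ^ N = (A : 𝓞 K) * ξ - B)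
    (hN : 1 ≤ N) (hA : A ≠ 0) (hB : B ≠ 0) :
    masserSupport ((ξ : K) ^ (N - 1)) (-(A : K)) ((A : K) - (ξ : K) ^ (N - 1)) ≤
      (∏ p ∈ (A * B).primeFactors, p) ^ Module.finrank ℚ K :=
  masserSupport_le_rad_pow (mul_ne_zero hA hB)
    (fun v hv => badPrimes_trinomial_subset ξ hξ hN v hv)

end SupportStep

/-! ### The height step for the trinomial triple (3.7) -/

section HeightTrinomial

variable {K : Type*} [Field K] [NumberField K]

/-- With `ξ^N = Aξ − B` and `gcd(A, B) = 1`, the algebraic integers `ξ^{N-1}, −A, A − ξ^{N-1}`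
generate the unit ideal (it contains `A` and `B = ξ (A − ξ^{N-1})`).
[cite: Masser2002, §3, before (3.7)] -/
theorem span_trinomialTriple_eq_top {N A B : ℕ} (ξ : 𝓞 K) (hξ : ξ ^ N = (A : 𝓞 K) * ξ - B)
    (hN : 1 ≤ N) (hcop : Nat.Coprime A B) :
    Ideal.span (Set.range ![ξ ^ (N - 1), -(A : 𝓞 K), (A : 𝓞 K) - ξ ^ (N - 1)]) = ⊤ := by
  classical
  set I := Ideal.span (Set.range ![ξ ^ (N - 1), -(A : 𝓞 K), (A : 𝓞 K) - ξ ^ (N - 1)]) with hI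
  have hAmem : (A : 𝓞 K) ∈ I := by
    have : -(A : 𝓞 K) ∈ I := Ideal.subset_span ⟨1, rfl⟩
    simpa using I.neg_mem this
  have hfac : (B : 𝓞 K) = ξ * ((A : 𝓞 K) - ξ ^ (N - 1)) := by
    have : ξ ^ N = ξ * ξ ^ (N - 1) := by
      rw [← pow_succ']; congr 1; omega
    rw [mul_sub, ← this, hξ]; ring
  have hBmem : (B : 𝓞 K) ∈ I := by
    rw [hfac]
    exact I.mul_mem_left _ (Ideal.subset_span ⟨2, rfl⟩)
  rw [Ideal.eq_top_iff_one]
  have hbez := Nat.gcd_eq_gcd_ab A B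
  rw [Nat.Coprime.gcd_eq_one hcop] at hbez
  have hcast : ((1 : ℕ) : 𝓞 K) = (A : 𝓞 K) * (Nat.gcdA A B : 𝓞 K) +
      (B : 𝓞 K) * (Nat.gcdB A B : 𝓞 K) := by
    have := congrArg (fun z : ℤ => (z : 𝓞 K)) hbez
    push_cast at this
    exact_mod_cast this
  rw [Nat.cast_one] at hcast
  rw [hcast]
  exact I.add_mem (I.mul_mem_right _ hAmem) (I.mul_mem_right _ hBmem)

/-- **Masser's height bound for the trinomial triple** [cite: Masser2002, §3 (3.7)]: with
`ξ^N = Aξ − B`, `gcd(A,B) = 1`, the projective point `(ξ^N : −Aξ : B) = (ξ^{N-1} : −A : A − ξ^{N-1})`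
has `H_K ≥ |N_{K/ℚ}(A)| = A^{[K:ℚ]}`. -/
theorem pow_le_mulHeight_trinomialTriple {N A B : ℕ} (ξ : 𝓞 K)
    (hξ : ξ ^ N = (A : 𝓞 K) * ξ - B) (hN : 1 ≤ N) (hcop : Nat.Coprime A B) :
    ((A : ℝ)) ^ Module.finrank ℚ K ≤
      mulHeight ![(ξ : K) ^ (N - 1), -(A : K), (A : K) - (ξ : K) ^ (N - 1)] := by
  classical
  have h := abs_norm_le_mulHeight_of_span_eq_top (span_trinomialTriple_eq_top ξ hξ hN hcop) 1
  have hfun : (fun i => ((![ξ ^ (N - 1), -(A : 𝓞 K), (A : 𝓞 K) - ξ ^ (N - 1)] i : 𝓞 K) : K)) =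
      ![(ξ : K) ^ (N - 1), -(A : K), (A : K) - (ξ : K) ^ (N - 1)] := by
    funext i
    fin_cases i <;> simp
  rw [hfun] at h
  refine le_trans (le_of_eq ?_) h
  have hnorm : Algebra.norm ℚ ((-(A : 𝓞 K) : 𝓞 K) : K) = (-(A : ℚ)) ^ Module.finrank ℚ K := by
    have : ((-(A : 𝓞 K) : 𝓞 K) : K) = algebraMap ℚ K (-(A : ℚ)) := by simp
    rw [this, Algebra.norm_algebraMap]
  simp only [Matrix.cons_val_one, Matrix.cons_val_zero] at *
  rw [hnorm]
  push_cast
  rw [abs_pow, abs_neg, Nat.abs_cast]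

end HeightTrinomial

/-! ### The discriminant step, part 1: `|D_K| ≤ |disc(b)|` for any integral `ℚ`-basis `b` -/

section DiscrStep

variable {K : Type*} [Field K] [NumberField K]

/-- For a `ℚ`-basis `b` of `K` consisting of algebraic integers, `disc_ℚ(b) = d² · D_K` for a
nonzero integer `d` (the determinant of the matrix of `b` in an integral basis). [folklore] -/
theorem exists_discr_eq_sq_mul_discr {ι : Type*} [Fintype ι] [DecidableEq ι]
    (b : Module.Basis ι ℚ K) (hb : ∀ i, IsIntegral ℤ (b i)) :
    ∃ d : ℤ, d ≠ 0 ∧ Algebra.discr ℚ b = ((d : ℤ) : ℚ) ^ 2 * (NumberField.discr K : ℚ) := by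
  classical
  set e := (integralBasis K).indexEquiv b with he
  set b' : Module.Basis ι ℚ K := (integralBasis K).reindex e with hb'
  set x : ι → 𝓞 K := fun j => ⟨b j, hb j⟩ with hx
  have hxb : ∀ j, algebraMap (𝓞 K) K (x j) = b j := fun j => rfl
  set P₀ : Matrix ι ι ℤ := fun i j => (RingOfIntegers.basis K).repr (x j) (e.symm i) with hP₀
  have hP : b'.toMatrix b = P₀.map (Int.castRingHom ℚ) := by
    ext i j
    rw [Module.Basis.toMatrix_apply, hb', Module.Basis.repr_reindex, Matrix.map_apply,
      Finsupp.mapDomain_equiv_apply, ← hxb j, integralBasis_repr_apply]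
    rfl
  have hdetmap : (P₀.map (Int.castRingHom ℚ)).det = ((P₀.det : ℤ) : ℚ) := by
    rw [← RingHom.mapMatrix_apply, ← RingHom.map_det]; rfl
  have hdiscr : Algebra.discr ℚ b = ((P₀.det : ℤ) : ℚ) ^ 2 * (NumberField.discr K : ℚ) := by
    conv_lhs => rw [← b'.toMatrix_map_vecMul b]
    rw [Algebra.discr_of_matrix_vecMul, hP, hdetmap, coe_discr]
    congr 1
    rw [hb', Module.Basis.coe_reindex, Algebra.discr_reindex]
  have hne : Algebra.discr ℚ b ≠ 0 := Algebra.discr_not_zero_of_basis ℚ b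
  have hdet : P₀.det ≠ 0 := by
    intro h0
    apply hne
    rw [hdiscr, h0]
    simp
  exact ⟨P₀.det, hdet, hdiscr⟩

/-- For any `ℚ`-basis `b` of `K` consisting of algebraic integers, `|D_K| ≤ |disc_ℚ(b)|`.
[folklore] -/
theorem abs_discr_le_abs_discr_of_isIntegral {ι : Type*} [Fintype ι] [DecidableEq ι]
    (b : Module.Basis ι ℚ K) (hb : ∀ i, IsIntegral ℤ (b i)) :
    |((NumberField.discr K : ℤ) : ℚ)| ≤ |Algebra.discr ℚ b| := by
  obtain ⟨d, hd, hdiscr⟩ := exists_discr_eq_sq_mul_discr b hb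
  have hsq : (1 : ℚ) ≤ ((d : ℤ) : ℚ) ^ 2 := by
    have h1 : (1 : ℤ) ≤ |d| := Int.one_le_abs hd
    have h2 : (1 : ℤ) ≤ d ^ 2 := by nlinarith [sq_abs d]
    exact_mod_cast h2
  rw [hdiscr, abs_mul, abs_pow]
  calc |((NumberField.discr K : ℤ) : ℚ)| = 1 * |((NumberField.discr K : ℤ) : ℚ)| := (one_mul _).symm
    _ ≤ |((d : ℤ) : ℚ)| ^ 2 * |((NumberField.discr K : ℤ) : ℚ)| := by
        apply mul_le_mul_of_nonneg_right _ (abs_nonneg _)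
        rw [← abs_pow]
        exact le_trans hsq (le_abs_self _)

/-- If moreover `disc_ℚ(b)` is the integer `N`, then `D_K ∣ N`. [folklore] -/
theorem discr_dvd_of_isIntegral {ι : Type*} [Fintype ι] [DecidableEq ι]
    (b : Module.Basis ι ℚ K) (hb : ∀ i, IsIntegral ℤ (b i)) {N : ℤ}
    (hN : Algebra.discr ℚ b = (N : ℚ)) : NumberField.discr K ∣ N := by
  obtain ⟨d, -, hdiscr⟩ := exists_discr_eq_sq_mul_discr b hb
  refine ⟨d ^ 2, ?_⟩
  have : (N : ℚ) = ((NumberField.discr K * d ^ 2 : ℤ) : ℚ) := by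
    rw [← hN, hdiscr]; push_cast; ring
  exact_mod_cast this

end DiscrStep

/-! ### The quadratic base field `K = ℚ(ξ)`, `ξ² = 2vξ − u²` (Masser's trinomial with `n = 2`)

For `n = 2` Masser's polynomial `X^n − n ũ^{n-1} X + (n−1) u^n` is `X² − 2vX + u²`
(we write `v` for `ũ`). -/

section Quadratic

open Polynomial

/-- Masser's trinomial for `n = 2`: `X² − 2vX + u²` over `ℚ`. [cite: Masser2002, §3 (3.6)] -/
def masserQuad (u v : ℕ) : ℚ[X] := X ^ 2 - C (2 * (v : ℚ)) * X + C ((u : ℚ) ^ 2)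

/-- Auxiliary step (`masserQuad_natDegree`). [folklore] -/
theorem masserQuad_natDegree (u v : ℕ) : (masserQuad u v).natDegree = 2 := by
  unfold masserQuad; compute_degree!

/-- Auxiliary step (`masserQuad_monic`). [folklore] -/
theorem masserQuad_monic (u v : ℕ) : (masserQuad u v).Monic := by
  unfold masserQuad; monicity!

/-- Auxiliary step (`masserQuad_ne_zero`). [folklore] -/
theorem masserQuad_ne_zero (u v : ℕ) : masserQuad u v ≠ 0 := (masserQuad_monic u v).ne_zero

/-- Auxiliary step (`masserQuad_nextCoeff`). [folklore] -/
theorem masserQuad_nextCoeff (u v : ℕ) : (masserQuad u v).nextCoeff = -(2 * (v : ℚ)) := by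
  rw [nextCoeff_of_natDegree_pos (by rw [masserQuad_natDegree]; norm_num), masserQuad_natDegree]
  simp only [masserQuad, Nat.add_one_sub_one, coeff_add, coeff_sub, coeff_X_pow, coeff_C_mul,
    coeff_X_one, coeff_C_succ]
  norm_num

/-- The quadratic field `K = ℚ[X]/(X² − 2vX + u²)`. [folklore] -/
abbrev MasserQuadField (u v : ℕ) : Type := AdjoinRoot (masserQuad u v)

variable {u v : ℕ} [hirr : Fact (Irreducible (masserQuad u v))]

/-- The root `ξ` of `X² − 2vX + u²`. [folklore] -/
abbrev quadRoot (u v : ℕ) : MasserQuadField u v := AdjoinRoot.root (masserQuad u v)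

/-- Auxiliary step (`aeval_quadRoot`). [folklore] -/
theorem aeval_quadRoot :
    aeval (quadRoot u v) (X ^ 2 - C (2 * (v : ℚ)) * X + C ((u : ℚ) ^ 2)) = 0 := by
  have h := AdjoinRoot.mk_self (f := masserQuad u v)
  rw [← AdjoinRoot.aeval_eq] at h
  exact h

/-- Auxiliary step (`quadRoot_sq`). [folklore] -/
theorem quadRoot_sq :
    (quadRoot u v) ^ 2 = algebraMap ℚ _ (2 * (v : ℚ)) * quadRoot u v - algebraMap ℚ _ ((u : ℚ) ^ 2) := by
  have h := aeval_quadRoot (u := u) (v := v)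
  simp only [map_add, map_sub, map_mul, aeval_X_pow, aeval_X, aeval_C] at h
  rw [map_mul]
  linear_combination h

/-- `(ξ − v)² = v² − u²`. [folklore] -/
theorem quadRoot_sub_sq :
    (quadRoot u v - algebraMap ℚ _ (v : ℚ)) ^ 2 = algebraMap ℚ _ ((v : ℚ) ^ 2 - (u : ℚ) ^ 2) := by
  have h := quadRoot_sq (u := u) (v := v)
  simp only [map_sub, map_pow, map_mul, map_ofNat] at h ⊢
  linear_combination h

/-- Auxiliary step (`isIntegral_quadRoot`). [folklore] -/
theorem isIntegral_quadRoot : IsIntegral ℤ (quadRoot u v) := by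
  refine ⟨X ^ 2 - C (2 * (v : ℤ)) * X + C ((u : ℤ) ^ 2), by monicity!, ?_⟩
  have h := quadRoot_sq (u := u) (v := v)
  simp only [map_pow, map_mul, map_ofNat, map_natCast] at h
  simp only [eval₂_add, eval₂_sub, eval₂_mul, eval₂_X_pow, eval₂_X, eval₂_C]
  simp only [map_mul, map_pow, map_natCast, map_ofNat]
  linear_combination h

/-- `Tr_{K/ℚ}(ξ) = 2v`. [folklore] -/
theorem trace_quadRoot : Algebra.trace ℚ (MasserQuadField u v) (quadRoot u v) = 2 * (v : ℚ) := by
  have h := PowerBasis.trace_gen_eq_nextCoeff_minpoly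
    (AdjoinRoot.powerBasis (masserQuad_ne_zero u v))
  rw [AdjoinRoot.minpoly_powerBasis_gen_of_monic (masserQuad_monic u v),
    AdjoinRoot.powerBasis_gen, masserQuad_nextCoeff, neg_neg] at h
  exact h

/-- Auxiliary step (`finrank_masserQuadField`). [folklore] -/
theorem finrank_masserQuadField : Module.finrank ℚ (MasserQuadField u v) = 2 := by
  rw [PowerBasis.finrank (AdjoinRoot.powerBasis (masserQuad_ne_zero u v)),
    AdjoinRoot.powerBasis_dim, masserQuad_natDegree]

/-- The root `ξ` is irrational (the defining quadratic is irreducible). [folklore] -/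
theorem quadRoot_ne_algebraMap (q : ℚ) : quadRoot u v ≠ algebraMap ℚ _ q := by
  intro hq
  have h := aeval_quadRoot (u := u) (v := v)
  rw [hq, aeval_algebraMap_apply,
    map_eq_zero_iff _ (algebraMap ℚ (MasserQuadField u v)).injective] at h
  have hroot : (masserQuad u v).IsRoot q := h
  have hdeg := degree_eq_one_of_irreducible_of_root hirr.out hroot
  have h2 : (masserQuad u v).degree = 2 := by
    rw [degree_eq_natDegree (masserQuad_ne_zero u v), masserQuad_natDegree]; rfl
  rw [h2] at hdeg
  exact absurd hdeg (by decide)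

variable (u v) in
/-- The integral element `ω' = (ξ − v)/M` (for `M² ∣ v² − u²`), realising the index `M` of
`ℤ[ξ]`; this replaces Hensel's bound on the `2`-part of `D_K` in [cite: Masser2002, §3 (3.9)]. -/
def quadOmega (M : ℕ) : MasserQuadField u v :=
  algebraMap ℚ _ ((M : ℚ)⁻¹) * (quadRoot u v - algebraMap ℚ _ (v : ℚ))

/-- Auxiliary step (`quadOmega_sq`). [folklore] -/
theorem quadOmega_sq {M : ℕ} :
    (quadOmega u v M) ^ 2 = algebraMap ℚ _ (((v : ℚ) ^ 2 - (u : ℚ) ^ 2) / (M : ℚ) ^ 2) := by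
  unfold quadOmega
  rw [mul_pow, quadRoot_sub_sq, ← map_pow, ← map_mul]
  congr 1
  field_simp

/-- Auxiliary step (`quadRoot_eq_quadOmega`). [folklore] -/
theorem quadRoot_eq_quadOmega {M : ℕ} (hM : M ≠ 0) :
    quadRoot u v = algebraMap ℚ _ (M : ℚ) * quadOmega u v M + algebraMap ℚ _ (v : ℚ) := by
  unfold quadOmega
  rw [← mul_assoc, ← map_mul, mul_inv_cancel₀ (by exact_mod_cast hM), map_one, one_mul]
  ring

/-- Auxiliary step (`isIntegral_quadOmega`). [folklore] -/
theorem isIntegral_quadOmega {M : ℕ} {c : ℤ}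
    (hc : (c : ℚ) = ((v : ℚ) ^ 2 - (u : ℚ) ^ 2) / (M : ℚ) ^ 2) :
    IsIntegral ℤ (quadOmega u v M) := by
  refine ⟨X ^ 2 - C c, by monicity!, ?_⟩
  simp only [eval₂_sub, eval₂_X_pow, eval₂_C, quadOmega_sq, ← hc]
  rw [sub_eq_zero]
  exact (IsScalarTower.algebraMap_apply ℤ ℚ (MasserQuadField u v) c).symm ▸ rfl

/-- `1, ω'` are linearly independent over `ℚ`. [folklore] -/
theorem linearIndependent_one_quadOmega {M : ℕ} (hM : M ≠ 0) :
    LinearIndependent ℚ ![(1 : MasserQuadField u v), quadOmega u v M] := by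
  rw [LinearIndependent.pair_iff]
  intro s t hst
  by_cases ht : t = 0
  · subst ht
    simp only [zero_smul, add_zero, smul_eq_zero, one_ne_zero, or_false] at hst
    exact ⟨hst, rfl⟩
  · exfalso
    have hω : quadOmega u v M = algebraMap ℚ _ (-s / t) := by
      have : t • quadOmega u v M = -(s • (1 : MasserQuadField u v)) := by
        linear_combination hst
      rw [Algebra.smul_def, Algebra.smul_def, mul_one] at this
      rw [map_div₀, map_neg, eq_div_iff (by simpa using ht), mul_comm]
      exact this
    apply quadRoot_ne_algebraMap (u := u) (v := v) ((M : ℚ) * (-s / t) + v)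
    rw [quadRoot_eq_quadOmega hM, hω, map_add, map_mul]

/-- The `ℚ`-basis `(1, ω')` of `K`. [folklore] -/
def quadBasis {M : ℕ} (hM : M ≠ 0) : Module.Basis (Fin 2) ℚ (MasserQuadField u v) :=
  basisOfLinearIndependentOfCardEqFinrank (linearIndependent_one_quadOmega hM)
    (by rw [finrank_masserQuadField]; simp)

/-- Auxiliary step (`quadBasis_apply_zero`). [folklore] -/
theorem quadBasis_apply_zero {M : ℕ} (hM : M ≠ 0) : quadBasis (u := u) (v := v) hM 0 = 1 := by
  simp [quadBasis]

/-- Auxiliary step (`quadBasis_apply_one`). [folklore] -/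
theorem quadBasis_apply_one {M : ℕ} (hM : M ≠ 0) :
    quadBasis (u := u) (v := v) hM 1 = quadOmega u v M := by
  simp [quadBasis]

/-- `Tr(ω') = 0`. [folklore] -/
theorem trace_quadOmega {M : ℕ} :
    Algebra.trace ℚ (MasserQuadField u v) (quadOmega u v M) = 0 := by
  unfold quadOmega
  rw [← Algebra.smul_def, LinearMap.map_smul, map_sub, trace_quadRoot, Algebra.trace_algebraMap,
    finrank_masserQuadField]
  simp

/-- `disc_ℚ(1, ω') = 4 (v² − u²)/M²`. [folklore] -/
theorem discr_quadBasis {M : ℕ} (hM : M ≠ 0) :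
    Algebra.discr ℚ (quadBasis (u := u) (v := v) hM) =
      4 * (((v : ℚ) ^ 2 - (u : ℚ) ^ 2) / (M : ℚ) ^ 2) := by
  rw [Algebra.discr_def, Matrix.det_fin_two]
  simp only [Algebra.traceMatrix_apply, Algebra.traceForm_apply, quadBasis_apply_zero,
    quadBasis_apply_one, one_mul, mul_one, trace_quadOmega]
  rw [← pow_two, quadOmega_sq, Algebra.trace_algebraMap, finrank_masserQuadField]
  have h1 : Algebra.trace ℚ (MasserQuadField u v) 1 = 2 := by
    rw [← map_one (algebraMap ℚ (MasserQuadField u v)), Algebra.trace_algebraMap,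
      finrank_masserQuadField]
    simp
  rw [h1]
  simp
  ring

/-- **Discriminant step for `n = 2`** (replacing [cite: Masser2002, §3 (3.9)]): if
`M² ∣ v² − u²` then `|D_K| ≤ 4 (v² − u²) / M²`. -/
theorem abs_discr_masserQuadField_le {M : ℕ} (hM : M ≠ 0) {c : ℤ}
    (hc : (c : ℚ) = ((v : ℚ) ^ 2 - (u : ℚ) ^ 2) / (M : ℚ) ^ 2) :
    |((NumberField.discr (MasserQuadField u v) : ℤ) : ℚ)| ≤ 4 * |(c : ℚ)| := by
  classical
  have hint : ∀ i, IsIntegral ℤ (quadBasis (u := u) (v := v) hM i) := by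
    intro i
    fin_cases i
    · rw [show ((⟨0, by norm_num⟩ : Fin 2)) = 0 from rfl, quadBasis_apply_zero]
      exact isIntegral_one
    · rw [show ((⟨1, by norm_num⟩ : Fin 2)) = 1 from rfl, quadBasis_apply_one]
      exact isIntegral_quadOmega hc
  refine le_trans (abs_discr_le_abs_discr_of_isIntegral _ hint) ?_
  rw [discr_quadBasis hM, ← hc, abs_mul]
  norm_num

/-- `D_K ∣ 4 (v² − u²)/M²` when `M² ∣ v² − u²`. [folklore] -/
theorem discr_masserQuadField_dvd {M : ℕ} (hM : M ≠ 0) {c : ℤ}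
    (hc : (c : ℚ) = ((v : ℚ) ^ 2 - (u : ℚ) ^ 2) / (M : ℚ) ^ 2) :
    NumberField.discr (MasserQuadField u v) ∣ 4 * c := by
  classical
  have hint : ∀ i, IsIntegral ℤ (quadBasis (u := u) (v := v) hM i) := by
    intro i
    fin_cases i
    · rw [show ((⟨0, by norm_num⟩ : Fin 2)) = 0 from rfl, quadBasis_apply_zero]
      exact isIntegral_one
    · rw [show ((⟨1, by norm_num⟩ : Fin 2)) = 1 from rfl, quadBasis_apply_one]
      exact isIntegral_quadOmega hc
  refine discr_dvd_of_isIntegral _ hint ?_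
  rw [discr_quadBasis hM, ← hc]
  push_cast
  ring

end Quadratic

/-! ### Base change: `X^e − r` is irreducible over `K` for a prime `r ∤ D_K` -/

section BaseChange

open Polynomial UniqueFactorizationMonoid

variable {K : Type*} [Field K] [NumberField K]

/-- If the rational prime `r` does not divide `D_K`, then `r ∉ 𝔯²` for every prime `𝔯 ∣ r` of
`𝓞 K` (`r` is unramified). [folklore] -/
theorem natCast_notMem_sq_of_not_dvd_discr {r : ℕ} (hr : r.Prime)
    (hrD : ¬ (r : ℤ) ∣ NumberField.discr K) (P : Ideal (𝓞 K)) [hP : P.IsPrime]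
    (hrP : (r : 𝓞 K) ∈ P) : (r : 𝓞 K) ∉ P ^ 2 := by
  classical
  have hrZ : Prime (r : ℤ) := Nat.prime_iff_prime_int.mp hr
  have hunr : Algebra.IsUnramifiedAt ℤ P :=
    (NumberField.not_dvd_discr_iff_forall_mem K (𝓞 K) hrZ).mp hrD P hP
      (by simpa using hrP)
  have hP0 : P ≠ ⊥ := by
    intro h; rw [h] at hrP
    simp only [Ideal.mem_bot, Nat.cast_eq_zero] at hrP
    exact hr.ne_zero hrP
  have he1 : P.ramificationIdx ℤ = 1 := Ideal.ramificationIdx_eq_one P ℤ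
  have hunder : P.under ℤ = Ideal.span {(r : ℤ)} := by
    have hmax : (Ideal.span {(r : ℤ)}).IsMaximal :=
      ((Ideal.span_singleton_prime hrZ.ne_zero).mpr hrZ).isMaximal (by simpa using hrZ.ne_zero)
    refine (hmax.eq_of_le (Ideal.IsPrime.under ℤ P).ne_top ?_).symm
    rw [Ideal.span_singleton_le_iff_mem, Ideal.mem_comap]
    simpa using hrP
  haveI : P.LiesOver (Ideal.span {(r : ℤ)}) := ⟨hunder.symm⟩
  have hmap : (Ideal.span {(r : ℤ)}).map (algebraMap ℤ (𝓞 K)) = Ideal.span {(r : 𝓞 K)} := by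
    rw [Ideal.map_span, Set.image_singleton, map_natCast]
  have hI0 : Ideal.span {(r : 𝓞 K)} ≠ ⊥ := by
    simpa [Ideal.span_singleton_eq_bot] using hr.ne_zero
  have hp0 : (Ideal.span {(r : ℤ)}).map (algebraMap ℤ (𝓞 K)) ≠ ⊥ := by rwa [hmap]
  have hcount : (normalizedFactors (Ideal.span {(r : 𝓞 K)})).count P = 1 := by
    rw [← hmap, ← Ideal.IsDedekindDomain.ramificationIdx_eq_normalizedFactors_count
      (Ideal.span {(r : ℤ)}) P hp0, he1]
  intro hmem
  have hdvd : P ^ 2 ∣ Ideal.span {(r : 𝓞 K)} :=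
    Ideal.dvd_iff_le.mpr ((Ideal.span_singleton_le_iff_mem _).mpr hmem)
  rw [dvd_iff_normalizedFactors_le_normalizedFactors (pow_ne_zero _ hP0) hI0,
    normalizedFactors_pow,
    normalizedFactors_irreducible (Ideal.prime_of_isPrime hP0 hP).irreducible,
    normalize_eq] at hdvd
  have := Multiset.count_le_of_le P hdvd
  rw [hcount, Multiset.count_nsmul, Multiset.count_singleton_self] at this
  omega

/-- The polynomial `X^e − r` over `𝓞 K`. [folklore] -/
def rootPoly (K : Type*) [Field K] [NumberField K] (e r : ℕ) : (𝓞 K)[X] := X ^ e - C (r : 𝓞 K)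

/-- Auxiliary step (`rootPoly_monic`). [folklore] -/
theorem rootPoly_monic {e r : ℕ} (he : 1 ≤ e) : (rootPoly K e r).Monic := by
  unfold rootPoly
  exact monic_X_pow_sub_C _ (by omega)

/-- **Eisenstein**: for a prime `r ∤ D_K` and `e ≥ 1`, `X^e − r` is irreducible over `𝓞 K`. [folklore] -/
theorem irreducible_rootPoly {e r : ℕ} (he : 1 ≤ e) (hr : r.Prime)
    (hrD : ¬ (r : ℤ) ∣ NumberField.discr K) : Irreducible (rootPoly K e r) := by
  classical
  -- a prime of `𝓞 K` above `r`
  have hnu : Ideal.span {(r : 𝓞 K)} ≠ ⊤ := by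
    intro htop
    have h1 : Ideal.absNorm (Ideal.span {(r : 𝓞 K)}) = 1 := by rw [htop, Ideal.absNorm_top]
    rw [Ideal.absNorm_span_natCast] at h1
    have hpos : 0 < Module.finrank ℤ (𝓞 K) := by
      rw [RingOfIntegers.rank]; exact Module.finrank_pos
    rcases pow_eq_one_iff.mp h1 with h | h
    · exact hr.one_lt.ne' h
    · exact (Nat.ne_of_gt hpos) h
  obtain ⟨P, hPmax, hle⟩ := Ideal.exists_le_maximal _ hnu
  haveI : P.IsPrime := hPmax.isPrime
  have hrP : (r : 𝓞 K) ∈ P := hle (Ideal.mem_span_singleton_self _)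
  have hrP2 : (r : 𝓞 K) ∉ P ^ 2 := natCast_notMem_sq_of_not_dvd_discr hr hrD P hrP
  have hdeg : (rootPoly K e r).natDegree = e := by
    unfold rootPoly; rw [natDegree_X_pow_sub_C]
  have heis : (rootPoly K e r).IsEisensteinAt P := by
    refine ⟨?_, ?_, ?_⟩
    · rw [(rootPoly_monic he).leadingCoeff]
      exact (Ideal.ne_top_iff_one P).mp hPmax.ne_top
    · intro n hn
      rw [hdeg] at hn
      unfold rootPoly
      rw [coeff_sub, coeff_X_pow, coeff_C]
      by_cases hn0 : n = 0
      · subst hn0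
        rw [if_neg (by omega), if_pos rfl, zero_sub]
        exact P.neg_mem hrP
      · rw [if_neg (by omega), if_neg hn0, sub_zero]
        exact P.zero_mem
    · unfold rootPoly
      rw [coeff_sub, coeff_X_pow, coeff_C, if_neg (by omega), if_pos rfl, zero_sub]
      intro hmem
      exact hrP2 (by simpa using (P ^ 2).neg_mem hmem)
  exact heis.irreducible hPmax.isPrime (rootPoly_monic he).isPrimitive
    (by rw [hdeg]; omega)

variable (K) in
/-- `X^e − r` over `K`. [folklore] -/
abbrev rootPolyK (e r : ℕ) : K[X] := (rootPoly K e r).map (algebraMap (𝓞 K) K)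

/-- Auxiliary step (`rootPolyK_eq`). [folklore] -/
theorem rootPolyK_eq (e r : ℕ) : rootPolyK K e r = X ^ e - C (r : K) := by
  simp [rootPolyK, rootPoly, Polynomial.map_sub, Polynomial.map_pow, map_natCast]

/-- Auxiliary step (`irreducible_rootPolyK`). [folklore] -/
theorem irreducible_rootPolyK {e r : ℕ} (he : 1 ≤ e) (hr : r.Prime)
    (hrD : ¬ (r : ℤ) ∣ NumberField.discr K) : Irreducible (rootPolyK K e r) :=
  ((rootPoly_monic (K := K) he).irreducible_iff_irreducible_map_fraction_map).mp
    (irreducible_rootPoly he hr hrD)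

/-- Auxiliary step (`rootPolyK_monic`). [folklore] -/
theorem rootPolyK_monic {e r : ℕ} (he : 1 ≤ e) : (rootPolyK K e r).Monic :=
  (rootPoly_monic he).map _

/-- Auxiliary step (`rootPolyK_natDegree`). [folklore] -/
theorem rootPolyK_natDegree {e r : ℕ} : (rootPolyK K e r).natDegree = e := by
  rw [rootPolyK_eq, natDegree_X_pow_sub_C]

variable (K) in
/-- The base-changed field `L = K(r^{1/e}) = K[X]/(X^e − r)`. [folklore] -/
abbrev BaseChangeField (e r : ℕ) : Type _ := AdjoinRoot (rootPolyK K e r)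

section Instances

variable {e r : ℕ} [hirr : Fact (Irreducible (rootPolyK K e r))]

/-- Instance for the base-changed field. [folklore] -/
instance : CharZero (BaseChangeField K e r) :=
  charZero_of_injective_algebraMap (algebraMap K (BaseChangeField K e r)).injective

/-- Instance for the base-changed field. [folklore] -/
instance : Module.Finite K (BaseChangeField K e r) :=
  (AdjoinRoot.powerBasis hirr.out.ne_zero).finite

/-- Instance for the base-changed field. [folklore] -/
instance : IsScalarTower ℚ K (BaseChangeField K e r) := inferInstance

/-- Instance for the base-changed field. [folklore] -/
instance : NumberField (BaseChangeField K e r) where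
  to_charZero := inferInstance
  to_finiteDimensional := Module.Finite.trans K (BaseChangeField K e r)

/-- Auxiliary step (`finrank_baseChangeField`). [folklore] -/
theorem finrank_baseChangeField :
    Module.finrank ℚ (BaseChangeField K e r) = Module.finrank ℚ K * e := by
  rw [← Module.finrank_mul_finrank ℚ K (BaseChangeField K e r),
    PowerBasis.finrank (AdjoinRoot.powerBasis hirr.out.ne_zero), AdjoinRoot.powerBasis_dim,
    rootPolyK_natDegree]

end Instances

section Discriminant

variable {e r : ℕ} [hirr : Fact (Irreducible (rootPolyK K e r))]

/-- The generator `η = r^{1/e}` of `L/K`. [folklore] -/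
abbrev bcRoot (K : Type*) [Field K] [NumberField K] (e r : ℕ)
    [Fact (Irreducible (rootPolyK K e r))] : BaseChangeField K e r :=
  AdjoinRoot.root (rootPolyK K e r)

/-- Auxiliary step (`bcRoot_pow`). [folklore] -/
theorem bcRoot_pow : (bcRoot K e r) ^ e = algebraMap K _ (r : K) := by
  have h : aeval (bcRoot K e r) (X ^ e - C (r : K)) = 0 := by
    rw [← rootPolyK_eq, AdjoinRoot.aeval_eq, AdjoinRoot.mk_self]
  simp only [map_sub, aeval_X_pow, aeval_C] at h
  exact sub_eq_zero.mp h

/-- Auxiliary step (`isIntegral_bcRoot`). [folklore] -/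
theorem isIntegral_bcRoot (he : 1 ≤ e) : IsIntegral ℤ (bcRoot K e r) := by
  refine ⟨X ^ e - C (r : ℤ), monic_X_pow_sub_C _ (by omega), ?_⟩
  simp only [eval₂_sub, eval₂_X_pow, eval₂_C]
  rw [bcRoot_pow, sub_eq_zero]
  simp

/-- `η` as an algebraic integer. [folklore] -/
def bcRootInt (he : 1 ≤ e) : 𝓞 (BaseChangeField K e r) := ⟨bcRoot K e r, isIntegral_bcRoot he⟩

/-- Auxiliary step (`bcRootInt_coe`). [folklore] -/
theorem bcRootInt_coe (he : 1 ≤ e) :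
    ((bcRootInt (K := K) (r := r) he : 𝓞 (BaseChangeField K e r)) : BaseChangeField K e r) =
      bcRoot K e r := rfl

/-- Auxiliary step (`aeval_bcRootInt_rootPoly`). [folklore] -/
theorem aeval_bcRootInt_rootPoly (he : 1 ≤ e) :
    aeval (bcRootInt (K := K) (r := r) he) (rootPoly K e r) = 0 := by
  simp only [rootPoly, map_sub, aeval_X_pow, map_natCast]
  rw [sub_eq_zero]
  apply RingOfIntegers.ext
  simp only [bcRootInt, map_pow, RingOfIntegers.map_mk, map_natCast]
  rw [bcRoot_pow]
  simp

/-- Auxiliary step (`minpoly_bcRoot`). [folklore] -/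
theorem minpoly_bcRoot (he : 1 ≤ e) : minpoly K (bcRoot K e r) = rootPolyK K e r := by
  have h := AdjoinRoot.minpoly_powerBasis_gen_of_monic (K := K) (rootPolyK_monic (r := r) he)
    (hirr.out.ne_zero)
  rwa [AdjoinRoot.powerBasis_gen] at h

/-- Auxiliary step (`minpoly_bcRootInt`). [folklore] -/
theorem minpoly_bcRootInt (he : 1 ≤ e) :
    minpoly (𝓞 K) (bcRootInt (K := K) (r := r) he) = rootPoly K e r := by
  apply Polynomial.map_injective (algebraMap (𝓞 K) K) (FaithfulSMul.algebraMap_injective _ _)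
  rw [← minpoly.isIntegrallyClosed_eq_field_fractions K (BaseChangeField K e r)
    (IsIntegral.of_finite (𝓞 K) (bcRootInt (K := K) (r := r) he))]
  exact minpoly_bcRoot he

omit hirr in
/-- Auxiliary step (`rootPolyK_coeff_zero`). [folklore] -/
theorem rootPolyK_coeff_zero (he : 1 ≤ e) : (rootPolyK K e r).coeff 0 = -(r : K) := by
  rw [rootPolyK_eq, coeff_sub, coeff_X_pow, coeff_C_zero, if_neg (by omega), zero_sub]

/-- `N_{L/K}(η) = (−1)^{e+1} r`. [folklore] -/
theorem norm_bcRoot (he : 1 ≤ e) :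
    Algebra.norm K (bcRoot K e r) = (-1) ^ (e + 1) * (r : K) := by
  have h := Algebra.PowerBasis.norm_gen_eq_coeff_zero_minpoly
    (AdjoinRoot.powerBasis (K := K) (hirr.out.ne_zero))
  rw [AdjoinRoot.powerBasis_gen, AdjoinRoot.powerBasis_dim, rootPolyK_natDegree,
    minpoly_bcRoot he, rootPolyK_coeff_zero he] at h
  rw [h, pow_succ]
  ring

/-- `|N_{L/ℚ}(η)| = r^{[K:ℚ]}`. [folklore] -/
theorem abs_norm_bcRoot (he : 1 ≤ e) :
    |Algebra.norm ℚ (bcRoot K e r)| = (r : ℚ) ^ Module.finrank ℚ K := by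
  rw [← Algebra.norm_norm (S := K), norm_bcRoot he]
  have : ((-1) ^ (e + 1) * (r : K)) = algebraMap ℚ K ((-1) ^ (e + 1) * (r : ℚ)) := by simp
  rw [this, Algebra.norm_algebraMap, abs_pow, abs_mul, abs_pow, abs_neg, abs_one, one_pow,
    one_mul, Nat.abs_cast]

/-- Auxiliary step (`finrank_K_baseChangeField`). [folklore] -/
theorem finrank_K_baseChangeField : Module.finrank K (BaseChangeField K e r) = e := by
  rw [PowerBasis.finrank (AdjoinRoot.powerBasis hirr.out.ne_zero), AdjoinRoot.powerBasis_dim,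
    rootPolyK_natDegree]

/-- The element `e η^{e-1} = g'(η)` of `𝓞 L` lies in the relative different `𝔇_{L/K}`. [folklore] -/
theorem mem_differentIdeal_baseChange (he : 1 ≤ e) :
    ((e : 𝓞 (BaseChangeField K e r)) * (bcRootInt (K := K) (r := r) he) ^ (e - 1)) ∈
      differentIdeal (𝓞 K) (𝓞 (BaseChangeField K e r)) := by
  have hx : Algebra.adjoin K {algebraMap (𝓞 (BaseChangeField K e r)) (BaseChangeField K e r)
      (bcRootInt (K := K) (r := r) he)} = ⊤ := by
    change Algebra.adjoin K {bcRoot K e r} = ⊤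
    exact AdjoinRoot.adjoinRoot_eq_top
  have hmem := aeval_derivative_mem_differentIdeal (𝓞 K) K (BaseChangeField K e r)
    (bcRootInt (K := K) (r := r) he) hx
  rw [minpoly_bcRootInt he] at hmem
  unfold rootPoly at hmem
  rw [derivative_sub, derivative_X_pow, derivative_C, sub_zero] at hmem
  simpa [map_natCast] using hmem

/-- `|N_{L/ℚ}(e η^{e-1})| = e^{[L:ℚ]} r^{[K:ℚ](e-1)}`. [folklore] -/
theorem natAbs_norm_derivative_baseChange (he : 1 ≤ e) :
    (Algebra.norm ℤ ((e : 𝓞 (BaseChangeField K e r)) *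
        (bcRootInt (K := K) (r := r) he) ^ (e - 1))).natAbs =
      e ^ Module.finrank ℚ (BaseChangeField K e r) * r ^ (Module.finrank ℚ K * (e - 1)) := by
  have hq : ((Algebra.norm ℤ ((e : 𝓞 (BaseChangeField K e r)) *
        (bcRootInt (K := K) (r := r) he) ^ (e - 1))).natAbs : ℚ) =
      ((e ^ Module.finrank ℚ (BaseChangeField K e r) * r ^ (Module.finrank ℚ K * (e - 1)) : ℕ) : ℚ) := by
    rw [Nat.cast_natAbs, Int.cast_abs, Algebra.coe_norm_int]
    push_cast
    simp only [bcRootInt, RingOfIntegers.map_mk]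
    rw [map_mul, map_pow, abs_mul, abs_pow, abs_norm_bcRoot he, ← pow_mul]
    have : ((e : BaseChangeField K e r)) = algebraMap ℚ (BaseChangeField K e r) (e : ℚ) := by simp
    rw [this, Algebra.norm_algebraMap, abs_pow, Nat.abs_cast]
  exact_mod_cast hq

/-- `N(𝔇_{L/K}) ≤ e^{[L:ℚ]} r^{[K:ℚ](e-1)}`. [folklore] -/
theorem absNorm_differentIdeal_baseChange_le (he : 1 ≤ e) (hr : r.Prime) :
    Ideal.absNorm (differentIdeal (𝓞 K) (𝓞 (BaseChangeField K e r))) ≤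
      e ^ Module.finrank ℚ (BaseChangeField K e r) * r ^ (Module.finrank ℚ K * (e - 1)) := by
  set δ : 𝓞 (BaseChangeField K e r) :=
    (e : 𝓞 (BaseChangeField K e r)) * (bcRootInt (K := K) (r := r) he) ^ (e - 1) with hδ
  have hmem : δ ∈ differentIdeal (𝓞 K) (𝓞 (BaseChangeField K e r)) :=
    mem_differentIdeal_baseChange he
  have hdvd := Ideal.absNorm_dvd_absNorm_of_le
    ((Ideal.span_singleton_le_iff_mem _).mpr hmem)
  rw [Ideal.absNorm_span_singleton, hδ, natAbs_norm_derivative_baseChange he] at hdvd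
  refine Nat.le_of_dvd ?_ hdvd
  have he0 : 0 < e := he
  have hr0 : 0 < r := hr.pos
  positivity

/-- **Discriminant of the base change**: `|D_L| ≤ e^{[L:ℚ]} r^{[K:ℚ](e-1)} |D_K|^e`. [folklore] -/
theorem natAbs_discr_baseChangeField_le (he : 1 ≤ e) (hr : r.Prime) :
    (NumberField.discr (BaseChangeField K e r)).natAbs ≤
      e ^ Module.finrank ℚ (BaseChangeField K e r) * r ^ (Module.finrank ℚ K * (e - 1)) *
        (NumberField.discr K).natAbs ^ e := by
  rw [NumberField.natAbs_discr_eq_absNorm_differentIdeal_mul_natAbs_discr_pow K (𝓞 K)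
    (BaseChangeField K e r) (𝓞 (BaseChangeField K e r)), finrank_K_baseChangeField]
  exact Nat.mul_le_mul_right _ (absNorm_differentIdeal_baseChange_le he hr)

end Discriminant

end BaseChange

/-! ### The algebraic core: a field of degree `n = 2e` with Masser's triple -/

section Core

open Polynomial

/-- **Masser's triple, packaged**: in a number field `L`, an algebraic integer `ξ` with
`ξ^N = Aξ − B`, `gcd(A,B) = 1`, `A, B ≠ 0`, gives nonzero `a, b, c` with `a + b + c = 0`,
`H_L(a,b,c) ≥ A^{[L:ℚ]}` and `S_L(a,b,c) ≤ rad(AB)^{[L:ℚ]}`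
(`(a,b,c) = (ξ^N, −Aξ, B)/ξ`). [cite: Masser2002, §3 (3.7)–(3.8)] -/
theorem exists_masserTriple {L : Type*} [Field L] [NumberField L] {N A B : ℕ} (ξ : 𝓞 L)
    (hξ : ξ ^ N = (A : 𝓞 L) * ξ - B) (hN : 1 ≤ N) (hcop : Nat.Coprime A B) (hA : A ≠ 0)
    (hB : B ≠ 0) :
    ∃ a b c : L, a ≠ 0 ∧ b ≠ 0 ∧ c ≠ 0 ∧ a + b + c = 0 ∧
      ((A : ℝ)) ^ Module.finrank ℚ L ≤ mulHeight ![a, b, c] ∧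
      masserSupport a b c ≤ (∏ p ∈ (A * B).primeFactors, p) ^ Module.finrank ℚ L := by
  have hfac : (B : 𝓞 L) = ξ * ((A : 𝓞 L) - ξ ^ (N - 1)) := by
    have : ξ ^ N = ξ * ξ ^ (N - 1) := by
      rw [← pow_succ']; congr 1; omega
    rw [mul_sub, ← this, hξ]; ring
  have hB' : (B : 𝓞 L) ≠ 0 := by exact_mod_cast hB
  have hξ0 : ξ ≠ 0 := by
    intro h; apply hB'; rw [hfac, h, zero_mul]
  have hc0 : (A : 𝓞 L) - ξ ^ (N - 1) ≠ 0 := by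
    intro h; apply hB'; rw [hfac, h, mul_zero]
  refine ⟨(ξ : L) ^ (N - 1), -(A : L), (A : L) - (ξ : L) ^ (N - 1), ?_, ?_, ?_, by ring,
    pow_le_mulHeight_trinomialTriple ξ hξ hN hcop, masserSupport_trinomial_le ξ hξ hN hA hB⟩
  · exact pow_ne_zero _ (by exact_mod_cast hξ0)
  · simp only [ne_eq, neg_eq_zero, Nat.cast_eq_zero]; exact hA
  · have : (((A : 𝓞 L) - ξ ^ (N - 1) : 𝓞 L) : L) ≠ 0 := by exact_mod_cast hc0
    simpa using this

/-- In any number field containing an algebraic integer root of `X² − 2vX + u²` we get Masser's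
triple for `n = 2` with `A = 2v`, `B = u²`. [folklore] -/
theorem exists_masserTriple_quad {L : Type*} [Field L] [NumberField L] {u v : ℕ} (hu : 0 < u)
    (hv : 0 < v) (hcop : Nat.Coprime (2 * v) (u ^ 2)) (ξ : 𝓞 L)
    (hξ : ξ ^ 2 = ((2 * v : ℕ) : 𝓞 L) * ξ - ((u ^ 2 : ℕ) : 𝓞 L)) :
    ∃ a b c : L, a ≠ 0 ∧ b ≠ 0 ∧ c ≠ 0 ∧ a + b + c = 0 ∧
      ((2 * v : ℕ) : ℝ) ^ Module.finrank ℚ L ≤ mulHeight ![a, b, c] ∧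
      masserSupport a b c ≤ (∏ p ∈ (2 * v * u ^ 2).primeFactors, p) ^ Module.finrank ℚ L :=
  exists_masserTriple (N := 2) ξ hξ (by norm_num) hcop (by omega) (by positivity)

section EvenCore

variable {u v e r : ℕ}

/-- Even core, generic case: `X² − 2vX + u²` irreducible, `L = K(r^{1/e})`. [folklore] -/
theorem exists_field_even_core_irred (hu : 0 < u) (hv : 0 < v) (hcop : Nat.Coprime (2 * v) (u ^ 2))
    (he : 1 ≤ e) (hr : r.Prime) [Fact (Irreducible (masserQuad u v))]
    [Fact (Irreducible (rootPolyK (MasserQuadField u v) e r))] :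
    Module.finrank ℚ (BaseChangeField (MasserQuadField u v) e r) = 2 * e ∧
    (NumberField.discr (BaseChangeField (MasserQuadField u v) e r)).natAbs ≤
      e ^ (2 * e) * r ^ (2 * (e - 1)) * (NumberField.discr (MasserQuadField u v)).natAbs ^ e ∧
    ∃ a b c : BaseChangeField (MasserQuadField u v) e r, a ≠ 0 ∧ b ≠ 0 ∧ c ≠ 0 ∧ a + b + c = 0 ∧
      ((2 * v : ℕ) : ℝ) ^ (2 * e) ≤ mulHeight ![a, b, c] ∧
      masserSupport a b c ≤ (∏ p ∈ (2 * v * u ^ 2).primeFactors, p) ^ (2 * e) := by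
  set ξK : 𝓞 (MasserQuadField u v) := ⟨quadRoot u v, isIntegral_quadRoot⟩ with hξKdef
  have hξK : ξK ^ 2 = ((2 * v : ℕ) : 𝓞 (MasserQuadField u v)) * ξK -
      ((u ^ 2 : ℕ) : 𝓞 (MasserQuadField u v)) := by
    apply RingOfIntegers.ext
    simp only [hξKdef, map_pow, RingOfIntegers.map_mk, map_sub, map_mul, map_natCast]
    have h := quadRoot_sq (u := u) (v := v)
    simp only [map_mul, map_ofNat, map_natCast, map_pow] at h
    push_cast
    exact h
  set ξ : 𝓞 (BaseChangeField (MasserQuadField u v) e r) :=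
    algebraMap (𝓞 (MasserQuadField u v)) (𝓞 (BaseChangeField (MasserQuadField u v) e r)) ξK
    with hξdef
  have hξ : ξ ^ 2 = ((2 * v : ℕ) : 𝓞 (BaseChangeField (MasserQuadField u v) e r)) * ξ -
      ((u ^ 2 : ℕ) : 𝓞 (BaseChangeField (MasserQuadField u v) e r)) := by
    rw [hξdef, ← map_pow, hξK]
    simp only [map_sub, map_mul, map_natCast]
  have hfin : Module.finrank ℚ (BaseChangeField (MasserQuadField u v) e r) = 2 * e := by
    rw [finrank_baseChangeField, finrank_masserQuadField]
  obtain ⟨a, b, c, ha, hb, hc, habc, hH, hS⟩ := exists_masserTriple_quad hu hv hcop ξ hξ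
  rw [hfin] at hH hS
  refine ⟨hfin, ?_, a, b, c, ha, hb, hc, habc, hH, hS⟩
  have hD := natAbs_discr_baseChangeField_le (K := MasserQuadField u v) (e := e) (r := r) he hr
  rwa [finrank_baseChangeField, finrank_masserQuadField] at hD

/-- Even core, degenerate case: in `L = ℚ(2^{1/n})` with an (integral) rational root `q` of
`X² − 2vX + u²`. [folklore] -/
theorem exists_field_even_core_rat (hu : 0 < u) (hv : 0 < v) (hcop : Nat.Coprime (2 * v) (u ^ 2))
    {n : ℕ} (hn : 1 ≤ n) {q : ℚ} (hqeq : q ^ 2 = 2 * (v : ℚ) * q - (u : ℚ) ^ 2)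
    [Fact (Irreducible (rootPolyK ℚ n 2))] :
    Module.finrank ℚ (BaseChangeField ℚ n 2) = n ∧
    (NumberField.discr (BaseChangeField ℚ n 2)).natAbs ≤ n ^ n * 2 ^ (n - 1) ∧
    ∃ a b c : BaseChangeField ℚ n 2, a ≠ 0 ∧ b ≠ 0 ∧ c ≠ 0 ∧ a + b + c = 0 ∧
      ((2 * v : ℕ) : ℝ) ^ n ≤ mulHeight ![a, b, c] ∧
      masserSupport a b c ≤ (∏ p ∈ (2 * v * u ^ 2).primeFactors, p) ^ n := by
  have hqZ : IsIntegral ℤ q := by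
    refine ⟨X ^ 2 - C (2 * (v : ℤ)) * X + C ((u : ℤ) ^ 2), by monicity!, ?_⟩
    simp only [eval₂_add, eval₂_sub, eval₂_mul, eval₂_X_pow, eval₂_X, eval₂_C]
    simp only [map_mul, map_pow, map_natCast, map_ofNat]
    linear_combination hqeq
  have hqint : IsIntegral ℤ (algebraMap ℚ (BaseChangeField ℚ n 2) q) := hqZ.algebraMap
  set ξ : 𝓞 (BaseChangeField ℚ n 2) := ⟨algebraMap ℚ _ q, hqint⟩ with hξdef
  have hξ : ξ ^ 2 = ((2 * v : ℕ) : 𝓞 (BaseChangeField ℚ n 2)) * ξ -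
      ((u ^ 2 : ℕ) : 𝓞 (BaseChangeField ℚ n 2)) := by
    apply RingOfIntegers.ext
    simp only [hξdef, map_pow, RingOfIntegers.map_mk, map_sub, map_mul, map_natCast]
    rw [← map_pow, hqeq]
    simp
  have hfin : Module.finrank ℚ (BaseChangeField ℚ n 2) = n := by
    rw [finrank_baseChangeField, Module.finrank_self, one_mul]
  obtain ⟨a, b, c, ha, hb, hc, habc, hH, hS⟩ := exists_masserTriple_quad hu hv hcop ξ hξ
  rw [hfin] at hH hS
  refine ⟨hfin, ?_, a, b, c, ha, hb, hc, habc, hH, hS⟩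
  have hD := natAbs_discr_baseChangeField_le (K := ℚ) (e := n) (r := 2) hn Nat.prime_two
  simp only [finrank_baseChangeField, Module.finrank_self, one_mul, Rat.numberField_discr,
    Int.natAbs_one, one_pow, mul_one] at hD
  exact hD

/-- **Algebraic core, even degree.** Given `0 < u < v` with `gcd(2v, u²) = 1`, `M ≠ 0` with
`M² ∣ v² − u²`, `e ≥ 1` and an odd prime `r ∤ v² − u²`, there is a number field `L` of degree
`2e` with `|D_L| ≤ (2e)^{2e} (2r)^{2e} (4 (v²−u²)/M²)^e` containing nonzero `a + b + c = 0` with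
`H_L ≥ (2v)^{2e}` and `S_L ≤ rad(2vu²)^{2e}`. (Masser's §3 for `n = 2`, then base change to
`L = K(r^{1/e})`; the case where `X² − 2vX + u²` has a rational root uses `L = ℚ(2^{1/2e})`.)
[cite: Masser2002, §3 (3.6)–(3.9)] -/
theorem exists_field_even_core {M : ℕ} (hu : 0 < u) (huv : u < v)
    (hcop : Nat.Coprime (2 * v) (u ^ 2)) (hM : M ≠ 0) (hMdvd : M ^ 2 ∣ v ^ 2 - u ^ 2)
    (he : 1 ≤ e) (hr : r.Prime) (hr2 : r ≠ 2) (hrdvd : ¬ r ∣ v ^ 2 - u ^ 2) :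
    ∃ (L : Type) (_ : Field L) (_ : NumberField L),
      Module.finrank ℚ L = 2 * e ∧
      (NumberField.discr L).natAbs ≤
        (2 * e) ^ (2 * e) * (2 * r) ^ (2 * e) * (4 * ((v ^ 2 - u ^ 2) / M ^ 2)) ^ e ∧
      ∃ a b c : L, a ≠ 0 ∧ b ≠ 0 ∧ c ≠ 0 ∧ a + b + c = 0 ∧
        ((2 * v : ℕ) : ℝ) ^ (2 * e) ≤ mulHeight ![a, b, c] ∧
        masserSupport a b c ≤ (∏ p ∈ (2 * v * u ^ 2).primeFactors, p) ^ (2 * e) := by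
  classical
  have hv : 0 < v := lt_trans hu huv
  have huv2 : u ^ 2 < v ^ 2 := Nat.pow_lt_pow_left huv (by norm_num)
  obtain ⟨k, hk⟩ := hMdvd
  have hkpos : 0 < k := by
    rcases Nat.eq_zero_or_pos k with h | h
    · rw [h, mul_zero] at hk; omega
    · exact h
  have hkdiv : (v ^ 2 - u ^ 2) / M ^ 2 = k := by
    rw [hk, Nat.mul_div_cancel_left _ (by positivity)]
  have hkQ : ((k : ℤ) : ℚ) = ((v : ℚ) ^ 2 - (u : ℚ) ^ 2) / (M : ℚ) ^ 2 := by
    have hsub : ((v ^ 2 - u ^ 2 : ℕ) : ℚ) = (v : ℚ) ^ 2 - (u : ℚ) ^ 2 := by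
      rw [Nat.cast_sub huv2.le]; push_cast; ring
    rw [eq_div_iff (by positivity), ← hsub, hk]
    push_cast; ring
  have hr1 : 1 ≤ 2 * r := by have := hr.one_lt; omega
  rw [hkdiv]
  by_cases hirr : Irreducible (masserQuad u v)
  · -- the generic case: `K = ℚ(ξ)` quadratic, `L = K(r^{1/e})`
    haveI : Fact (Irreducible (masserQuad u v)) := ⟨hirr⟩
    have hDK := discr_masserQuadField_dvd (u := u) (v := v) hM hkQ
    have hDKabs := abs_discr_masserQuadField_le (u := u) (v := v) hM hkQ
    have hrD : ¬ (r : ℤ) ∣ NumberField.discr (MasserQuadField u v) := by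
      intro hrdiscr
      have h4k : (r : ℤ) ∣ 4 * k := dvd_trans hrdiscr hDK
      have hrZ : Prime (r : ℤ) := Nat.prime_iff_prime_int.mp hr
      rcases hrZ.dvd_or_dvd h4k with h4 | hk'
      · have h4' : r ∣ 2 ^ 2 := by exact_mod_cast h4
        exact hr2 ((Nat.prime_dvd_prime_iff_eq hr Nat.prime_two).mp (hr.dvd_of_dvd_pow h4'))
      · apply hrdvd
        rw [hk]
        exact Dvd.dvd.mul_left (by exact_mod_cast hk') _
    haveI : Fact (Irreducible (rootPolyK (MasserQuadField u v) e r)) :=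
      ⟨irreducible_rootPolyK he hr hrD⟩
    obtain ⟨hfin, hD, a, b, c, ha, hb, hc, habc, hH, hS⟩ :=
      exists_field_even_core_irred (e := e) (r := r) hu hv hcop he hr
    refine ⟨BaseChangeField (MasserQuadField u v) e r, inferInstance, inferInstance, hfin, ?_,
      a, b, c, ha, hb, hc, habc, hH, hS⟩
    have hDK' : (NumberField.discr (MasserQuadField u v)).natAbs ≤ 4 * k := by
      have : |((NumberField.discr (MasserQuadField u v) : ℤ) : ℚ)| ≤ 4 * (k : ℚ) := by
        simpa using hDKabs
      have h2 : ((NumberField.discr (MasserQuadField u v)).natAbs : ℚ) ≤ ((4 * k : ℕ) : ℚ) := by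
        rw [Nat.cast_natAbs, Int.cast_abs]; push_cast; exact this
      exact_mod_cast h2
    calc (NumberField.discr (BaseChangeField (MasserQuadField u v) e r)).natAbs
        ≤ e ^ (2 * e) * r ^ (2 * (e - 1)) * (NumberField.discr (MasserQuadField u v)).natAbs ^ e :=
          hD
      _ ≤ (2 * e) ^ (2 * e) * (2 * r) ^ (2 * e) * (4 * k) ^ e := by
        apply Nat.mul_le_mul (Nat.mul_le_mul ?_ ?_) ?_
        · exact Nat.pow_le_pow_left (by omega) _
        · exact le_trans (Nat.pow_le_pow_right hr.pos (by omega)) (Nat.pow_le_pow_left (by omega) _)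
        · exact Nat.pow_le_pow_left hDK' _
  · -- the degenerate case: `X² − 2vX + u²` has a rational root `q`; use `L = ℚ(2^{1/2e})`
    have hroots : (masserQuad u v).roots ≠ 0 := fun h0 =>
      hirr (((masserQuad_monic u v).irreducible_iff_roots_eq_zero_of_degree_le_three
        (by rw [masserQuad_natDegree]) (by rw [masserQuad_natDegree]; norm_num)).mpr h0)
    obtain ⟨q, hq⟩ := Multiset.exists_mem_of_ne_zero hroots
    rw [mem_roots (masserQuad_ne_zero u v)] at hq
    have hqeq : q ^ 2 = 2 * (v : ℚ) * q - (u : ℚ) ^ 2 := by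
      have : (masserQuad u v).eval q = 0 := hq
      simp only [masserQuad, eval_add, eval_sub, eval_pow, eval_X, eval_mul, eval_C] at this
      linear_combination this
    have hrD : ¬ ((2 : ℕ) : ℤ) ∣ NumberField.discr ℚ := by
      rw [Rat.numberField_discr]; norm_num
    have hn : 1 ≤ 2 * e := by omega
    haveI : Fact (Irreducible (rootPolyK ℚ (2 * e) 2)) :=
      ⟨irreducible_rootPolyK hn Nat.prime_two hrD⟩
    obtain ⟨hfin, hD, a, b, c, ha, hb, hc, habc, hH, hS⟩ :=
      exists_field_even_core_rat hu hv hcop hn hqeq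
    refine ⟨BaseChangeField ℚ (2 * e) 2, inferInstance, inferInstance, hfin, ?_,
      a, b, c, ha, hb, hc, habc, hH, hS⟩
    calc (NumberField.discr (BaseChangeField ℚ (2 * e) 2)).natAbs
        ≤ (2 * e) ^ (2 * e) * 2 ^ (2 * e - 1) := hD
      _ ≤ (2 * e) ^ (2 * e) * (2 * r) ^ (2 * e) * (4 * k) ^ e := by
        have h1 : 2 ^ (2 * e - 1) ≤ (2 * r) ^ (2 * e) :=
          le_trans (Nat.pow_le_pow_right (by norm_num) (by omega))
            (Nat.pow_le_pow_left (by have := hr.two_le; omega) _)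
        have h2 : 1 ≤ (4 * k) ^ e := Nat.one_le_pow _ _ (by omega)
        calc (2 * e) ^ (2 * e) * 2 ^ (2 * e - 1) ≤ (2 * e) ^ (2 * e) * (2 * r) ^ (2 * e) :=
              Nat.mul_le_mul_left _ h1
          _ = (2 * e) ^ (2 * e) * (2 * r) ^ (2 * e) * 1 := (mul_one _).symm
          _ ≤ (2 * e) ^ (2 * e) * (2 * r) ^ (2 * e) * (4 * k) ^ e := Nat.mul_le_mul_left _ h2

end EvenCore

end Core

/-! ### The box of smooth numbers and the pigeonhole (3.4)–(3.5) -/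

section SmoothBox

open Finset

/-- The box map: exponent vectors `f : P → Fin (E+1)` ↦ `∏_{p ∈ P} p^{f p}`. [folklore] -/
def boxProd (P : Finset ℕ) (E : ℕ) (f : P → Fin (E + 1)) : ℕ := ∏ p ∈ P.attach, (p : ℕ) ^ (f p : ℕ)

/-- Auxiliary step (`boxProd_pos`). [folklore] -/
theorem boxProd_pos {P : Finset ℕ} (hP : ∀ p ∈ P, p.Prime) {E : ℕ} (f : P → Fin (E + 1)) :
    0 < boxProd P E f :=
  Finset.prod_pos fun p _ => pow_pos (hP p.1 p.2).pos _

/-- Auxiliary step (`factorization_boxProd`). [folklore] -/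
theorem factorization_boxProd {P : Finset ℕ} (hP : ∀ p ∈ P, p.Prime) {E : ℕ}
    (f : P → Fin (E + 1)) (p : P) : (boxProd P E f).factorization p = f p := by
  classical
  unfold boxProd
  rw [Nat.factorization_prod (fun q _ => pow_ne_zero _ (hP q.1 q.2).ne_zero)]
  simp only [Nat.factorization_pow, Finset.sum_apply', Finsupp.coe_smul, Pi.smul_apply,
    smul_eq_mul]
  rw [Finset.sum_eq_single p]
  · rw [(hP p.1 p.2).factorization_self, mul_one]
  · intro q _ hqp
    rw [Nat.Prime.factorization (hP q.1 q.2), Finsupp.single_apply, if_neg, mul_zero]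
    exact fun h => hqp (Subtype.ext h)
  · intro h; exact absurd (Finset.mem_attach _ p) h

/-- Auxiliary step (`boxProd_injective`). [folklore] -/
theorem boxProd_injective {P : Finset ℕ} (hP : ∀ p ∈ P, p.Prime) (E : ℕ) :
    Function.Injective (boxProd P E) := by
  intro f g hfg
  funext p
  apply Fin.ext
  have := factorization_boxProd hP f p
  rw [hfg, factorization_boxProd hP g p] at this
  exact this.symm

/-- Auxiliary step (`prime_dvd_boxProd`). [folklore] -/
theorem prime_dvd_boxProd {P : Finset ℕ} (hP : ∀ p ∈ P, p.Prime) {E : ℕ} (f : P → Fin (E + 1))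
    {q : ℕ} (hq : q.Prime) (hdvd : q ∣ boxProd P E f) : q ∈ P := by
  unfold boxProd at hdvd
  rw [(Nat.prime_iff.mp hq).dvd_finsetProd_iff] at hdvd
  obtain ⟨p, _, hp⟩ := hdvd
  have := (Nat.prime_dvd_prime_iff_eq hq (hP p.1 p.2)).mp (hq.dvd_of_dvd_pow hp)
  rw [this]; exact p.2

/-- Auxiliary step (`boxProd_le`). [folklore] -/
theorem boxProd_le {P : Finset ℕ} (hP : ∀ p ∈ P, p.Prime) {E Y : ℕ} (hY : ∀ p ∈ P, p ≤ Y)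
    (f : P → Fin (E + 1)) : boxProd P E f ≤ Y ^ (P.card * E) := by
  unfold boxProd
  calc ∏ p ∈ P.attach, (p : ℕ) ^ (f p : ℕ) ≤ ∏ p ∈ P.attach, Y ^ E := by
        apply Finset.prod_le_prod' fun p _ => ?_
        exact le_trans (Nat.pow_le_pow_left (hY p.1 p.2) _)
          (Nat.pow_le_pow_right (lt_of_lt_of_le (hP p.1 p.2).pos (hY p.1 p.2))
            (Nat.lt_succ_iff.mp (f p).2))
    _ = Y ^ (P.card * E) := by rw [Finset.prod_const, Finset.card_attach, ← pow_mul, mul_comm]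

/-- **Pigeonhole on the box** [cite: Masser2002, §3 (3.4)–(3.5)]: if `(E+1)^{|P|} > Q` and the
prime factors of `Q` avoid `P`, there are coprime `P`-smooth `0 < u < v ≤ Y^{|P| E}` with
`Q ∣ v − u`. -/
theorem exists_coprime_smooth_pair {P : Finset ℕ} (hP : ∀ p ∈ P, p.Prime) {E Y Q : ℕ}
    (hY : ∀ p ∈ P, p ≤ Y) (hQ : 0 < Q) (hQP : ∀ p ∈ P, ¬ p ∣ Q) (hcard : Q < (E + 1) ^ P.card) :
    ∃ u v : ℕ, 0 < u ∧ u < v ∧ v ≤ Y ^ (P.card * E) ∧ Nat.Coprime u v ∧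
      (∀ q : ℕ, q.Prime → q ∣ u * v → q ∈ P) ∧ Q ∣ v - u := by
  classical
  haveI : NeZero Q := ⟨hQ.ne'⟩
  -- pigeonhole
  have hc : Fintype.card (ZMod Q) < Fintype.card (P → Fin (E + 1)) := by
    rw [ZMod.card, Fintype.card_fun, Fintype.card_fin, Fintype.card_coe]
    exact hcard
  obtain ⟨f, g, hfg, hmod⟩ := Fintype.exists_ne_map_eq_of_card_lt
    (fun f => (boxProd P E f : ZMod Q)) hc
  -- order the two products
  have hne : boxProd P E f ≠ boxProd P E g := fun h => hfg (boxProd_injective hP E h)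
  have key : ∀ {s₁ s₂ : ℕ}, s₁ < s₂ → (s₁ : ZMod Q) = s₂ →
      (∃ f', s₁ = boxProd P E f') → (∃ g', s₂ = boxProd P E g') →
      ∃ u v : ℕ, 0 < u ∧ u < v ∧ v ≤ Y ^ (P.card * E) ∧ Nat.Coprime u v ∧
        (∀ q : ℕ, q.Prime → q ∣ u * v → q ∈ P) ∧ Q ∣ v - u := by
    intro s₁ s₂ hlt hmod' hf' hg'
    obtain ⟨f', hf'⟩ := hf'
    obtain ⟨g', hg'⟩ := hg'
    have hs₁pos : 0 < s₁ := hf' ▸ boxProd_pos hP f'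
    obtain ⟨d, hd⟩ : ∃ d, d = Nat.gcd s₁ s₂ := ⟨_, rfl⟩
    have hdpos : 0 < d := hd ▸ Nat.gcd_pos_of_pos_left _ hs₁pos
    obtain ⟨u, hu⟩ : d ∣ s₁ := hd ▸ Nat.gcd_dvd_left s₁ s₂
    obtain ⟨v, hv⟩ : d ∣ s₂ := hd ▸ Nat.gcd_dvd_right s₁ s₂
    have hsmooth₁ : ∀ q : ℕ, q.Prime → q ∣ s₁ → q ∈ P := fun q hq h =>
      prime_dvd_boxProd hP f' hq (hf' ▸ h)
    have hsmooth₂ : ∀ q : ℕ, q.Prime → q ∣ s₂ → q ∈ P := fun q hq h =>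
      prime_dvd_boxProd hP g' hq (hg' ▸ h)
    refine ⟨u, v, ?_, ?_, ?_, ?_, ?_, ?_⟩
    · rcases Nat.eq_zero_or_pos u with h | h
      · rw [h, mul_zero] at hu; omega
      · exact h
    · have : d * u < d * v := by rw [← hu, ← hv]; exact hlt
      exact Nat.lt_of_mul_lt_mul_left this
    · calc v ≤ d * v := Nat.le_mul_of_pos_left _ hdpos
        _ = s₂ := hv.symm
        _ ≤ Y ^ (P.card * E) := hg' ▸ boxProd_le hP hY g'
    · have := Nat.coprime_div_gcd_div_gcd (m := s₁) (n := s₂) (hd ▸ hdpos)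
      rw [← hd] at this
      convert this using 1
      · rw [hu, Nat.mul_div_cancel_left _ hdpos]
      · rw [hv, Nat.mul_div_cancel_left _ hdpos]
    · intro q hq hquv
      rcases (Nat.Prime.dvd_mul hq).mp hquv with h | h
      · exact hsmooth₁ q hq (dvd_trans h (Dvd.intro_left _ hu.symm))
      · exact hsmooth₂ q hq (dvd_trans h (Dvd.intro_left _ hv.symm))
    · have hsub : Q ∣ s₂ - s₁ := by
        have := (ZMod.natCast_eq_natCast_iff' s₁ s₂ Q).mp hmod'
        exact (Nat.modEq_iff_dvd' hlt.le).mp this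
      rw [hu, hv, ← Nat.mul_sub] at hsub
      have hcop : Nat.Coprime Q d := by
        apply Nat.Coprime.symm
        rw [Nat.coprime_iff_gcd_eq_one]
        by_contra h1
        obtain ⟨q, hq, hqdvd⟩ := Nat.exists_prime_and_dvd h1
        have hqd : q ∣ d := dvd_trans hqdvd (Nat.gcd_dvd_left _ _)
        have hqQ : q ∣ Q := dvd_trans hqdvd (Nat.gcd_dvd_right _ _)
        have hqP : q ∈ P := hsmooth₁ q hq (dvd_trans hqd (Dvd.intro _ hu.symm))
        exact hQP q hqP hqQ
      exact hcop.dvd_of_dvd_mul_left hsub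
  rcases lt_or_gt_of_ne hne with hlt | hlt
  · exact key hlt hmod ⟨f, rfl⟩ ⟨g, rfl⟩
  · exact key hlt hmod.symm ⟨g, rfl⟩ ⟨f, rfl⟩

end SmoothBox

/-! ### A small odd prime not dividing a given number -/

section SmallPrime

open Finset Chebyshev

/-- If `θ(T) > log (2 D)` then some odd prime `r ≤ T` does not divide `D`: otherwise the
product of the odd primes `≤ T`, which is at least `primorial(T)/2`, would divide `D`.
[folklore] -/
theorem exists_odd_prime_not_dvd {D T : ℕ} (hD : 0 < D)
    (hθ : Real.log (2 * (D : ℝ)) < θ (T : ℝ)) :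
    ∃ r : ℕ, r.Prime ∧ r ≠ 2 ∧ r ≤ T ∧ ¬ r ∣ D := by
  classical
  by_contra hcon
  push Not at hcon
  -- every odd prime `≤ T` divides `D`
  set S : Finset ℕ := (Finset.range (T + 1)).filter (fun p => p.Prime ∧ p ≠ 2) with hS
  have hSdvd : (∏ p ∈ S, p) ∣ D := by
    apply Finset.prod_primes_dvd
    · intro p hp
      simp only [hS, Finset.mem_filter] at hp
      exact hp.2.1.prime
    · intro p hp
      simp only [hS, Finset.mem_filter, Finset.mem_range] at hp
      exact hcon p hp.2.1 hp.2.2 (by omega)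
  have hSle : (∏ p ∈ S, p) ≤ D := Nat.le_of_dvd hD hSdvd
  -- `primorial T ≤ 2 * ∏ S`
  have hprim : primorial T ≤ 2 * ∏ p ∈ S, p := by
    unfold primorial
    have hsplit : (Finset.range (T + 1)).filter Nat.Prime =
        ((Finset.range (T + 1)).filter (fun p => p.Prime ∧ p = 2)) ∪ S := by
      ext p
      simp only [hS, Finset.mem_filter, Finset.mem_union, Finset.mem_range]
      tauto
    have hdisj : Disjoint ((Finset.range (T + 1)).filter (fun p => p.Prime ∧ p = 2)) S := by
      rw [Finset.disjoint_left]
      intro p hp hp'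
      simp only [hS, Finset.mem_filter] at hp hp'
      exact hp'.2.2 hp.2.2
    rw [hsplit, Finset.prod_union hdisj]
    apply Nat.mul_le_mul_right
    have hsub : (Finset.range (T + 1)).filter (fun p => p.Prime ∧ p = 2) ⊆ {2} := by
      intro p hp
      simp only [Finset.mem_filter] at hp
      simp [hp.2.2]
    calc ∏ p ∈ (Finset.range (T + 1)).filter (fun p => p.Prime ∧ p = 2), p
        ≤ ∏ p ∈ ({2} : Finset ℕ), p := by
          apply Finset.prod_le_prod_of_subset_of_one_le' hsub
          intro p hp _
          simp only [Finset.mem_singleton] at hp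
          omega
      _ = 2 := by simp
  have hθ' : θ (T : ℝ) ≤ Real.log (2 * (D : ℝ)) := by
    rw [theta_eq_log_primorial, Nat.floor_natCast]
    apply Real.log_le_log (by exact_mod_cast primorial_pos T)
    have : (primorial T : ℝ) ≤ ((2 * ∏ p ∈ S, p : ℕ) : ℝ) := by exact_mod_cast hprim
    refine le_trans this ?_
    have h2 : ((2 * ∏ p ∈ S, p : ℕ) : ℝ) ≤ ((2 * D : ℕ) : ℝ) := by
      exact_mod_cast Nat.mul_le_mul_left 2 hSle
    refine le_trans h2 ?_
    push_cast
    exact le_rfl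
  linarith

end SmallPrime

/-! ### Bookkeeping for the final assembly (even degree) -/

section Bookkeeping

open Finset Chebyshev

/-- The odd primes `≤ Y` (Masser's primes `q < p ≤ y` with `q = 2`). [cite: Masser2002, §3] -/
def oddPrimesLE (Y : ℕ) : Finset ℕ := (Finset.range (Y + 1)).filter (fun p => p.Prime ∧ p ≠ 2)

/-- Members of `oddPrimesLE Y` are odd primes `≤ Y`. [folklore] -/
theorem mem_oddPrimesLE {Y p : ℕ} : p ∈ oddPrimesLE Y ↔ p ≤ Y ∧ p.Prime ∧ p ≠ 2 := by
  simp [oddPrimesLE]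

/-- `3 ∈ oddPrimesLE Y` for `Y ≥ 3`. [folklore] -/
theorem three_mem_oddPrimesLE {Y : ℕ} (hY : 3 ≤ Y) : 3 ∈ oddPrimesLE Y :=
  mem_oddPrimesLE.mpr ⟨hY, Nat.prime_three, by norm_num⟩

/-- The radical of `2 v u²` is at most `primorial Y` when all prime factors of `uv` are odd primes
`≤ Y`. [folklore] -/
theorem rad_le_primorial {u v Y : ℕ} (hY : 2 ≤ Y)
    (huv : ∀ q : ℕ, q.Prime → q ∣ u * v → q ∈ oddPrimesLE Y) :
    ∏ p ∈ (2 * v * u ^ 2).primeFactors, p ≤ primorial Y := by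
  unfold primorial
  apply Finset.prod_le_prod_of_subset_of_one_le'
  · intro p hp
    have hpprime := Nat.prime_of_mem_primeFactors hp
    have hpdvd := Nat.dvd_of_mem_primeFactors hp
    simp only [Finset.mem_filter, Finset.mem_range]
    refine ⟨?_, hpprime⟩
    rcases (Nat.Prime.dvd_mul hpprime).mp hpdvd with h2v | hu2
    · rcases (Nat.Prime.dvd_mul hpprime).mp h2v with h2 | hv
      · have := (Nat.prime_dvd_prime_iff_eq hpprime Nat.prime_two).mp h2; omega
      · have := (mem_oddPrimesLE.mp (huv p hpprime (Dvd.dvd.mul_left hv u))).1; omega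
    · have hu : p ∣ u := hpprime.dvd_of_dvd_pow hu2
      have := (mem_oddPrimesLE.mp (huv p hpprime (Dvd.dvd.mul_right hu v))).1; omega
  · intro p hp _
    exact (Finset.mem_filter.mp hp).2.one_lt.le

/-- From `m^d ∣ v − u` we get `(m^{d/2})² ∣ v² − u²`. [folklore] -/
theorem sq_pow_half_dvd {m d u v : ℕ} (h : m ^ d ∣ v - u) :
    (m ^ (d / 2)) ^ 2 ∣ v ^ 2 - u ^ 2 := by
  have h1 : (m ^ (d / 2)) ^ 2 ∣ m ^ d := by
    rw [← pow_mul]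
    exact Nat.pow_dvd_pow m (by omega)
  have h2 : v ^ 2 - u ^ 2 = (v + u) * (v - u) := Nat.sq_sub_sq v u
  rw [h2]
  exact Dvd.dvd.mul_left (dvd_trans h1 h) _

/-- `gcd(2v, u²) = 1` when `u, v` are coprime and `u` is odd. [folklore] -/
theorem coprime_two_mul_sq {u v : ℕ} (hcop : Nat.Coprime u v) (hodd : ¬ 2 ∣ u) :
    Nat.Coprime (2 * v) (u ^ 2) := by
  apply Nat.Coprime.pow_right
  apply Nat.Coprime.mul_left
  · exact (Nat.Prime.coprime_iff_not_dvd Nat.prime_two).mpr hodd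
  · exact hcop.symm

/-- **Size of the pigeonhole modulus** (the count (3.4)): with `B = (E+1)^k ≥ 2`, a prime
`Y < m ≤ 2Y` and `d = ⌊log_m (B−1)⌋`, the modulus `M = m^{⌊d/2⌋}` satisfies
`k log(E+1) − log 2 − 2 log(2Y) ≤ 2 log M`. [cite: Masser2002, §3 (3.4)] -/
theorem log_modulus_ge {E k m Y : ℕ} (hmY : m ≤ 2 * Y) (hm : 2 ≤ m)
    (hB : 2 ≤ (E + 1) ^ k) :
    (k : ℝ) * Real.log ((E : ℝ) + 1) - Real.log 2 - 2 * Real.log (2 * (Y : ℝ)) ≤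
      2 * Real.log ((m : ℝ) ^ (Nat.log m ((E + 1) ^ k - 1) / 2)) := by
  have hm1 : 1 < m := hm
  have hmR : (1 : ℝ) < m := by exact_mod_cast hm1
  have hlogm : 0 < Real.log m := Real.log_pos hmR
  have hY : 1 ≤ Y := by omega
  have hBR : (2 : ℝ) ≤ ((E : ℝ) + 1) ^ k := by exact_mod_cast hB
  -- `B - 1 < m^(d+1)` with `B = (E+1)^k`, `d = log_m (B-1)`
  have hlt := Nat.lt_pow_succ_log_self hm1 ((E + 1) ^ k - 1)
  have hltR : ((E : ℝ) + 1) ^ k - 1 < (m : ℝ) ^ (Nat.log m ((E + 1) ^ k - 1) + 1) := by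
    have : (((E + 1) ^ k - 1 : ℕ) : ℝ) < ((m ^ (Nat.log m ((E + 1) ^ k - 1) + 1) : ℕ) : ℝ) := by
      exact_mod_cast hlt
    rw [Nat.cast_sub (by omega)] at this
    push_cast at this
    exact this
  have hlogB1 : Real.log (((E : ℝ) + 1) ^ k - 1) <
      ((Nat.log m ((E + 1) ^ k - 1) : ℝ) + 1) * Real.log m := by
    have e1 : ((Nat.log m ((E + 1) ^ k - 1) : ℝ) + 1) * Real.log m =
        Real.log ((m : ℝ) ^ (Nat.log m ((E + 1) ^ k - 1) + 1)) := by
      rw [Real.log_pow]; push_cast; ring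
    rw [e1]
    exact Real.log_lt_log (by linarith) hltR
  -- `log (B - 1) ≥ log B - log 2`
  have hlogB : Real.log (((E : ℝ) + 1) ^ k) - Real.log 2 ≤ Real.log (((E : ℝ) + 1) ^ k - 1) := by
    rw [← Real.log_div (by positivity) (by norm_num)]
    apply Real.log_le_log (by positivity)
    linarith
  have hlogBk : Real.log (((E : ℝ) + 1) ^ k) = k * Real.log ((E : ℝ) + 1) := by
    rw [Real.log_pow]
  -- `2 (d/2) ≥ d - 1`
  set d := Nat.log m ((E + 1) ^ k - 1) with hddef
  have hhalf : ((d : ℝ) - 1) ≤ 2 * ((d / 2 : ℕ) : ℝ) := by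
    have : d - 1 ≤ 2 * (d / 2) := by omega
    have h' : ((d - 1 : ℕ) : ℝ) ≤ ((2 * (d / 2) : ℕ) : ℝ) := by exact_mod_cast this
    rcases Nat.eq_zero_or_pos d with hd0 | hdpos
    · simp [hd0]
    · rw [Nat.cast_sub hdpos] at h'; push_cast at h'; exact h'
  have hlog2Y : Real.log m ≤ Real.log (2 * (Y : ℝ)) := by
    apply Real.log_le_log (by positivity)
    exact_mod_cast hmY
  rw [Real.log_pow]
  calc (k : ℝ) * Real.log ((E : ℝ) + 1) - Real.log 2 - 2 * Real.log (2 * (Y : ℝ))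
      ≤ Real.log (((E : ℝ) + 1) ^ k - 1) - 2 * Real.log m := by rw [← hlogBk]; linarith
    _ ≤ ((d : ℝ) + 1) * Real.log m - 2 * Real.log m := by linarith
    _ = ((d : ℝ) - 1) * Real.log m := by ring
    _ ≤ 2 * ((d / 2 : ℕ) : ℝ) * Real.log m := by
        apply mul_le_mul_of_nonneg_right hhalf hlogm.le
    _ = 2 * (((d / 2 : ℕ) : ℝ) * Real.log m) := by ring

/-- `S_K(a,b,c) ≥ 1`. [folklore] -/
theorem one_le_masserSupport {K : Type*} [Field K] [NumberField K] (a b c : K) :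
    1 ≤ masserSupport a b c := by
  unfold masserSupport
  refine finprod_mem_induction (fun x => 1 ≤ x) le_rfl (fun x y hx hy => ?_) (fun v _ => ?_)
  · exact one_le_mul hx hy
  · exact Nat.one_le_pow _ _ (Nat.pos_of_ne_zero (Ideal.absNorm_eq_zero_iff.not.mpr v.ne_bot))

/-- `log log 3 > 0`. [folklore] -/
theorem log_log_three_pos : 0 < Real.log (Real.log 3) := by
  apply Real.log_pos
  rw [Real.lt_log_iff_exp_lt (by norm_num)]
  have := Real.exp_one_lt_d9
  linarith

/-- `k = #(odd primes ≤ Y) ≤ Y`. [folklore] -/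
theorem card_oddPrimesLE_le (Y : ℕ) : (oddPrimesLE Y).card ≤ Y := by
  have hsub : oddPrimesLE Y ⊆ Finset.Icc 2 Y := by
    intro p hp
    rw [mem_oddPrimesLE] at hp
    simp only [Finset.mem_Icc]
    exact ⟨hp.2.1.two_le, hp.1⟩
  refine le_trans (Finset.card_le_card hsub) ?_
  simp

end Bookkeeping

/-! ### The assembly for even degree: from a good parameter `Y` to Masser's inequality -/

section EvenAssembly

open Finset Chebyshev

/-- The final linear bookkeeping of logarithms (pure real arithmetic). [folklore] -/
theorem final_log_ineq {logC logD frac llogS logH logv logM logr logT A e4 e2 k1 F G eR nR l2Y : ℝ}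
    (he : 0 ≤ eR) (hn : nR = 2 * eR)
    (hlogH : nR * Real.log 2 + nR * logv ≤ logH)
    (hlogD : logD ≤ A + nR * logr + e4 + 2 * eR * logv - 2 * eR * logM)
    (hrT : logr ≤ logT) (hfrac : frac ≤ F) (hlS : llogS ≤ G)
    (hM : eR * (k1 - e2 - 2 * l2Y) ≤ 2 * eR * logM)
    (hneed : logC + F + A + nR * logT + e4 + eR * e2 + 2 * eR * l2Y + G < eR * k1) :
    logC + logD + frac + llogS < logH := by
  have h1 : nR * logr ≤ nR * logT := mul_le_mul_of_nonneg_left hrT (by linarith)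
  have h2 : 0 ≤ nR * Real.log 2 := mul_nonneg (by linarith) (Real.log_nonneg (by norm_num))
  subst hn
  linear_combination hlogD + h1 + hfrac + hlS + hM + hneed + hlogH + h2

/-- `log (n^n (2r)^n (4 v²/M²)^e) = n log n + n log(2r) + e log 4 + 2e log v − 2e log M`.
[folklore] -/
theorem log_discr_bound_eq {n e r : ℕ} {v M : ℝ} (hn : 1 ≤ n) (hr : 1 ≤ r) (hv : 0 < v)
    (hM : 0 < M) :
    Real.log ((n : ℝ) ^ n * (2 * (r : ℝ)) ^ n * (4 * (v ^ 2 / M ^ 2)) ^ e) =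
      n * Real.log n + n * Real.log (2 * (r : ℝ)) + e * Real.log 4 + 2 * e * Real.log v -
        2 * e * Real.log M := by
  have hnR : (0 : ℝ) < n := by exact_mod_cast hn
  have hrR : (0 : ℝ) < r := by exact_mod_cast hr
  have h4 : Real.log (4 * (v ^ 2 / M ^ 2)) = Real.log 4 + 2 * Real.log v - 2 * Real.log M := by
    rw [Real.log_mul (by norm_num) (by positivity), Real.log_div (by positivity) (by positivity),
      Real.log_pow, Real.log_pow]
    push_cast; ring
  rw [Real.log_mul (by positivity) (by positivity), Real.log_mul (by positivity) (by positivity),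
    Real.log_pow, Real.log_pow, Real.log_pow, h4]
  ring

/-- The final step for even degree: from the core field and the numerical hypothesis to the
strict inequality `C · D · φ_ν(D) · S^λ < H`. [cite: Masser2002, §3 (3.10)] -/
theorem even_final_step {e : ℕ} (he : 1 ≤ e) (l ν C : ℝ) (hl : 1 ≤ l) {Y E T : ℕ}
    (hY : 3 ≤ Y)
    (hneed : Real.log C +
        ((Real.log 3) ^ ν +
          ((2 * e : ℕ) * Real.log (2 * e : ℕ) + (2 * e : ℕ) * Real.log (2 * (T : ℝ)) +
            e * Real.log 4 + 2 * e * ((Y : ℝ) * E * Real.log Y)) ^ ν) / Real.log (Real.log 3) +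
        (2 * e : ℕ) * Real.log (2 * e : ℕ) + (2 * e : ℕ) * Real.log (2 * (T : ℝ)) +
        e * Real.log 4 + e * Real.log 2 + 2 * e * Real.log (2 * (Y : ℝ)) +
        l * (2 * e : ℕ) * θ (Y : ℝ) <
        e * ((oddPrimesLE Y).card * Real.log ((E : ℝ) + 1)))
    {m : ℕ} (hmprime : m.Prime) (hm2Y : m ≤ 2 * Y) (hB : 2 ≤ (E + 1) ^ (oddPrimesLE Y).card)
    {u v r : ℕ} (hv : 0 < v) (hsmooth : ∀ q : ℕ, q.Prime → q ∣ u * v → q ∈ oddPrimesLE Y)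
    (hrT : r ≤ T) (hr : r.Prime)
    {L : Type*} [Field L] [NumberField L] (hfin : Module.finrank ℚ L = 2 * e)
    (hD : (NumberField.discr L).natAbs ≤
      (2 * e) ^ (2 * e) * (2 * r) ^ (2 * e) *
        (4 * ((v ^ 2 - u ^ 2) / (m ^ (Nat.log m ((E + 1) ^ (oddPrimesLE Y).card - 1) / 2)) ^ 2)) ^ e)
    {a b c : L} (hH : ((2 * v : ℕ) : ℝ) ^ (2 * e) ≤ mulHeight ![a, b, c])
    (hS : masserSupport a b c ≤ (∏ p ∈ (2 * v * u ^ 2).primeFactors, p) ^ (2 * e))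
    (hlogv : Real.log v ≤ (Y : ℝ) * E * Real.log Y)
    (hMpos : 0 < m ^ (Nat.log m ((E + 1) ^ (oddPrimesLE Y).card - 1) / 2)) :
    C * |(NumberField.discr L : ℝ)| * masserPhi ν |(NumberField.discr L : ℝ)| *
        (masserSupport a b c : ℝ) ^ l < mulHeight ![a, b, c] := by
  -- notation for the real quantities
  set M : ℕ := m ^ (Nat.log m ((E + 1) ^ (oddPrimesLE Y).card - 1) / 2) with hMdef
  set H : ℝ := mulHeight ![a, b, c] with hHdef
  set D : ℝ := |((NumberField.discr L : ℤ) : ℝ)| with hDdef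
  set S : ℝ := (masserSupport a b c : ℝ) with hSdef
  have hvR : (0 : ℝ) < v := by exact_mod_cast hv
  have hHpos : 0 < H := lt_of_lt_of_le (by positivity) hH
  have hS1 : (1 : ℝ) ≤ S := by rw [hSdef]; exact_mod_cast one_le_masserSupport a b c
  have hSpos : 0 < S := by linarith
  have hDnat : D = ((NumberField.discr L).natAbs : ℝ) := by
    rw [hDdef, Nat.cast_natAbs, Int.cast_abs]
  have hD3 : (3 : ℝ) ≤ D := by
    have h2 : (2 : ℤ) < |NumberField.discr L| := NumberField.abs_discr_gt_two (by omega)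
    have : ((3 : ℤ) : ℝ) ≤ ((|NumberField.discr L| : ℤ) : ℝ) := by exact_mod_cast h2
    simpa [hDdef, Int.cast_abs] using this
  have hDpos' : 0 < D := by linarith
  have hφpos : 0 < masserPhi ν D := masserPhi_pos ν D
  -- Case `C ≤ 0`: the left-hand side is `≤ 0 < H`.
  rcases le_or_gt C 0 with hC | hC
  · have : C * D * masserPhi ν D * S ^ l ≤ 0 := by
      have h1 : C * D ≤ 0 := mul_nonpos_of_nonpos_of_nonneg hC hDpos'.le
      have h2 : C * D * masserPhi ν D ≤ 0 := mul_nonpos_of_nonpos_of_nonneg h1 hφpos.le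
      exact mul_nonpos_of_nonpos_of_nonneg h2 (Real.rpow_nonneg hSpos.le l)
    exact lt_of_le_of_lt this hHpos
  -- Case `C > 0`: compare logarithms.
  have hLHSpos : 0 < C * D * masserPhi ν D * S ^ l := by positivity
  rw [← Real.log_lt_log_iff hLHSpos hHpos]
  have hlogLHS : Real.log (C * D * masserPhi ν D * S ^ l) =
      Real.log C + Real.log D + Real.log D ^ ν / Real.log (Real.log D) + l * Real.log S := by
    rw [Real.log_mul (by positivity) (by positivity), Real.log_mul (by positivity) hφpos.ne',
      Real.log_mul hC.ne' hDpos'.ne', Real.log_rpow hSpos]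
    unfold masserPhi
    rw [Real.log_exp]
  rw [hlogLHS]
  -- lower bound for `log H`
  have hlogH : ((2 * e : ℕ) : ℝ) * Real.log 2 + ((2 * e : ℕ) : ℝ) * Real.log v ≤ Real.log H := by
    have h1 : Real.log (((2 * v : ℕ) : ℝ) ^ (2 * e)) ≤ Real.log H :=
      Real.log_le_log (by positivity) hH
    rw [Real.log_pow] at h1
    push_cast at h1 ⊢
    rw [Real.log_mul (by norm_num) hvR.ne'] at h1
    linarith
  -- upper bound for `D`
  have hMR : (0 : ℝ) < M := by exact_mod_cast hMpos
  have hkk : (((v ^ 2 - u ^ 2) / M ^ 2 : ℕ) : ℝ) ≤ (v : ℝ) ^ 2 / (M : ℝ) ^ 2 := by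
    rw [le_div_iff₀ (by positivity)]
    have h1 : (v ^ 2 - u ^ 2) / M ^ 2 * M ^ 2 ≤ v ^ 2 :=
      le_trans (Nat.div_mul_le_self _ _) (Nat.sub_le _ _)
    exact_mod_cast h1
  have hDle : D ≤ ((2 * e : ℕ) : ℝ) ^ (2 * e) * (2 * (r : ℝ)) ^ (2 * e) *
      (4 * ((v : ℝ) ^ 2 / (M : ℝ) ^ 2)) ^ e := by
    rw [hDnat]
    have h1 : ((NumberField.discr L).natAbs : ℝ) ≤
        (((2 * e) ^ (2 * e) * (2 * r) ^ (2 * e) * (4 * ((v ^ 2 - u ^ 2) / M ^ 2)) ^ e : ℕ) : ℝ) := by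
      exact_mod_cast hD
    refine le_trans h1 ?_
    push_cast
    gcongr
  have hlogD : Real.log D ≤ ((2 * e : ℕ) : ℝ) * Real.log (2 * e : ℕ) +
      (2 * e : ℕ) * Real.log (2 * (r : ℝ)) + e * Real.log 4 + 2 * e * Real.log v -
        2 * e * Real.log M := by
    have h1 := Real.log_le_log hDpos' hDle
    rwa [log_discr_bound_eq (by omega) hr.one_lt.le hvR hMR] at h1
  have hlogr : Real.log (2 * (r : ℝ)) ≤ Real.log (2 * (T : ℝ)) := by
    apply Real.log_le_log (by have := hr.pos; positivity)
    exact_mod_cast Nat.mul_le_mul_left 2 hrT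
  -- `(log D)^ν / log log D ≤ ((log 3)^ν + Λ^ν) / log log 3`
  have hlogD0 : 0 ≤ Real.log D := Real.log_nonneg (by linarith)
  have hlogM0 : 0 ≤ Real.log M := Real.log_nonneg (by exact_mod_cast hMpos)
  have hlogDΛ : Real.log D ≤ ((2 * e : ℕ) : ℝ) * Real.log (2 * e : ℕ) +
      (2 * e : ℕ) * Real.log (2 * (T : ℝ)) + e * Real.log 4 + 2 * e * ((Y : ℝ) * E * Real.log Y) := by
    have h1 : ((2 * e : ℕ) : ℝ) * Real.log (2 * (r : ℝ)) ≤ (2 * e : ℕ) * Real.log (2 * (T : ℝ)) :=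
      mul_le_mul_of_nonneg_left hlogr (by positivity)
    have h2 : 2 * (e : ℝ) * Real.log v ≤ 2 * e * ((Y : ℝ) * E * Real.log Y) :=
      mul_le_mul_of_nonneg_left hlogv (by positivity)
    have h3 : 0 ≤ 2 * (e : ℝ) * Real.log M := by positivity
    linarith
  have hlog3 : 0 < Real.log 3 := Real.log_pos (by norm_num)
  have hΛ0 : 0 ≤ ((2 * e : ℕ) : ℝ) * Real.log (2 * e : ℕ) +
      (2 * e : ℕ) * Real.log (2 * (T : ℝ)) + e * Real.log 4 + 2 * e * ((Y : ℝ) * E * Real.log Y) :=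
    le_trans hlogD0 hlogDΛ
  have hpowν : Real.log D ^ ν ≤ Real.log 3 ^ ν + (((2 * e : ℕ) : ℝ) * Real.log (2 * e : ℕ) +
      (2 * e : ℕ) * Real.log (2 * (T : ℝ)) + e * Real.log 4 + 2 * e * ((Y : ℝ) * E * Real.log Y)) ^ ν := by
    rcases le_or_gt 0 ν with hν | hν
    · have := Real.rpow_le_rpow hlogD0 hlogDΛ hν
      have h0 : 0 ≤ Real.log 3 ^ ν := Real.rpow_nonneg hlog3.le ν
      linarith
    · have hle : Real.log 3 ≤ Real.log D := Real.log_le_log (by norm_num) hD3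
      have := Real.rpow_le_rpow_of_nonpos hlog3 hle hν.le
      have h0 := Real.rpow_nonneg hΛ0 ν
      linarith
  have hll : Real.log (Real.log 3) ≤ Real.log (Real.log D) :=
    Real.log_le_log hlog3 (Real.log_le_log (by norm_num) hD3)
  have hfrac : Real.log D ^ ν / Real.log (Real.log D) ≤
      (Real.log 3 ^ ν + (((2 * e : ℕ) : ℝ) * Real.log (2 * e : ℕ) +
      (2 * e : ℕ) * Real.log (2 * (T : ℝ)) + e * Real.log 4 + 2 * e * ((Y : ℝ) * E * Real.log Y)) ^ ν) /
        Real.log (Real.log 3) := by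
    apply div_le_div₀ _ hpowν log_log_three_pos hll
    exact add_nonneg (Real.rpow_nonneg hlog3.le ν) (Real.rpow_nonneg hΛ0 ν)
  -- `l log S ≤ l n θ(Y)`
  have hlogS : Real.log S ≤ ((2 * e : ℕ) : ℝ) * θ (Y : ℝ) := by
    have h1 : masserSupport a b c ≤ (primorial Y) ^ (2 * e) :=
      le_trans hS (Nat.pow_le_pow_left (rad_le_primorial (by omega) hsmooth) _)
    have h2 : S ≤ ((primorial Y : ℕ) : ℝ) ^ (2 * e) := by rw [hSdef]; exact_mod_cast h1
    calc Real.log S ≤ Real.log (((primorial Y : ℕ) : ℝ) ^ (2 * e)) := Real.log_le_log hSpos h2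
      _ = ((2 * e : ℕ) : ℝ) * Real.log ((primorial Y : ℕ) : ℝ) := by rw [Real.log_pow]
      _ = ((2 * e : ℕ) : ℝ) * θ (Y : ℝ) := by rw [theta_eq_log_primorial, Nat.floor_natCast]
  have hlθ : l * Real.log S ≤ l * ((2 * e : ℕ) : ℝ) * θ (Y : ℝ) := by
    have := mul_le_mul_of_nonneg_left hlogS (show (0 : ℝ) ≤ l by linarith)
    linarith
  -- `2 e log M ≥ e (k log (E+1) − log 2 − 2 log 2Y)`
  have hMlog := log_modulus_ge (E := E) (k := (oddPrimesLE Y).card) hm2Y hmprime.two_le hB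
  have hMlog' : (e : ℝ) * (((oddPrimesLE Y).card : ℝ) * Real.log ((E : ℝ) + 1) - Real.log 2 -
      2 * Real.log (2 * (Y : ℝ))) ≤ 2 * e * Real.log M := by
    have := mul_le_mul_of_nonneg_left hMlog (show (0 : ℝ) ≤ e by positivity)
    rw [hMdef]; push_cast
    linarith
  -- put everything together
  have hn : ((2 * e : ℕ) : ℝ) = 2 * (e : ℝ) := by push_cast; ring
  exact final_log_ineq (by positivity) hn hlogH hlogD hlogr hfrac hlθ hMlog' hneed

/-- **Masser's theorem for even degree, deterministic part.** Given the parameters `Y, E, T` of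
the construction (primes `≤ Y`, exponent box `E`, range `T` for the auxiliary prime) satisfying
the numerical hypotheses `hT` and `hneed`, there is a number field of degree `2e` and a zero-sum
triple violating `H ≤ C D_K φ_ν(D_K) S^λ`. [cite: Masser2002, §3 (3.4)–(3.10)] -/
theorem even_assembly {e : ℕ} (he : 1 ≤ e) (l ν C : ℝ) (hl : 1 ≤ l) {Y E T : ℕ}
    (hY : 3 ≤ Y) (hE : 1 ≤ E)
    (hT : Real.log 2 + 2 * (Y : ℝ) * E * Real.log Y < θ (T : ℝ))
    (hneed : Real.log C +
        ((Real.log 3) ^ ν +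
          ((2 * e : ℕ) * Real.log (2 * e : ℕ) + (2 * e : ℕ) * Real.log (2 * (T : ℝ)) +
            e * Real.log 4 + 2 * e * ((Y : ℝ) * E * Real.log Y)) ^ ν) / Real.log (Real.log 3) +
        (2 * e : ℕ) * Real.log (2 * e : ℕ) + (2 * e : ℕ) * Real.log (2 * (T : ℝ)) +
        e * Real.log 4 + e * Real.log 2 + 2 * e * Real.log (2 * (Y : ℝ)) +
        l * (2 * e : ℕ) * θ (Y : ℝ) <
        e * ((oddPrimesLE Y).card * Real.log ((E : ℝ) + 1))) :
    ∃ (K : Type) (_ : Field K) (_ : NumberField K),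
      Module.finrank ℚ K = 2 * e ∧
        ∃ a b c : K, a ≠ 0 ∧ b ≠ 0 ∧ c ≠ 0 ∧ a + b + c = 0 ∧
          C * |(NumberField.discr K : ℝ)| * masserPhi ν |(NumberField.discr K : ℝ)| *
              (masserSupport a b c : ℝ) ^ l <
            mulHeight ![a, b, c] := by
  classical
  -- the primes and the box
  have hPprime : ∀ p ∈ oddPrimesLE Y, p.Prime := fun p hp => (mem_oddPrimesLE.mp hp).2.1
  have hPY : ∀ p ∈ oddPrimesLE Y, p ≤ Y := fun p hp => (mem_oddPrimesLE.mp hp).1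
  have hk1 : 1 ≤ (oddPrimesLE Y).card := Finset.card_pos.mpr ⟨3, three_mem_oddPrimesLE hY⟩
  have hkY : (oddPrimesLE Y).card ≤ Y := card_oddPrimesLE_le Y
  have hB : 2 ≤ (E + 1) ^ (oddPrimesLE Y).card :=
    calc 2 ≤ E + 1 := by omega
      _ = (E + 1) ^ 1 := (pow_one _).symm
      _ ≤ (E + 1) ^ (oddPrimesLE Y).card := Nat.pow_le_pow_right (by omega) hk1
  -- the pigeonhole prime `m` and modulus `Q = m^d`
  obtain ⟨m, hmprime, hYm, hm2Y⟩ := Nat.exists_prime_lt_and_le_two_mul Y (by omega)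
  have hQpos : 0 < m ^ Nat.log m ((E + 1) ^ (oddPrimesLE Y).card - 1) := pow_pos hmprime.pos _
  have hQlt : m ^ Nat.log m ((E + 1) ^ (oddPrimesLE Y).card - 1) < (E + 1) ^ (oddPrimesLE Y).card := by
    have := Nat.pow_log_le_self m (show (E + 1) ^ (oddPrimesLE Y).card - 1 ≠ 0 by omega)
    omega
  have hQP : ∀ p ∈ oddPrimesLE Y, ¬ p ∣ m ^ Nat.log m ((E + 1) ^ (oddPrimesLE Y).card - 1) := by
    intro p hp hdvd
    have hpm : p ∣ m := (hPprime p hp).dvd_of_dvd_pow hdvd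
    have := (Nat.prime_dvd_prime_iff_eq (hPprime p hp) hmprime).mp hpm
    have := hPY p hp
    omega
  obtain ⟨u, v, hu, huv, hvle, hcop, hsmooth, hQdvd⟩ :=
    exists_coprime_smooth_pair hPprime hPY hQpos hQP hQlt
  have hv : 0 < v := lt_trans hu huv
  -- the modulus `M = m^(d/2)`
  have hMpos : 0 < m ^ (Nat.log m ((E + 1) ^ (oddPrimesLE Y).card - 1) / 2) := pow_pos hmprime.pos _
  have hMdvd := sq_pow_half_dvd hQdvd
  -- `gcd(2v, u²) = 1`
  have hodd : ¬ 2 ∣ u := by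
    intro h2
    have := (mem_oddPrimesLE.mp (hsmooth 2 Nat.prime_two (Dvd.dvd.mul_right h2 v))).2.2
    exact this rfl
  have hcop2 : Nat.Coprime (2 * v) (u ^ 2) := coprime_two_mul_sq hcop hodd
  -- the auxiliary prime `r`
  have huv2 : u ^ 2 < v ^ 2 := Nat.pow_lt_pow_left huv (by norm_num)
  have hDpos : 0 < v ^ 2 - u ^ 2 := by omega
  have hYR : (1 : ℝ) < Y := by exact_mod_cast (show 1 < Y by omega)
  have hlogY : 0 < Real.log Y := Real.log_pos hYR
  have hlogv : Real.log v ≤ (Y : ℝ) * E * Real.log Y := by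
    have h1 : (v : ℝ) ≤ (Y : ℝ) ^ ((oddPrimesLE Y).card * E) := by exact_mod_cast hvle
    calc Real.log v ≤ Real.log ((Y : ℝ) ^ ((oddPrimesLE Y).card * E)) :=
          Real.log_le_log (by exact_mod_cast hv) h1
      _ = ((oddPrimesLE Y).card * E : ℕ) * Real.log Y := by rw [Real.log_pow]
      _ ≤ (Y : ℝ) * E * Real.log Y := by
          apply mul_le_mul_of_nonneg_right _ hlogY.le
          have : (((oddPrimesLE Y).card * E : ℕ) : ℝ) ≤ ((Y * E : ℕ) : ℝ) := by
            exact_mod_cast Nat.mul_le_mul_right E hkY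
          push_cast at this ⊢; exact this
  have hθT : Real.log (2 * ((v ^ 2 - u ^ 2 : ℕ) : ℝ)) < θ (T : ℝ) := by
    refine lt_of_le_of_lt ?_ hT
    have h1 : ((v ^ 2 - u ^ 2 : ℕ) : ℝ) ≤ (v : ℝ) ^ 2 := by
      have : v ^ 2 - u ^ 2 ≤ v ^ 2 := Nat.sub_le _ _
      exact_mod_cast this
    calc Real.log (2 * ((v ^ 2 - u ^ 2 : ℕ) : ℝ)) ≤ Real.log (2 * (v : ℝ) ^ 2) := by
          apply Real.log_le_log (by positivity)
          linarith
      _ = Real.log 2 + 2 * Real.log v := by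
          rw [Real.log_mul (by norm_num) (by positivity), Real.log_pow]; push_cast; ring
      _ ≤ Real.log 2 + 2 * ((Y : ℝ) * E * Real.log Y) := by linarith
      _ = Real.log 2 + 2 * (Y : ℝ) * E * Real.log Y := by ring
  obtain ⟨r, hr, hr2, hrT, hrdvd⟩ := exists_odd_prime_not_dvd hDpos hθT
  -- the field
  obtain ⟨L, iF, iN, hfin, hD, a, b, c, ha, hb, hc, habc, hH, hS⟩ :=
    exists_field_even_core (e := e) (r := r) hu huv hcop2 hMpos.ne' hMdvd he hr hr2 hrdvd
  refine ⟨L, iF, iN, hfin, a, b, c, ha, hb, hc, habc, ?_⟩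
  exact even_final_step he l ν C hl hY hneed hmprime hm2Y hB hv hsmooth hrT hr hfin hD hH hS
    hlogv hMpos

end EvenAssembly

/-! ### Asymptotics: the error terms are `o(y)` -/

section Asymptotics

open Filter Asymptotics Topology Chebyshev

/-- `log (y+1) = o(y)`. [folklore] -/
theorem isLittleO_log_add_one : (fun y : ℝ => Real.log (y + 1)) =o[atTop] (fun y => y) := by
  have h1 : (fun y : ℝ => Real.log (y + 1)) =o[atTop] (fun y => y + 1) := by
    have := Real.isLittleO_log_id_atTop.comp_tendsto
      (tendsto_atTop_add_const_right atTop (1 : ℝ) tendsto_id)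
    simpa [Function.comp_def] using this
  have h2 : (fun y : ℝ => y + 1) =O[atTop] (fun y => y) := by
    apply IsBigO.of_bound 2
    filter_upwards [eventually_ge_atTop (1 : ℝ)] with y hy
    rw [Real.norm_of_nonneg (by linarith), Real.norm_of_nonneg (by linarith)]
    linarith
  exact h1.trans_isBigO h2

/-- `√y · log y = o(y)`. [folklore] -/
theorem isLittleO_sqrt_mul_log : (fun y : ℝ => Real.sqrt y * Real.log y) =o[atTop] (fun y => y) := by
  have h1 : (fun y : ℝ => Real.log y) =o[atTop] (fun y => y ^ (1 / 2 : ℝ)) :=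
    isLittleO_log_rpow_atTop (by norm_num)
  have h2 : (fun y : ℝ => Real.sqrt y * Real.log y) =o[atTop]
      (fun y => y ^ (1 / 2 : ℝ) * y ^ (1 / 2 : ℝ)) := by
    have hb : (fun y : ℝ => Real.sqrt y) =O[atTop] (fun y => y ^ (1 / 2 : ℝ)) := by
      apply IsBigO.of_bound 1
      filter_upwards [eventually_ge_atTop (0 : ℝ)] with y hy
      rw [Real.sqrt_eq_rpow, one_mul]
    exact hb.mul_isLittleO h1
  refine h2.trans_isBigO ?_
  apply IsBigO.of_bound 1
  filter_upwards [eventually_ge_atTop (0 : ℝ)] with y hy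
  rw [← Real.rpow_add' hy (by norm_num), one_mul]
  norm_num

/-- For `ν > 0` with `ν (a+1) < 1`: `(A y^{a+1} log y)^ν = o(y)`. [folklore] -/
theorem isLittleO_rpow_main {A a ν : ℝ} (hA : 0 ≤ A) (hνa : ν * (a + 1) < 1) :
    (fun y : ℝ => (A * y ^ (a + 1) * Real.log y) ^ ν) =o[atTop] (fun y => y) := by
  set s : ℝ := 1 - ν * (a + 1) with hs
  have hspos : 0 < s := by rw [hs]; linarith
  have h1 : (fun y : ℝ => Real.log y ^ ν) =o[atTop] (fun y => y ^ s) :=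
    isLittleO_log_rpow_rpow_atTop ν hspos
  have h2 : (fun y : ℝ => (A ^ ν * y ^ (ν * (a + 1))) * Real.log y ^ ν) =o[atTop]
      (fun y => (A ^ ν * y ^ (ν * (a + 1))) * y ^ s) :=
    (isBigO_refl (fun y : ℝ => A ^ ν * y ^ (ν * (a + 1))) atTop).mul_isLittleO h1
  have h3 : (fun y : ℝ => (A * y ^ (a + 1) * Real.log y) ^ ν) =ᶠ[atTop]
      (fun y => (A ^ ν * y ^ (ν * (a + 1))) * Real.log y ^ ν) := by
    filter_upwards [eventually_ge_atTop (1 : ℝ)] with y hy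
    have hy0 : 0 ≤ y := by linarith
    have hlog : 0 ≤ Real.log y := Real.log_nonneg hy
    rw [Real.mul_rpow (by positivity) hlog, Real.mul_rpow hA (by positivity), ← Real.rpow_mul hy0,
      mul_comm (a + 1) ν]
  have h4 : (fun y : ℝ => (A ^ ν * y ^ (ν * (a + 1))) * y ^ s) =O[atTop] (fun y => y) := by
    apply IsBigO.of_bound (A ^ ν)
    filter_upwards [eventually_ge_atTop (0 : ℝ)] with y hy
    rw [mul_assoc, ← Real.rpow_add' hy (by rw [hs]; ring_nf; norm_num), Real.norm_of_nonneg hy,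
      Real.norm_of_nonneg (by positivity)]
    have : ν * (a + 1) + s = 1 := by rw [hs]; ring
    rw [this, Real.rpow_one]
  exact (h3.trans_isLittleO h2).trans_isBigO h4

/-- **Chebyshev, eventual form**: `θ(T) ≥ T/2` for all large `T`. [folklore] -/
theorem eventually_theta_ge_half : ∃ T₀ : ℕ, ∀ T : ℕ, T₀ ≤ T → (T : ℝ) / 2 ≤ θ (T : ℝ) := by
  have h : (fun y : ℝ => Real.log (y + 1) + 2 * (Real.sqrt y * Real.log y)) =o[atTop]
      (fun y => y) := isLittleO_log_add_one.add (isLittleO_sqrt_mul_log.const_mul_left 2)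
  have hev := h.def (show (0 : ℝ) < Real.log 2 - 1 / 2 by
    have := Real.log_two_gt_d9; linarith)
  rw [Filter.eventually_atTop] at hev
  obtain ⟨y₀, hy₀⟩ := hev
  refine ⟨Nat.ceil (max y₀ 1), fun T hT => ?_⟩
  have hTy : y₀ ≤ (T : ℝ) := le_trans (le_trans (le_max_left _ _) (Nat.le_ceil _)) (by exact_mod_cast hT)
  have hT1 : (1 : ℝ) ≤ T := le_trans (le_trans (le_max_right _ _) (Nat.le_ceil _)) (by exact_mod_cast hT)
  have hb := hy₀ T hTy
  have hnn : 0 ≤ Real.log ((T : ℝ) + 1) + 2 * (Real.sqrt T * Real.log T) := by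
    have : 0 ≤ Real.log ((T : ℝ) + 1) := Real.log_nonneg (by linarith)
    have : 0 ≤ Real.sqrt T * Real.log T := mul_nonneg (Real.sqrt_nonneg _) (Real.log_nonneg hT1)
    positivity
  rw [Real.norm_of_nonneg hnn, Real.norm_of_nonneg (Nat.cast_nonneg T)] at hb
  have hθ := theta_ge T
  linarith

/-- `primorial Y ≤ 2 · ∏_{odd p ≤ Y} p`. [folklore] -/
theorem primorial_le_two_mul_prod_oddPrimesLE (Y : ℕ) :
    primorial Y ≤ 2 * ∏ p ∈ oddPrimesLE Y, p := by
  classical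
  unfold primorial
  have hsplit : (Finset.range (Y + 1)).filter Nat.Prime =
      ((Finset.range (Y + 1)).filter (fun p => p.Prime ∧ p = 2)) ∪ oddPrimesLE Y := by
    ext p
    simp only [oddPrimesLE, Finset.mem_filter, Finset.mem_union, Finset.mem_range]
    tauto
  have hdisj : Disjoint ((Finset.range (Y + 1)).filter (fun p => p.Prime ∧ p = 2)) (oddPrimesLE Y) := by
    rw [Finset.disjoint_left]
    intro p hp hp'
    simp only [oddPrimesLE, Finset.mem_filter] at hp hp'
    exact hp'.2.2 hp.2.2
  rw [hsplit, Finset.prod_union hdisj]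
  apply Nat.mul_le_mul_right
  have hsub : (Finset.range (Y + 1)).filter (fun p => p.Prime ∧ p = 2) ⊆ {2} := by
    intro p hp
    simp only [Finset.mem_filter] at hp
    simp [hp.2.2]
  calc ∏ p ∈ (Finset.range (Y + 1)).filter (fun p => p.Prime ∧ p = 2), p
      ≤ ∏ p ∈ ({2} : Finset ℕ), p := by
        apply Finset.prod_le_prod_of_subset_of_one_le' hsub
        intro p hp _
        simp only [Finset.mem_singleton] at hp
        omega
    _ = 2 := by simp

/-- `θ(Y) ≤ log 2 + k log Y` with `k = #(odd primes ≤ Y)`. [folklore] -/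
theorem theta_le_log_two_add {Y : ℕ} (hY : 1 ≤ Y) :
    θ (Y : ℝ) ≤ Real.log 2 + (oddPrimesLE Y).card * Real.log Y := by
  rw [theta_eq_log_primorial, Nat.floor_natCast]
  have h1 : (primorial Y : ℝ) ≤ ((2 * ∏ p ∈ oddPrimesLE Y, p : ℕ) : ℝ) := by
    exact_mod_cast primorial_le_two_mul_prod_oddPrimesLE Y
  have h2 : ∏ p ∈ oddPrimesLE Y, p ≤ Y ^ (oddPrimesLE Y).card := by
    calc ∏ p ∈ oddPrimesLE Y, p ≤ ∏ _p ∈ oddPrimesLE Y, Y :=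
          Finset.prod_le_prod' fun p hp => (mem_oddPrimesLE.mp hp).1
      _ = Y ^ (oddPrimesLE Y).card := Finset.prod_const Y
  have h3 : (primorial Y : ℝ) ≤ 2 * (Y : ℝ) ^ (oddPrimesLE Y).card := by
    refine le_trans h1 ?_
    have : ((2 * ∏ p ∈ oddPrimesLE Y, p : ℕ) : ℝ) ≤ ((2 * Y ^ (oddPrimesLE Y).card : ℕ) : ℝ) := by
      exact_mod_cast Nat.mul_le_mul_left 2 h2
    push_cast at this ⊢
    exact this
  have hY' : (0 : ℝ) < Y := by exact_mod_cast hY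
  calc Real.log (primorial Y : ℝ) ≤ Real.log (2 * (Y : ℝ) ^ (oddPrimesLE Y).card) :=
        Real.log_le_log (by exact_mod_cast primorial_pos Y) h3
    _ = Real.log 2 + (oddPrimesLE Y).card * Real.log Y := by
        rw [Real.log_mul (by norm_num) (by positivity), Real.log_pow]

/-- The sublinear error function of the final inequality is `o(y)`. [folklore] -/
theorem isLittleO_errorFun {J B A a ν c₀ : ℝ} (hA : 0 < A) (ha : 0 < a + 1) (hνa : ν * (a + 1) < 1) :
    (fun y : ℝ => J + B * Real.log y + (A * y ^ (a + 1) * Real.log y) ^ ν / c₀) =o[atTop]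
      (fun y => y) := by
  refine ((isLittleO_const_id_atTop J).add ?_).add ?_
  · exact (Real.isLittleO_log_id_atTop.const_mul_left B)
  · simp_rw [div_eq_inv_mul]
    apply IsLittleO.const_mul_left
    rcases le_or_gt ν 0 with hν | hν
    · -- for `ν ≤ 0` the term is eventually `≤ 1`
      have hbase : Tendsto (fun y : ℝ => A * y ^ (a + 1) * Real.log y) atTop atTop := by
        have h1 : Tendsto (fun y : ℝ => A * y ^ (a + 1)) atTop atTop :=
          (tendsto_rpow_atTop ha).const_mul_atTop hA
        exact h1.atTop_mul_atTop₀ Real.tendsto_log_atTop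
      have hev : ∀ᶠ y in atTop, ‖(A * y ^ (a + 1) * Real.log y) ^ ν‖ ≤ 1 * ‖(1 : ℝ)‖ := by
        filter_upwards [hbase.eventually_ge_atTop 1] with y hy
        rw [Real.norm_of_nonneg (Real.rpow_nonneg (by linarith) ν), norm_one, one_mul]
        exact Real.rpow_le_one_of_one_le_of_nonpos hy hν
      exact (IsBigO.of_bound 1 hev).trans_isLittleO (isLittleO_const_id_atTop (1 : ℝ))
    · exact isLittleO_rpow_main hA.le hνa

end Asymptotics

/-! ### Choice of the parameters and Masser's theorem in even degree -/

section EvenMain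

open Filter Asymptotics Topology Chebyshev Finset

/-- Choice of the slack `σ > 0` with `ν (2λ + 2σ + 1) < 1` (possible as `ν < 1/(2λ+1)`).
[folklore] -/
theorem exists_slack {l ν : ℝ} (hl : 1 ≤ l) (hν : ν < 1 / (2 * l + 1)) :
    ∃ σ : ℝ, 0 < σ ∧ ν * (2 * l + 2 * σ + 1) < 1 := by
  rcases le_or_gt ν 0 with h | h
  · refine ⟨1, one_pos, ?_⟩
    have : ν * (2 * l + 2 * 1 + 1) ≤ 0 := mul_nonpos_of_nonpos_of_nonneg h (by linarith)
    linarith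
  · have hpos : (0 : ℝ) < 2 * l + 1 := by linarith
    have h1 : ν * (2 * l + 1) < 1 := by
      rw [lt_div_iff₀ hpos] at hν; linarith
    refine ⟨(1 - ν * (2 * l + 1)) / (4 * ν), by positivity, ?_⟩
    have : ν * (2 * l + 2 * ((1 - ν * (2 * l + 1)) / (4 * ν)) + 1) =
        ν * (2 * l + 1) + (1 - ν * (2 * l + 1)) / 2 := by
      field_simp
      ring
    rw [this]
    linarith

/-- The final linear bookkeeping for the choice of parameters (pure real arithmetic). [folklore] -/
theorem even_need_arith {logC L3ν c₀ Pν Λν J B logY log2T θY kE Y e a l σ nR : ℝ}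
    (hnR : nR = 2 * e) (ha : a = 2 * l + 2 * σ)
    (hJ : J = logC + (L3ν + 1) / c₀ + nR * Real.log nR + nR * Real.log 18 +
      e * Real.log 4 + e * Real.log 2 + 2 * e * Real.log 2 + e * a * Real.log 2)
    (hB : B = nR * (a + 2) + 2 * e)
    (hlog2Y : Real.log (2 * Y) = Real.log 2 + logY)
    (hfracle : (L3ν + Λν) / c₀ ≤ (L3ν + 1) / c₀ + Pν / c₀)
    (hFY : J + B * logY + Pν / c₀ ≤ e * σ / 2 * Y)
    (hRHS : e * a * (θY - Real.log 2) ≤ kE)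
    (hmain : e * σ / 2 * Y < 2 * e * σ * θY)
    (h2T : 2 * e * log2T ≤ 2 * e * (Real.log 18 + (a + 2) * logY)) :
    logC + (L3ν + Λν) / c₀ + (2 * e) * Real.log (2 * e) + (2 * e) * log2T +
      e * Real.log 4 + e * Real.log 2 + 2 * e * Real.log (2 * Y) + l * (2 * e) * θY < kE := by
  subst hnR ha hJ hB
  rw [hlog2Y]
  linear_combination hfracle + hFY + hRHS + hmain + h2T

/-- Elementary bounds for the parameter choice: with `Y ≥ 3`, `E = ⌊Y^a⌋`, `T ≤ 9 Y^{a+2}`,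
the quantity `Λ = n log n + n log 2T + e log 4 + 2e·Y·E·log Y` satisfies `1 ≤ Λ ≤ A Y^{a+1} log Y`
and `log 2T ≤ log 18 + (a+2) log Y`. [folklore] -/
theorem param_bounds {e : ℕ} (he : 1 ≤ e) {a : ℝ} (ha0 : 0 < a) {Y E T : ℕ} (hY3 : 3 ≤ Y)
    (hEle : (E : ℝ) ≤ (Y : ℝ) ^ a) (hT9 : (T : ℝ) ≤ 9 * (Y : ℝ) ^ (a + 2)) (hT1 : (1 : ℝ) ≤ T) :
    Real.log (2 * (T : ℝ)) ≤ Real.log 18 + (a + 2) * Real.log Y ∧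
    (1 : ℝ) ≤ (2 * e : ℕ) * Real.log (2 * e : ℕ) + (2 * e : ℕ) * Real.log (2 * (T : ℝ)) +
      e * Real.log 4 + 2 * e * ((Y : ℝ) * E * Real.log Y) ∧
    ((2 * e : ℕ) * Real.log (2 * e : ℕ) + (2 * e : ℕ) * Real.log (2 * (T : ℝ)) +
      e * Real.log 4 + 2 * e * ((Y : ℝ) * E * Real.log Y) ≤
      ((2 * e : ℕ) * Real.log (2 * e : ℕ) + (2 * e : ℕ) * Real.log 18 + e * Real.log 4 +
        (2 * e : ℕ) * (a + 2) + 2 * e) * (Y : ℝ) ^ (a + 1) * Real.log Y) := by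
  have hYR : (3 : ℝ) ≤ Y := by exact_mod_cast hY3
  have hY1 : (1 : ℝ) ≤ Y := by linarith
  have hY0 : (0 : ℝ) < Y := by linarith
  have heR : (1 : ℝ) ≤ e := by exact_mod_cast he
  have hnR : ((2 * e : ℕ) : ℝ) = 2 * (e : ℝ) := by push_cast; ring
  have hlogY1 : 1 ≤ Real.log Y := by
    rw [Real.le_log_iff_exp_le hY0]
    have := Real.exp_one_lt_d9; linarith
  have hlogY0 : 0 < Real.log Y := by linarith
  have hlogn : 0 ≤ Real.log ((2 * e : ℕ) : ℝ) := Real.log_nonneg (by rw [hnR]; linarith)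
  have hlog18 : 0 < Real.log 18 := Real.log_pos (by norm_num)
  have hlog4 : 1 < Real.log 4 := by
    rw [Real.lt_log_iff_exp_lt (by norm_num)]; have := Real.exp_one_lt_d9; linarith
  -- `log 2T`
  have hlog2T : Real.log (2 * (T : ℝ)) ≤ Real.log 18 + (a + 2) * Real.log Y := by
    rw [← Real.log_rpow hY0, ← Real.log_mul (by norm_num) (by positivity)]
    exact Real.log_le_log (by positivity) (by linarith)
  have hlog2T0 : 0 ≤ Real.log (2 * (T : ℝ)) := Real.log_nonneg (by linarith)
  -- powers of `Y`
  have hYa1' : (1 : ℝ) ≤ (Y : ℝ) ^ (a + 1) := Real.one_le_rpow hY1 (by linarith)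
  have hYEl : (Y : ℝ) * E * Real.log Y ≤ (Y : ℝ) ^ (a + 1) * Real.log Y := by
    apply mul_le_mul_of_nonneg_right _ hlogY0.le
    calc (Y : ℝ) * E ≤ (Y : ℝ) * (Y : ℝ) ^ a := mul_le_mul_of_nonneg_left hEle hY0.le
      _ = (Y : ℝ) ^ (a + 1) := by
          rw [Real.rpow_add hY0, Real.rpow_one]; ring
  set W := (Y : ℝ) ^ (a + 1) * Real.log Y with hW
  have hW1 : 1 ≤ W := by rw [hW]; nlinarith
  have hW0 : 0 ≤ W := by linarith
  refine ⟨hlog2T, ?_, ?_⟩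
  · have : 0 ≤ ((2 * e : ℕ) : ℝ) * Real.log ((2 * e : ℕ) : ℝ) := by positivity
    have : 0 ≤ ((2 * e : ℕ) : ℝ) * Real.log (2 * (T : ℝ)) := by positivity
    have : 0 ≤ 2 * (e : ℝ) * ((Y : ℝ) * E * Real.log Y) := by positivity
    nlinarith
  · have t1 : ((2 * e : ℕ) : ℝ) * Real.log ((2 * e : ℕ) : ℝ) ≤
        ((2 * e : ℕ) : ℝ) * Real.log ((2 * e : ℕ) : ℝ) * W := le_mul_of_one_le_right (by positivity) hW1
    have t21 : ((2 * e : ℕ) : ℝ) * Real.log 18 ≤ ((2 * e : ℕ) : ℝ) * Real.log 18 * W :=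
      le_mul_of_one_le_right (by positivity) hW1
    have t22 : (a + 2) * Real.log Y ≤ (a + 2) * W := by
      apply mul_le_mul_of_nonneg_left _ (by linarith)
      rw [hW]; exact le_mul_of_one_le_left hlogY0.le hYa1'
    have t2 : ((2 * e : ℕ) : ℝ) * Real.log (2 * (T : ℝ)) ≤
        ((2 * e : ℕ) : ℝ) * Real.log 18 * W + ((2 * e : ℕ) : ℝ) * (a + 2) * W := by
      have := mul_le_mul_of_nonneg_left hlog2T (show (0 : ℝ) ≤ ((2 * e : ℕ) : ℝ) by positivity)
      have := mul_le_mul_of_nonneg_left t22 (show (0 : ℝ) ≤ ((2 * e : ℕ) : ℝ) by positivity)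
      linarith
    have t3 : (e : ℝ) * Real.log 4 ≤ e * Real.log 4 * W := le_mul_of_one_le_right (by positivity) hW1
    have t4 : 2 * (e : ℝ) * ((Y : ℝ) * E * Real.log Y) ≤ 2 * e * W :=
      mul_le_mul_of_nonneg_left hYEl (by positivity)
    have hexp : (((2 * e : ℕ) : ℝ) * Real.log ((2 * e : ℕ) : ℝ) + ((2 * e : ℕ) : ℝ) * Real.log 18 +
        e * Real.log 4 + ((2 * e : ℕ) : ℝ) * (a + 2) + 2 * e) * (Y : ℝ) ^ (a + 1) * Real.log Y =
        ((2 * e : ℕ) : ℝ) * Real.log ((2 * e : ℕ) : ℝ) * W + ((2 * e : ℕ) : ℝ) * Real.log 18 * W +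
        e * Real.log 4 * W + ((2 * e : ℕ) : ℝ) * (a + 2) * W + 2 * e * W := by
      rw [hW]; ring
    rw [hexp]
    linarith

set_option maxHeartbeats 800000 in
/-- **Existence of good parameters** `Y, E, T` for the even-degree assembly.
[cite: Masser2002, §3, Lemma and (3.10)] -/
theorem exists_good_params {e : ℕ} (he : 1 ≤ e) (l ν C : ℝ) (hl : 1 ≤ l)
    (hν : ν < 1 / (2 * l + 1)) :
    ∃ Y E T : ℕ, 3 ≤ Y ∧ 1 ≤ E ∧
      Real.log 2 + 2 * (Y : ℝ) * E * Real.log Y < θ (T : ℝ) ∧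
      Real.log C +
        ((Real.log 3) ^ ν +
          ((2 * e : ℕ) * Real.log (2 * e : ℕ) + (2 * e : ℕ) * Real.log (2 * (T : ℝ)) +
            e * Real.log 4 + 2 * e * ((Y : ℝ) * E * Real.log Y)) ^ ν) / Real.log (Real.log 3) +
        (2 * e : ℕ) * Real.log (2 * e : ℕ) + (2 * e : ℕ) * Real.log (2 * (T : ℝ)) +
        e * Real.log 4 + e * Real.log 2 + 2 * e * Real.log (2 * (Y : ℝ)) +
        l * (2 * e : ℕ) * θ (Y : ℝ) <
        e * ((oddPrimesLE Y).card * Real.log ((E : ℝ) + 1)) := by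
  obtain ⟨σ, hσ, hσν⟩ := exists_slack hl hν
  obtain ⟨a, hadef⟩ : ∃ a : ℝ, a = 2 * l + 2 * σ := ⟨_, rfl⟩
  have ha0 : 0 < a := by rw [hadef]; linarith
  have hνa : ν * (a + 1) < 1 := by rw [hadef]; linarith
  have hnR : ((2 * e : ℕ) : ℝ) = 2 * (e : ℝ) := by push_cast; ring
  have heR : (1 : ℝ) ≤ e := by exact_mod_cast he
  have hc₀ : 0 < Real.log (Real.log 3) := log_log_three_pos
  obtain ⟨A, hAdef⟩ : ∃ A : ℝ, A = (2 * e : ℕ) * Real.log (2 * e : ℕ) + (2 * e : ℕ) * Real.log 18 +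
      e * Real.log 4 + (2 * e : ℕ) * (a + 2) + 2 * e := ⟨_, rfl⟩
  have hlogn : 0 ≤ Real.log ((2 * e : ℕ) : ℝ) := Real.log_nonneg (by rw [hnR]; linarith)
  have hlog18 : 0 < Real.log 18 := Real.log_pos (by norm_num)
  have hlog4 : 0 < Real.log 4 := Real.log_pos (by norm_num)
  have hlog2 : 0 < Real.log 2 := Real.log_pos (by norm_num)
  have hA : 0 < A := by rw [hAdef]; positivity
  obtain ⟨J, hJdef⟩ : ∃ J : ℝ, J = Real.log C + (Real.log 3 ^ ν + 1) / Real.log (Real.log 3) +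
      (2 * (e : ℝ)) * Real.log (2 * (e : ℝ)) + (2 * (e : ℝ)) * Real.log 18 +
      e * Real.log 4 + e * Real.log 2 + 2 * e * Real.log 2 + e * a * Real.log 2 := ⟨_, rfl⟩
  obtain ⟨B, hBdef⟩ : ∃ B : ℝ, B = (2 * (e : ℝ)) * (a + 2) + 2 * e := ⟨_, rfl⟩
  -- Chebyshev and the sublinear error
  obtain ⟨T₀, hT₀⟩ := eventually_theta_ge_half
  have hF := (isLittleO_errorFun (J := J) (B := B) (ν := ν) (c₀ := Real.log (Real.log 3)) hA
    (by linarith) hνa).def (show (0 : ℝ) < e * σ / 2 by positivity)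
  rw [Filter.eventually_atTop] at hF
  obtain ⟨y₀, hy₀⟩ := hF
  -- the parameter `Y`
  obtain ⟨Y, hYdef⟩ : ∃ Y : ℕ, Y = max (max T₀ 3) (Nat.ceil (max y₀ 0)) := ⟨_, rfl⟩
  have hY3 : 3 ≤ Y := hYdef ▸ le_trans (le_max_right _ _) (le_max_left _ _)
  have hYT₀ : T₀ ≤ Y := hYdef ▸ le_trans (le_max_left _ _) (le_max_left _ _)
  have hYy₀ : y₀ ≤ (Y : ℝ) := by
    calc y₀ ≤ max y₀ 0 := le_max_left _ _
      _ ≤ (Nat.ceil (max y₀ 0) : ℝ) := Nat.le_ceil _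
      _ ≤ (Y : ℝ) := by rw [hYdef]; exact_mod_cast le_max_right _ _
  have hYR : (3 : ℝ) ≤ Y := by exact_mod_cast hY3
  have hY1 : (1 : ℝ) ≤ Y := by linarith
  have hY0 : (0 : ℝ) < Y := by linarith
  have hlogY0 : 0 < Real.log Y := Real.log_pos (by linarith)
  have hYa1 : (1 : ℝ) ≤ (Y : ℝ) ^ a := Real.one_le_rpow hY1 ha0.le
  -- the parameter `E`
  obtain ⟨E, hEdef⟩ : ∃ E : ℕ, E = Nat.floor ((Y : ℝ) ^ a) := ⟨_, rfl⟩
  have hE1 : 1 ≤ E := hEdef ▸ Nat.le_floor (by simpa using hYa1)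
  have hEle : (E : ℝ) ≤ (Y : ℝ) ^ a := hEdef ▸ Nat.floor_le (by positivity)
  have hElt : (Y : ℝ) ^ a < (E : ℝ) + 1 := hEdef ▸ Nat.lt_floor_add_one _
  -- the parameter `T`
  obtain ⟨X, hXdef⟩ : ∃ X : ℝ, X = Real.log 2 + 2 * ((Y : ℝ) * E * Real.log Y) := ⟨_, rfl⟩
  have hX0 : 0 < X := by rw [hXdef]; positivity
  obtain ⟨T, hTdef⟩ : ∃ T : ℕ, T = max T₀ (Nat.ceil (2 * X) + 1) := ⟨_, rfl⟩
  have hTT₀ : T₀ ≤ T := hTdef ▸ le_max_left _ _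
  have hTX : 2 * X + 1 ≤ (T : ℝ) := by
    have h1 : ((Nat.ceil (2 * X) + 1 : ℕ) : ℝ) ≤ (T : ℝ) := by
      rw [hTdef]; exact_mod_cast le_max_right _ _
    push_cast at h1
    linarith [Nat.le_ceil (2 * X)]
  have hT : X < θ (T : ℝ) := by
    have := hT₀ T hTT₀
    linarith
  refine ⟨Y, E, T, hY3, hE1, ?_, ?_⟩
  · have : 2 * (Y : ℝ) * E * Real.log Y = 2 * ((Y : ℝ) * E * Real.log Y) := by ring
    rw [this, ← hXdef]; exact hT
  -- facts for `hneed`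
  have f1 : (Y : ℝ) / 2 ≤ θ (Y : ℝ) := hT₀ Y hYT₀
  have f2 : θ (Y : ℝ) ≤ Real.log 2 + (oddPrimesLE Y).card * Real.log Y :=
    theta_le_log_two_add (by omega)
  have f3 : a * Real.log Y ≤ Real.log ((E : ℝ) + 1) := by
    rw [← Real.log_rpow hY0]
    exact Real.log_le_log (by positivity) hElt.le
  -- `T ≤ 9 Y^(a+2)`
  have hYpow : (Y : ℝ) ≤ (Y : ℝ) ^ (a + 2) := by
    calc (Y : ℝ) = (Y : ℝ) ^ (1 : ℝ) := (Real.rpow_one _).symm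
      _ ≤ (Y : ℝ) ^ (a + 2) := Real.rpow_le_rpow_of_exponent_le hY1 (by linarith)
  have hYEa2 : (Y : ℝ) * E * Real.log Y ≤ (Y : ℝ) ^ (a + 2) := by
    have hlogYY : Real.log Y ≤ (Y : ℝ) := Real.log_le_self hY0.le
    calc (Y : ℝ) * E * Real.log Y ≤ (Y : ℝ) * (Y : ℝ) ^ a * Y := by
          apply mul_le_mul (mul_le_mul_of_nonneg_left hEle hY0.le) hlogYY hlogY0.le (by positivity)
      _ = (Y : ℝ) ^ (a + 2) := by
          rw [show a + 2 = 1 + a + 1 by ring, Real.rpow_add hY0 (1 + a) 1, Real.rpow_add hY0 1 a,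
            Real.rpow_one]
  have hT9 : (T : ℝ) ≤ 9 * (Y : ℝ) ^ (a + 2) := by
    have h1 : (T : ℝ) ≤ T₀ + (Nat.ceil (2 * X) + 1 : ℕ) := by
      rw [hTdef]; exact_mod_cast max_le_add_of_nonneg (Nat.zero_le _) (Nat.zero_le _)
    have h2 : ((Nat.ceil (2 * X) + 1 : ℕ) : ℝ) ≤ 2 * X + 2 := by
      push_cast; linarith [Nat.ceil_lt_add_one (show 0 ≤ 2 * X by positivity)]
    have h3 : (T₀ : ℝ) ≤ Y := by exact_mod_cast hYT₀
    have h5 : Real.log 2 < 1 := by have := Real.log_two_lt_d9; linarith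
    have h6 : (1 : ℝ) ≤ (Y : ℝ) ^ (a + 2) := le_trans hY1 hYpow
    have hXle : X ≤ Real.log 2 + 2 * (Y : ℝ) ^ (a + 2) := by rw [hXdef]; linarith
    linarith
  have hT1 : (1 : ℝ) ≤ T := by linarith
  obtain ⟨hlog2T, hΛ1, hΛle⟩ := param_bounds he ha0 hY3 hEle hT9 hT1
  rw [← hAdef] at hΛle
  have hΛν : ((2 * e : ℕ) * Real.log (2 * e : ℕ) + (2 * e : ℕ) * Real.log (2 * (T : ℝ)) +
      e * Real.log 4 + 2 * e * ((Y : ℝ) * E * Real.log Y)) ^ ν ≤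
      1 + (A * (Y : ℝ) ^ (a + 1) * Real.log Y) ^ ν := by
    have hpos : 0 ≤ (A * (Y : ℝ) ^ (a + 1) * Real.log Y) ^ ν := Real.rpow_nonneg (by positivity) ν
    rcases le_or_gt 0 ν with hν0 | hν0
    · have := Real.rpow_le_rpow (by linarith) hΛle hν0
      linarith
    · have := Real.rpow_le_one_of_one_le_of_nonpos hΛ1 hν0.le
      linarith
  -- the sublinear bound at `Y`
  have hFY := hy₀ Y hYy₀
  rw [Real.norm_of_nonneg hY0.le] at hFY
  rw [Real.norm_eq_abs] at hFY
  have hFY' : J + B * Real.log Y + (A * (Y : ℝ) ^ (a + 1) * Real.log Y) ^ ν / Real.log (Real.log 3) ≤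
      e * σ / 2 * Y := le_trans (le_abs_self _) hFY
  -- assemble `hneed`
  have hk0 : (0 : ℝ) ≤ (oddPrimesLE Y).card := Nat.cast_nonneg _
  have hRHS : (e : ℝ) * a * (θ (Y : ℝ) - Real.log 2) ≤
      e * ((oddPrimesLE Y).card * Real.log ((E : ℝ) + 1)) := by
    have h1 : ((oddPrimesLE Y).card : ℝ) * (a * Real.log Y) ≤
        (oddPrimesLE Y).card * Real.log ((E : ℝ) + 1) := mul_le_mul_of_nonneg_left f3 hk0
    have h2 : a * (θ (Y : ℝ) - Real.log 2) ≤ (oddPrimesLE Y).card * (a * Real.log Y) := by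
      have := mul_le_mul_of_nonneg_left f2 ha0.le
      linarith
    have := mul_le_mul_of_nonneg_left (le_trans h2 h1) (show (0 : ℝ) ≤ e by positivity)
    linarith
  have hfracle : (Real.log 3 ^ ν + ((2 * e : ℕ) * Real.log (2 * e : ℕ) +
      (2 * e : ℕ) * Real.log (2 * (T : ℝ)) + e * Real.log 4 + 2 * e * ((Y : ℝ) * E * Real.log Y)) ^ ν) /
        Real.log (Real.log 3) ≤
      (Real.log 3 ^ ν + 1) / Real.log (Real.log 3) +
        (A * (Y : ℝ) ^ (a + 1) * Real.log Y) ^ ν / Real.log (Real.log 3) := by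
    rw [← add_div]
    apply div_le_div_of_nonneg_right _ hc₀.le
    linarith
  have hlog2Y : Real.log (2 * (Y : ℝ)) = Real.log 2 + Real.log Y :=
    Real.log_mul (by norm_num) hY0.ne'
  have hmain : (e : ℝ) * σ / 2 * Y < 2 * e * σ * θ (Y : ℝ) := by
    have h1 : (e : ℝ) * σ * Y ≤ 2 * e * σ * θ (Y : ℝ) := by
      have := mul_le_mul_of_nonneg_left f1 (show (0 : ℝ) ≤ 2 * e * σ by positivity)
      linarith
    have h2 : (0 : ℝ) < e * σ * Y := by positivity
    linarith
  have h2T : 2 * (e : ℝ) * Real.log (2 * (T : ℝ)) ≤ 2 * e * (Real.log 18 + (a + 2) * Real.log Y) :=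
    mul_le_mul_of_nonneg_left hlog2T (by positivity)
  rw [hnR] at hfracle ⊢
  exact even_need_arith rfl hadef hJdef hBdef hlog2Y hfracle hFY' hRHS hmain h2T

/-- **Masser's theorem (`UniformABCDiscriminantSharp`) in every even degree.** For even
`n ≥ 2`, real `λ ≥ 1`, `ν < 1/(λn + 1)` and `C`, there is a number field `K` of degree `n` and
nonzero `a + b + c = 0` in `K` with `H_K(a,b,c) > C · |D_K| · φ_ν(|D_K|) · S_K(a,b,c)^λ`.
This is the statement of `UniformABCDiscriminantSharp` restricted to even `n`, proved by Masser's
construction in degree `2` (where the trinomial `X² − 2vX + u²` is irreducible or has a rational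
root, so that no appeal to Hilbert irreducibility/Faltings is needed) followed by the base change
`K ↦ K(r^{1/e})`, `n = 2e`. [cite: Masser2002, Theorem and §3] -/
theorem uniformABCDiscriminantSharp_even :
    ∀ n : ℕ, 2 ≤ n → Even n → ∀ l : ℝ, 1 ≤ l → ∀ ν : ℝ, ν < 1 / (l * n + 1) → ∀ C : ℝ,
      ∃ (K : Type) (_ : Field K) (_ : NumberField K),
        Module.finrank ℚ K = n ∧
          ∃ a b c : K, a ≠ 0 ∧ b ≠ 0 ∧ c ≠ 0 ∧ a + b + c = 0 ∧
            C * |(NumberField.discr K : ℝ)| * masserPhi ν |(NumberField.discr K : ℝ)| *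
                (masserSupport a b c : ℝ) ^ l <
              mulHeight ![a, b, c] := by
  intro n hn heven l hl ν hν C
  obtain ⟨e, he2⟩ := heven
  have he : 1 ≤ e := by omega
  have hne : n = 2 * e := by omega
  have hν' : ν < 1 / (2 * l + 1) := by
    refine lt_of_lt_of_le hν ?_
    apply one_div_le_one_div_of_le (by linarith)
    have : (2 : ℝ) ≤ n := by exact_mod_cast hn
    nlinarith
  obtain ⟨Y, E, T, hY, hE, hT, hneed⟩ := exists_good_params he l ν C hl hν'
  obtain ⟨K, iF, iN, hfin, a, b, c, ha, hb, hc, habc, hlt⟩ :=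
    even_assembly he l ν C hl hY hE hT hneed
  exact ⟨K, iF, iN, hfin.trans hne.symm, a, b, c, ha, hb, hc, habc, hlt⟩

/-- The even-degree case in the exact shape of the barrier fact: for even `n` the conclusion of
`UniformABCDiscriminantSharp` holds. [cite: Masser2002, Theorem] -/
theorem uniformABCDiscriminantSharp_of_even {n : ℕ} (hn : 2 ≤ n) (heven : Even n) {l : ℝ}
    (hl : 1 ≤ l) {ν : ℝ} (hν : ν < 1 / (l * n + 1)) (C : ℝ) :
    ∃ (K : Type) (_ : Field K) (_ : NumberField K),
      Module.finrank ℚ K = n ∧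
        ∃ a b c : K, a ≠ 0 ∧ b ≠ 0 ∧ c ≠ 0 ∧ a + b + c = 0 ∧
          C * |(NumberField.discr K : ℝ)| * masserPhi ν |(NumberField.discr K : ℝ)| *
              (masserSupport a b c : ℝ) ^ l <
            mulHeight ![a, b, c] :=
  uniformABCDiscriminantSharp_even n hn heven l hl ν hν C

end EvenMain

/-! ### The cubic base field `K = ℚ(ξ)`, `ξ³ = 3v²ξ − 2u³` (Masser's trinomial with `n = 3`)

For `n = 3` Masser's polynomial is `X³ − 3v²X + 2u³` (`A = 3v²`, `B = 2u³`); it is congruent to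
`(X − v)²(X + 2v)` modulo `2(u³ − v³)`, and `ω = (ξ − v)(ξ + 2v)/M` is integral when
`M² ∣ v − u`. [cite: Masser2002, §3 (3.6)] -/

section Cubic

open Polynomial

/-- Masser's trinomial for `n = 3`: `X³ − 3v²X + 2u³` over `ℚ`. [cite: Masser2002, §3 (3.6)] -/
def masserCubic (u v : ℕ) : ℚ[X] := X ^ 3 - C (3 * (v : ℚ) ^ 2) * X + C (2 * (u : ℚ) ^ 3)

/-- Degree `3`. [folklore] -/
theorem masserCubic_natDegree (u v : ℕ) : (masserCubic u v).natDegree = 3 := by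
  unfold masserCubic; compute_degree!

/-- Monic. [folklore] -/
theorem masserCubic_monic (u v : ℕ) : (masserCubic u v).Monic := by
  unfold masserCubic; monicity!

/-- Nonzero. [folklore] -/
theorem masserCubic_ne_zero (u v : ℕ) : masserCubic u v ≠ 0 := (masserCubic_monic u v).ne_zero

/-- The `X²`-coefficient vanishes. [folklore] -/
theorem masserCubic_nextCoeff (u v : ℕ) : (masserCubic u v).nextCoeff = 0 := by
  rw [nextCoeff_of_natDegree_pos (by rw [masserCubic_natDegree]; norm_num), masserCubic_natDegree]
  simp only [masserCubic, Nat.add_one_sub_one, coeff_add, coeff_sub, coeff_X_pow, coeff_C_mul,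
    coeff_X, coeff_C_succ]
  norm_num

/-- Evaluation of the cubic. [folklore] -/
theorem masserCubic_eval (u v : ℕ) (t : ℚ) :
    (masserCubic u v).eval t = t ^ 3 - 3 * (v : ℚ) ^ 2 * t + 2 * (u : ℚ) ^ 3 := by
  simp only [masserCubic, eval_add, eval_sub, eval_pow, eval_X, eval_mul, eval_C]

/-- The cubic field `K = ℚ[X]/(X³ − 3v²X + 2u³)`. [cite: Masser2002, §3 (3.6)] -/
abbrev MasserCubicField (u v : ℕ) : Type := AdjoinRoot (masserCubic u v)

variable {u v : ℕ} [hirr3 : Fact (Irreducible (masserCubic u v))]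

/-- The root `ξ` of `X³ − 3v²X + 2u³`. [folklore] -/
abbrev cubRoot (u v : ℕ) : MasserCubicField u v := AdjoinRoot.root (masserCubic u v)

/-- `ξ` is a root. [folklore] -/
theorem aeval_cubRoot :
    aeval (cubRoot u v) (X ^ 3 - C (3 * (v : ℚ) ^ 2) * X + C (2 * (u : ℚ) ^ 3)) = 0 := by
  have h := AdjoinRoot.mk_self (f := masserCubic u v)
  rw [← AdjoinRoot.aeval_eq] at h
  exact h

/-- `ξ³ = 3v² ξ − 2u³`. [folklore] -/
theorem cubRoot_cube :
    (cubRoot u v) ^ 3 = algebraMap ℚ _ (3 * (v : ℚ) ^ 2) * cubRoot u v -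
      algebraMap ℚ _ (2 * (u : ℚ) ^ 3) := by
  have h := aeval_cubRoot (u := u) (v := v)
  simp only [map_add, map_sub, map_mul, aeval_X_pow, aeval_X, aeval_C] at h
  rw [map_mul, map_mul]
  linear_combination h

/-- `ξ` is an algebraic integer. [folklore] -/
theorem isIntegral_cubRoot : IsIntegral ℤ (cubRoot u v) := by
  refine ⟨X ^ 3 - C (3 * (v : ℤ) ^ 2) * X + C (2 * (u : ℤ) ^ 3), by monicity!, ?_⟩
  have h := cubRoot_cube (u := u) (v := v)
  simp only [map_pow, map_mul, map_ofNat, map_natCast] at h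
  simp only [eval₂_add, eval₂_sub, eval₂_mul, eval₂_X_pow, eval₂_X, eval₂_C]
  simp only [map_mul, map_pow, map_natCast, map_ofNat]
  linear_combination h

/-- `minpoly_ℚ(ξ) = X³ − 3v²X + 2u³`. [folklore] -/
theorem minpoly_cubRoot : minpoly ℚ (cubRoot u v) = masserCubic u v := by
  have h := AdjoinRoot.minpoly_powerBasis_gen_of_monic (K := ℚ) (masserCubic_monic u v)
    (hirr3.out.ne_zero)
  rwa [AdjoinRoot.powerBasis_gen] at h

/-- `[K:ℚ] = 3`. [folklore] -/
theorem finrank_masserCubicField : Module.finrank ℚ (MasserCubicField u v) = 3 := by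
  rw [PowerBasis.finrank (AdjoinRoot.powerBasis (masserCubic_ne_zero u v)),
    AdjoinRoot.powerBasis_dim, masserCubic_natDegree]

/-- `Tr_{K/ℚ}(ξ) = 0`. [folklore] -/
theorem trace_cubRoot : Algebra.trace ℚ (MasserCubicField u v) (cubRoot u v) = 0 := by
  have h := PowerBasis.trace_gen_eq_nextCoeff_minpoly
    (AdjoinRoot.powerBasis (masserCubic_ne_zero u v))
  rw [AdjoinRoot.minpoly_powerBasis_gen_of_monic (masserCubic_monic u v),
    AdjoinRoot.powerBasis_gen, masserCubic_nextCoeff, neg_zero] at h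
  exact h

/-- `N_{K/ℚ}(ξ − t) = −F(t)` for rational `t`. [folklore] -/
theorem norm_cubRoot_sub (t : ℚ) :
    Algebra.norm ℚ (cubRoot u v - algebraMap ℚ _ t) = -((masserCubic u v).eval t) := by
  have hξ : IsIntegral ℚ (cubRoot u v) := (isIntegral_cubRoot (u := u) (v := v)).tower_top
  have hx : IsIntegral ℚ (cubRoot u v - algebraMap ℚ _ t) := hξ.sub isIntegral_algebraMap
  have hadj : Algebra.adjoin ℚ {cubRoot u v - algebraMap ℚ (MasserCubicField u v) t} = ⊤ := by
    apply PowerBasis.adjoin_eq_top_of_gen_mem_adjoin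
      (B := AdjoinRoot.powerBasis (masserCubic_ne_zero u v))
    rw [AdjoinRoot.powerBasis_gen]
    have hmem : (cubRoot u v - algebraMap ℚ (MasserCubicField u v) t) +
        algebraMap ℚ (MasserCubicField u v) t ∈
        Algebra.adjoin ℚ {cubRoot u v - algebraMap ℚ (MasserCubicField u v) t} :=
      Subalgebra.add_mem _ (Algebra.self_mem_adjoin_singleton ℚ _) (Subalgebra.algebraMap_mem _ t)
    rw [sub_add_cancel] at hmem
    exact hmem
  have h := Algebra.PowerBasis.norm_gen_eq_coeff_zero_minpoly (PowerBasis.ofAdjoinEqTop hx hadj)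
  rw [PowerBasis.ofAdjoinEqTop_gen, PowerBasis.ofAdjoinEqTop_dim, minpoly.sub_algebraMap,
    minpoly_cubRoot] at h
  rw [h, natDegree_comp, masserCubic_natDegree, natDegree_X_add_C, mul_one,
    coeff_zero_eq_eval_zero, eval_comp, eval_add, eval_X, eval_C, zero_add]
  ring

/-- The degenerate factorisation: `(ξ − v)²(ξ + 2v) = 2(v³ − u³)` in `K`
(`X³ − 3v²X + 2u³ − (X − v)²(X + 2v) = 2(u³ − v³)`). [cite: Masser2002, §3 (3.9)] -/
theorem cubRoot_degenerate :
    (cubRoot u v - algebraMap ℚ _ (v : ℚ)) ^ 2 * (cubRoot u v + algebraMap ℚ _ (2 * (v : ℚ))) =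
      algebraMap ℚ _ (2 * ((v : ℚ) ^ 3 - (u : ℚ) ^ 3)) := by
  have h := cubRoot_cube (u := u) (v := v)
  simp only [map_sub, map_pow, map_mul, map_ofNat, map_natCast] at h ⊢
  linear_combination h

variable (u v) in
/-- The integral element `ω = (ξ − v)(ξ + 2v)/M` (for `M² ∣ v − u`), realising the index `M` of
`ℤ[ξ]` in the cubic case. [cite: Masser2002, §3 (3.9)] -/
def cubOmega (M : ℕ) : MasserCubicField u v :=
  algebraMap ℚ _ ((M : ℚ)⁻¹) *
    ((cubRoot u v - algebraMap ℚ _ (v : ℚ)) * (cubRoot u v + algebraMap ℚ _ (2 * (v : ℚ))))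

/-- `ω² = (2(v³ − u³)/M²) · (ξ + 2v)`. [folklore] -/
theorem cubOmega_sq {M : ℕ} :
    (cubOmega u v M) ^ 2 = algebraMap ℚ _ (2 * ((v : ℚ) ^ 3 - (u : ℚ) ^ 3) / (M : ℚ) ^ 2) *
      (cubRoot u v + algebraMap ℚ _ (2 * (v : ℚ))) := by
  have h := cubRoot_degenerate (u := u) (v := v)
  have e1 : (cubOmega u v M) ^ 2 = algebraMap ℚ _ ((M : ℚ)⁻¹ ^ 2) *
      (((cubRoot u v - algebraMap ℚ _ (v : ℚ)) ^ 2 * (cubRoot u v + algebraMap ℚ _ (2 * (v : ℚ)))) *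
        (cubRoot u v + algebraMap ℚ _ (2 * (v : ℚ)))) := by
    unfold cubOmega; rw [map_pow]; ring
  rw [e1, h, ← mul_assoc, ← map_mul]
  congr 2
  rw [div_eq_mul_inv, inv_pow]; ring

/-- `ω = (ξ² + vξ − 2v²)/M`. [folklore] -/
theorem cubOmega_eq {M : ℕ} :
    cubOmega u v M = algebraMap ℚ _ ((M : ℚ)⁻¹) *
      ((cubRoot u v) ^ 2 + algebraMap ℚ _ (v : ℚ) * cubRoot u v -
        algebraMap ℚ _ (2 * (v : ℚ) ^ 2)) := by
  unfold cubOmega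
  simp only [map_mul, map_pow, map_ofNat]
  ring

/-- `ω` is an algebraic integer (its square is `c (ξ + 2v)` with `c ∈ ℤ`). [folklore] -/
theorem isIntegral_cubOmega {M : ℕ} {c : ℤ}
    (hc : (c : ℚ) = 2 * ((v : ℚ) ^ 3 - (u : ℚ) ^ 3) / (M : ℚ) ^ 2) :
    IsIntegral ℤ (cubOmega u v M) := by
  apply IsIntegral.of_pow (n := 2) (by norm_num)
  rw [cubOmega_sq, ← hc]
  have hξ : IsIntegral ℤ (cubRoot u v) := isIntegral_cubRoot
  have h1 : IsIntegral ℤ (algebraMap ℚ (MasserCubicField u v) (c : ℚ)) := by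
    have e : algebraMap ℚ (MasserCubicField u v) (c : ℚ) = algebraMap ℤ (MasserCubicField u v) c := by
      simp
    rw [e]
    exact isIntegral_algebraMap
  have h2 : IsIntegral ℤ (algebraMap ℚ (MasserCubicField u v) (2 * (v : ℚ))) := by
    have e : algebraMap ℚ (MasserCubicField u v) (2 * (v : ℚ)) =
        algebraMap ℤ (MasserCubicField u v) (2 * v) := by
      simp
    rw [e]
    exact isIntegral_algebraMap
  exact h1.mul (hξ.add h2)

/-- The root `ξ` generates `K`: `1, ξ, ξ²` are linearly independent. [folklore] -/
theorem linearIndependent_pow_cubRoot :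
    LinearIndependent ℚ (fun i : Fin 3 => (cubRoot u v) ^ (i : ℕ)) := by
  have hdim : (AdjoinRoot.powerBasis (masserCubic_ne_zero u v)).dim = 3 := by
    rw [AdjoinRoot.powerBasis_dim, masserCubic_natDegree]
  have h := ((AdjoinRoot.powerBasis (masserCubic_ne_zero u v)).basis.reindex (finCongr hdim)).linearIndependent
  have e : (fun i : Fin 3 => (cubRoot u v) ^ (i : ℕ)) =
      ⇑((AdjoinRoot.powerBasis (masserCubic_ne_zero u v)).basis.reindex (finCongr hdim)) := by
    funext i
    rw [Module.Basis.coe_reindex, Function.comp_apply, PowerBasis.coe_basis]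
    simp
  rw [e]
  exact h

/-- `1, ξ, ω` are linearly independent over `ℚ`. [folklore] -/
theorem linearIndependent_cubBasis {M : ℕ} (hM : M ≠ 0) :
    LinearIndependent ℚ ![(1 : MasserCubicField u v), cubRoot u v, cubOmega u v M] := by
  rw [Fintype.linearIndependent_iff]
  intro g hg
  have hli := Fintype.linearIndependent_iff.mp (linearIndependent_pow_cubRoot (u := u) (v := v))
  have hMQ : (M : ℚ) ≠ 0 := by exact_mod_cast hM
  -- rewrite the relation in the power basis
  set g' : Fin 3 → ℚ := ![g 0 - g 2 * (M : ℚ)⁻¹ * (2 * (v : ℚ) ^ 2),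
    g 1 + g 2 * (M : ℚ)⁻¹ * (v : ℚ), g 2 * (M : ℚ)⁻¹] with hg'
  have hrel : ∑ i : Fin 3, g' i • (cubRoot u v) ^ (i : ℕ) = 0 := by
    rw [Fin.sum_univ_three] at hg ⊢
    simp only [hg', Matrix.cons_val_zero, Matrix.cons_val_one, Matrix.cons_val_two,
      Matrix.tail_cons, Matrix.head_cons, Fin.val_zero, Fin.val_one, Fin.val_two, pow_zero,
      pow_one] at hg ⊢
    rw [cubOmega_eq] at hg
    simp only [Algebra.smul_def, map_sub, map_add, map_mul, map_pow, map_ofNat, map_natCast,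
      map_inv₀] at hg ⊢
    linear_combination hg
  have h0 := hli g' hrel
  have e2 : g 2 = 0 := by
    have := h0 2
    simp only [hg', Matrix.cons_val_two, Matrix.tail_cons, Matrix.head_cons, mul_eq_zero,
      inv_eq_zero, Nat.cast_eq_zero] at this
    tauto
  have e1 : g 1 = 0 := by
    have := h0 1
    simp only [hg', Matrix.cons_val_one, e2, zero_mul, add_zero] at this
    exact this
  have e0 : g 0 = 0 := by
    have := h0 0
    simp only [hg', Matrix.cons_val_zero, e2, zero_mul, sub_zero] at this
    exact this
  intro i
  fin_cases i
  · exact e0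
  · exact e1
  · exact e2

/-- The `ℚ`-basis `(1, ξ, ω)` of the cubic field. [folklore] -/
def cubBasis {M : ℕ} (hM : M ≠ 0) : Module.Basis (Fin 3) ℚ (MasserCubicField u v) :=
  basisOfLinearIndependentOfCardEqFinrank (linearIndependent_cubBasis hM)
    (by rw [finrank_masserCubicField]; simp)

/-- Values of `cubBasis`. [folklore] -/
theorem coe_cubBasis {M : ℕ} (hM : M ≠ 0) :
    ⇑(cubBasis (u := u) (v := v) hM) = ![(1 : MasserCubicField u v), cubRoot u v, cubOmega u v M] := by
  simp [cubBasis]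

/-- `N_{K/ℚ}(F'(ξ)) = −108 (v⁶ − u⁶)` for `F = X³ − 3v²X + 2u³` (`F'(ξ) = 3(ξ−v)(ξ+v)`).
[folklore] -/
theorem norm_derivative_cubRoot :
    Algebra.norm ℚ (aeval (cubRoot u v) (derivative (masserCubic u v))) =
      -(108 * ((v : ℚ) ^ 6 - (u : ℚ) ^ 6)) := by
  have hF' : derivative (masserCubic u v) = C (3 : ℚ) * X ^ 2 - C (3 * (v : ℚ) ^ 2) := by
    unfold masserCubic
    rw [derivative_add, derivative_sub, derivative_X_pow, derivative_C_mul_X, derivative_C,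
      add_zero]
    norm_num
  have hder : aeval (cubRoot u v) (derivative (masserCubic u v)) =
      algebraMap ℚ _ 3 * ((cubRoot u v - algebraMap ℚ _ (v : ℚ)) *
        (cubRoot u v - algebraMap ℚ _ (-(v : ℚ)))) := by
    rw [hF']
    simp only [map_sub, map_mul, aeval_C, aeval_X, map_neg, map_pow]
    ring
  rw [hder, map_mul, map_mul, Algebra.norm_algebraMap, finrank_masserCubicField, norm_cubRoot_sub,
    norm_cubRoot_sub, masserCubic_eval, masserCubic_eval]
  ring

/-- The discriminant of the power basis `(1, ξ, ξ²)` is `108 (v⁶ − u⁶)`. [folklore] -/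
theorem discr_powerBasis_cubRoot :
    Algebra.discr ℚ (AdjoinRoot.powerBasis (masserCubic_ne_zero u v)).basis =
      108 * ((v : ℚ) ^ 6 - (u : ℚ) ^ 6) := by
  rw [Algebra.discr_powerBasis_eq_norm, finrank_masserCubicField, AdjoinRoot.powerBasis_gen,
    minpoly_cubRoot, norm_derivative_cubRoot]
  norm_num

/-- The change of basis from `(1, ξ, ξ²)` to `(1, ξ, ω)`. [folklore] -/
def cubChange (v M : ℕ) : Matrix (Fin 3) (Fin 3) ℚ :=
  !![1, 0, -(2 * (v : ℚ) ^ 2) * (M : ℚ)⁻¹; 0, 1, (v : ℚ) * (M : ℚ)⁻¹; 0, 0, (M : ℚ)⁻¹]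

/-- `det (cubChange v M) = 1/M`. [folklore] -/
theorem det_cubChange (v M : ℕ) : (cubChange v M).det = (M : ℚ)⁻¹ := by
  unfold cubChange
  rw [Matrix.det_fin_three]
  simp

/-- `disc_ℚ(1, ξ, ω) = 108 (v⁶ − u⁶)/M²`. [folklore] -/
theorem discr_cubBasis {M : ℕ} (hM : M ≠ 0) :
    Algebra.discr ℚ (cubBasis (u := u) (v := v) hM) =
      108 * ((v : ℚ) ^ 6 - (u : ℚ) ^ 6) / (M : ℚ) ^ 2 := by
  classical
  have hdim : (AdjoinRoot.powerBasis (masserCubic_ne_zero u v)).dim = 3 := by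
    rw [AdjoinRoot.powerBasis_dim, masserCubic_natDegree]
  set b₀ := (AdjoinRoot.powerBasis (masserCubic_ne_zero u v)).basis.reindex (finCongr hdim) with hb₀
  have hb₀apply : ∀ i : Fin 3, b₀ i = (cubRoot u v) ^ (i : ℕ) := by
    intro i
    rw [hb₀, Module.Basis.coe_reindex, Function.comp_apply, PowerBasis.coe_basis]
    simp
  have hdiscr₀ : Algebra.discr ℚ b₀ = 108 * ((v : ℚ) ^ 6 - (u : ℚ) ^ 6) := by
    rw [hb₀, Module.Basis.coe_reindex, Algebra.discr_reindex, discr_powerBasis_cubRoot]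
  have hvec : ⇑(cubBasis (u := u) (v := v) hM) =
      Matrix.vecMul (⇑b₀) ((cubChange v M).map (algebraMap ℚ (MasserCubicField u v))) := by
    rw [coe_cubBasis]
    funext j
    simp only [Matrix.vecMul, dotProduct, Fin.sum_univ_three, Matrix.map_apply, hb₀apply,
      Fin.val_zero, Fin.val_one, Fin.val_two, pow_zero, pow_one, cubChange]
    fin_cases j
    · simp
    · simp
    · simp only [Fin.reduceFinMk, Matrix.cons_val_two, Matrix.tail_cons, Matrix.head_cons,
        Fin.isValue, Matrix.of_apply, Matrix.cons_val', Matrix.cons_val_zero, Matrix.cons_val_one,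
        Matrix.empty_val']
      rw [cubOmega_eq]
      simp only [map_mul, map_neg, map_inv₀, map_natCast, map_pow, map_ofNat]
      ring
  rw [hvec, Algebra.discr_of_matrix_vecMul, det_cubChange, hdiscr₀]
  field_simp

/-- **Discriminant step for `n = 3`**: if `M² ∣ v − u` then `|D_K| ≤ 108 (v⁶ − u⁶)/M²` and
`D_K ∣ 108 (v⁶ − u⁶)/M²`. [cite: Masser2002, §3 (3.9)] -/
theorem abs_discr_masserCubicField_le {M : ℕ} (hM : M ≠ 0) {c c' : ℤ}
    (hc : (c : ℚ) = 2 * ((v : ℚ) ^ 3 - (u : ℚ) ^ 3) / (M : ℚ) ^ 2)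
    (hc' : (c' : ℚ) = ((v : ℚ) ^ 6 - (u : ℚ) ^ 6) / (M : ℚ) ^ 2) :
    |((NumberField.discr (MasserCubicField u v) : ℤ) : ℚ)| ≤ 108 * |(c' : ℚ)| ∧
      NumberField.discr (MasserCubicField u v) ∣ 108 * c' := by
  classical
  have hint : ∀ i, IsIntegral ℤ (cubBasis (u := u) (v := v) hM i) := by
    intro i
    rw [coe_cubBasis]
    fin_cases i
    · exact isIntegral_one
    · exact isIntegral_cubRoot
    · exact isIntegral_cubOmega hc
  have hdiscr : Algebra.discr ℚ (cubBasis (u := u) (v := v) hM) = ((108 * c' : ℤ) : ℚ) := by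
    rw [discr_cubBasis hM]; push_cast; rw [hc']; ring
  refine ⟨?_, discr_dvd_of_isIntegral _ hint hdiscr⟩
  refine le_trans (abs_discr_le_abs_discr_of_isIntegral _ hint) ?_
  rw [hdiscr]
  push_cast
  rw [abs_mul]
  norm_num

end Cubic

/-! ### The algebraic core in base degree `3`: a field of degree `n = 3e` with Masser's triple -/

section CubicCore

open Polynomial

/-- In any number field containing an algebraic integer root of `X³ − 3v²X + 2u³` we get Masser's
triple for `n = 3` with `A = 3v²`, `B = 2u³`. [cite: Masser2002, §3 (3.7)–(3.8)] -/
theorem exists_masserTriple_cubic {L : Type*} [Field L] [NumberField L] {u v : ℕ} (hu : 0 < u)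
    (hv : 0 < v) (hcop : Nat.Coprime (3 * v ^ 2) (2 * u ^ 3)) (ξ : 𝓞 L)
    (hξ : ξ ^ 3 = ((3 * v ^ 2 : ℕ) : 𝓞 L) * ξ - ((2 * u ^ 3 : ℕ) : 𝓞 L)) :
    ∃ a b c : L, a ≠ 0 ∧ b ≠ 0 ∧ c ≠ 0 ∧ a + b + c = 0 ∧
      ((3 * v ^ 2 : ℕ) : ℝ) ^ Module.finrank ℚ L ≤ mulHeight ![a, b, c] ∧
      masserSupport a b c ≤ (∏ p ∈ (3 * v ^ 2 * (2 * u ^ 3)).primeFactors, p) ^ Module.finrank ℚ L :=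
  exists_masserTriple (N := 3) ξ hξ (by norm_num) hcop (by positivity) (by positivity)

variable {u v e r : ℕ}

/-- Cubic core, generic case: `X³ − 3v²X + 2u³` irreducible, `L = K(r^{1/e})`. [folklore] -/
theorem exists_field_three_core_irred (hu : 0 < u) (hv : 0 < v)
    (hcop : Nat.Coprime (3 * v ^ 2) (2 * u ^ 3)) (he : 1 ≤ e) (hr : r.Prime)
    [Fact (Irreducible (masserCubic u v))]
    [Fact (Irreducible (rootPolyK (MasserCubicField u v) e r))] :
    Module.finrank ℚ (BaseChangeField (MasserCubicField u v) e r) = 3 * e ∧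
    (NumberField.discr (BaseChangeField (MasserCubicField u v) e r)).natAbs ≤
      e ^ (3 * e) * r ^ (3 * (e - 1)) * (NumberField.discr (MasserCubicField u v)).natAbs ^ e ∧
    ∃ a b c : BaseChangeField (MasserCubicField u v) e r, a ≠ 0 ∧ b ≠ 0 ∧ c ≠ 0 ∧ a + b + c = 0 ∧
      ((3 * v ^ 2 : ℕ) : ℝ) ^ (3 * e) ≤ mulHeight ![a, b, c] ∧
      masserSupport a b c ≤ (∏ p ∈ (3 * v ^ 2 * (2 * u ^ 3)).primeFactors, p) ^ (3 * e) := by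
  set ξK : 𝓞 (MasserCubicField u v) := ⟨cubRoot u v, isIntegral_cubRoot⟩ with hξKdef
  have hξK : ξK ^ 3 = ((3 * v ^ 2 : ℕ) : 𝓞 (MasserCubicField u v)) * ξK -
      ((2 * u ^ 3 : ℕ) : 𝓞 (MasserCubicField u v)) := by
    apply RingOfIntegers.ext
    simp only [hξKdef, map_pow, RingOfIntegers.map_mk, map_sub, map_mul, map_natCast]
    have h := cubRoot_cube (u := u) (v := v)
    simp only [map_mul, map_ofNat, map_natCast, map_pow] at h
    push_cast
    exact h
  set ξ : 𝓞 (BaseChangeField (MasserCubicField u v) e r) :=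
    algebraMap (𝓞 (MasserCubicField u v)) (𝓞 (BaseChangeField (MasserCubicField u v) e r)) ξK
    with hξdef
  have hξ : ξ ^ 3 = ((3 * v ^ 2 : ℕ) : 𝓞 (BaseChangeField (MasserCubicField u v) e r)) * ξ -
      ((2 * u ^ 3 : ℕ) : 𝓞 (BaseChangeField (MasserCubicField u v) e r)) := by
    rw [hξdef, ← map_pow, hξK]
    simp only [map_sub, map_mul, map_natCast]
  have hfin : Module.finrank ℚ (BaseChangeField (MasserCubicField u v) e r) = 3 * e := by
    rw [finrank_baseChangeField, finrank_masserCubicField]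
  obtain ⟨a, b, c, ha, hb, hc, habc, hH, hS⟩ := exists_masserTriple_cubic hu hv hcop ξ hξ
  rw [hfin] at hH hS
  refine ⟨hfin, ?_, a, b, c, ha, hb, hc, habc, hH, hS⟩
  have hD := natAbs_discr_baseChangeField_le (K := MasserCubicField u v) (e := e) (r := r) he hr
  rwa [finrank_baseChangeField, finrank_masserCubicField] at hD

/-- Cubic core, degenerate case: in `L = ℚ(2^{1/n})` with an (integral) rational root `q` of
`X³ − 3v²X + 2u³`. [folklore] -/
theorem exists_field_three_core_rat (hu : 0 < u) (hv : 0 < v)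
    (hcop : Nat.Coprime (3 * v ^ 2) (2 * u ^ 3)) {n : ℕ} (hn : 1 ≤ n) {q : ℚ}
    (hqeq : q ^ 3 = 3 * (v : ℚ) ^ 2 * q - 2 * (u : ℚ) ^ 3)
    [Fact (Irreducible (rootPolyK ℚ n 2))] :
    Module.finrank ℚ (BaseChangeField ℚ n 2) = n ∧
    (NumberField.discr (BaseChangeField ℚ n 2)).natAbs ≤ n ^ n * 2 ^ (n - 1) ∧
    ∃ a b c : BaseChangeField ℚ n 2, a ≠ 0 ∧ b ≠ 0 ∧ c ≠ 0 ∧ a + b + c = 0 ∧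
      ((3 * v ^ 2 : ℕ) : ℝ) ^ n ≤ mulHeight ![a, b, c] ∧
      masserSupport a b c ≤ (∏ p ∈ (3 * v ^ 2 * (2 * u ^ 3)).primeFactors, p) ^ n := by
  have hqZ : IsIntegral ℤ q := by
    refine ⟨X ^ 3 - C (3 * (v : ℤ) ^ 2) * X + C (2 * (u : ℤ) ^ 3), by monicity!, ?_⟩
    simp only [eval₂_add, eval₂_sub, eval₂_mul, eval₂_X_pow, eval₂_X, eval₂_C]
    simp only [map_mul, map_pow, map_natCast, map_ofNat]
    linear_combination hqeq
  have hqint : IsIntegral ℤ (algebraMap ℚ (BaseChangeField ℚ n 2) q) := hqZ.algebraMap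
  set ξ : 𝓞 (BaseChangeField ℚ n 2) := ⟨algebraMap ℚ _ q, hqint⟩ with hξdef
  have hξ : ξ ^ 3 = ((3 * v ^ 2 : ℕ) : 𝓞 (BaseChangeField ℚ n 2)) * ξ -
      ((2 * u ^ 3 : ℕ) : 𝓞 (BaseChangeField ℚ n 2)) := by
    apply RingOfIntegers.ext
    simp only [hξdef, map_pow, RingOfIntegers.map_mk, map_sub, map_mul, map_natCast]
    rw [← map_pow, hqeq]
    simp
  have hfin : Module.finrank ℚ (BaseChangeField ℚ n 2) = n := by
    rw [finrank_baseChangeField, Module.finrank_self, one_mul]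
  obtain ⟨a, b, c, ha, hb, hc, habc, hH, hS⟩ := exists_masserTriple_cubic hu hv hcop ξ hξ
  rw [hfin] at hH hS
  refine ⟨hfin, ?_, a, b, c, ha, hb, hc, habc, hH, hS⟩
  have hD := natAbs_discr_baseChangeField_le (K := ℚ) (e := n) (r := 2) hn Nat.prime_two
  simp only [finrank_baseChangeField, Module.finrank_self, one_mul, Rat.numberField_discr,
    Int.natAbs_one, one_pow, mul_one] at hD
  exact hD

/-- **Algebraic core, base degree `3`.** Given `0 < u < v` with `gcd(3v², 2u³) = 1`, `M ≠ 0`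
with `M² ∣ v − u`, `e ≥ 1` and a prime `r ≥ 5` with `r ∤ v⁶ − u⁶`, there is a number field `L`
of degree `3e` with `|D_L| ≤ (3e)^{3e} (2r)^{3e} (108 (v⁶−u⁶)/M²)^e` containing nonzero
`a + b + c = 0` with `H_L ≥ (3v²)^{3e}` and `S_L ≤ rad(6u³v²)^{3e}`. (Masser's §3 for `n = 3` —
no Hilbert irreducibility is needed since a reducible cubic has a rational root — then base
change to `L = K(r^{1/e})`.) [cite: Masser2002, §3 (3.6)–(3.9)] -/
theorem exists_field_three_core {M : ℕ} (hu : 0 < u) (huv : u < v)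
    (hcop : Nat.Coprime (3 * v ^ 2) (2 * u ^ 3)) (hM : M ≠ 0) (hMdvd : M ^ 2 ∣ v - u)
    (he : 1 ≤ e) (hr : r.Prime) (hr2 : r ≠ 2) (hr3 : r ≠ 3) (hrdvd : ¬ r ∣ v ^ 6 - u ^ 6) :
    ∃ (L : Type) (_ : Field L) (_ : NumberField L),
      Module.finrank ℚ L = 3 * e ∧
      (NumberField.discr L).natAbs ≤
        (3 * e) ^ (3 * e) * (2 * r) ^ (3 * e) * (108 * ((v ^ 6 - u ^ 6) / M ^ 2)) ^ e ∧
      ∃ a b c : L, a ≠ 0 ∧ b ≠ 0 ∧ c ≠ 0 ∧ a + b + c = 0 ∧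
        ((3 * v ^ 2 : ℕ) : ℝ) ^ (3 * e) ≤ mulHeight ![a, b, c] ∧
        masserSupport a b c ≤ (∏ p ∈ (3 * v ^ 2 * (2 * u ^ 3)).primeFactors, p) ^ (3 * e) := by
  classical
  have hv : 0 < v := lt_trans hu huv
  have huv3 : u ^ 3 < v ^ 3 := Nat.pow_lt_pow_left huv (by norm_num)
  have huv6 : u ^ 6 < v ^ 6 := Nat.pow_lt_pow_left huv (by norm_num)
  have hM2dvd3 : M ^ 2 ∣ v ^ 3 - u ^ 3 := dvd_trans hMdvd (Nat.sub_dvd_pow_sub_pow v u 3)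
  have hM2dvd6 : M ^ 2 ∣ v ^ 6 - u ^ 6 := dvd_trans hMdvd (Nat.sub_dvd_pow_sub_pow v u 6)
  obtain ⟨k3, hk3⟩ := hM2dvd3
  obtain ⟨k, hk⟩ := hM2dvd6
  have hkpos : 0 < k := by
    rcases Nat.eq_zero_or_pos k with h | h
    · rw [h, mul_zero] at hk; omega
    · exact h
  have hkdiv : (v ^ 6 - u ^ 6) / M ^ 2 = k := by
    rw [hk, Nat.mul_div_cancel_left _ (by positivity)]
  have hkQ : ((k : ℤ) : ℚ) = ((v : ℚ) ^ 6 - (u : ℚ) ^ 6) / (M : ℚ) ^ 2 := by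
    have hsub : ((v ^ 6 - u ^ 6 : ℕ) : ℚ) = (v : ℚ) ^ 6 - (u : ℚ) ^ 6 := by
      rw [Nat.cast_sub huv6.le]; push_cast; ring
    rw [eq_div_iff (by positivity), ← hsub, hk]
    push_cast; ring
  have hk3Q : (((2 * k3 : ℕ) : ℤ) : ℚ) = 2 * ((v : ℚ) ^ 3 - (u : ℚ) ^ 3) / (M : ℚ) ^ 2 := by
    have hsub : ((v ^ 3 - u ^ 3 : ℕ) : ℚ) = (v : ℚ) ^ 3 - (u : ℚ) ^ 3 := by
      rw [Nat.cast_sub huv3.le]; push_cast; ring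
    rw [eq_div_iff (by positivity), ← hsub, hk3]
    push_cast; ring
  have hr1 : 1 ≤ 2 * r := by have := hr.one_lt; omega
  rw [hkdiv]
  by_cases hirr : Irreducible (masserCubic u v)
  · haveI : Fact (Irreducible (masserCubic u v)) := ⟨hirr⟩
    obtain ⟨hDKabs, hDK⟩ := abs_discr_masserCubicField_le (u := u) (v := v) hM hk3Q hkQ
    have hrD : ¬ (r : ℤ) ∣ NumberField.discr (MasserCubicField u v) := by
      intro hrdiscr
      have h108k : (r : ℤ) ∣ 108 * k := dvd_trans hrdiscr hDK
      have hrZ : Prime (r : ℤ) := Nat.prime_iff_prime_int.mp hr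
      rcases hrZ.dvd_or_dvd h108k with h108 | hk'
      · have h108' : r ∣ 2 ^ 2 * 3 ^ 3 := by exact_mod_cast h108
        rcases (Nat.Prime.dvd_mul hr).mp h108' with h4 | h27
        · exact hr2 ((Nat.prime_dvd_prime_iff_eq hr Nat.prime_two).mp (hr.dvd_of_dvd_pow h4))
        · exact hr3 ((Nat.prime_dvd_prime_iff_eq hr Nat.prime_three).mp (hr.dvd_of_dvd_pow h27))
      · apply hrdvd
        rw [hk]
        exact Dvd.dvd.mul_left (by exact_mod_cast hk') _
    haveI : Fact (Irreducible (rootPolyK (MasserCubicField u v) e r)) :=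
      ⟨irreducible_rootPolyK he hr hrD⟩
    obtain ⟨hfin, hD, a, b, c, ha, hb, hc, habc, hH, hS⟩ :=
      exists_field_three_core_irred (e := e) (r := r) hu hv hcop he hr
    refine ⟨BaseChangeField (MasserCubicField u v) e r, inferInstance, inferInstance, hfin, ?_,
      a, b, c, ha, hb, hc, habc, hH, hS⟩
    have hDK' : (NumberField.discr (MasserCubicField u v)).natAbs ≤ 108 * k := by
      have : |((NumberField.discr (MasserCubicField u v) : ℤ) : ℚ)| ≤ 108 * (k : ℚ) := by
        simpa using hDKabs
      have h2 : ((NumberField.discr (MasserCubicField u v)).natAbs : ℚ) ≤ ((108 * k : ℕ) : ℚ) := by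
        rw [Nat.cast_natAbs, Int.cast_abs]; push_cast; exact this
      exact_mod_cast h2
    calc (NumberField.discr (BaseChangeField (MasserCubicField u v) e r)).natAbs
        ≤ e ^ (3 * e) * r ^ (3 * (e - 1)) * (NumberField.discr (MasserCubicField u v)).natAbs ^ e :=
          hD
      _ ≤ (3 * e) ^ (3 * e) * (2 * r) ^ (3 * e) * (108 * k) ^ e := by
        apply Nat.mul_le_mul (Nat.mul_le_mul ?_ ?_) ?_
        · exact Nat.pow_le_pow_left (by omega) _
        · exact le_trans (Nat.pow_le_pow_right hr.pos (by omega)) (Nat.pow_le_pow_left (by omega) _)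
        · exact Nat.pow_le_pow_left hDK' _
  · -- degenerate case: a rational root `q`; use `L = ℚ(2^{1/3e})`
    have hroots : (masserCubic u v).roots ≠ 0 := fun h0 =>
      hirr (((masserCubic_monic u v).irreducible_iff_roots_eq_zero_of_degree_le_three
        (by rw [masserCubic_natDegree]; norm_num) (by rw [masserCubic_natDegree])).mpr h0)
    obtain ⟨q, hq⟩ := Multiset.exists_mem_of_ne_zero hroots
    rw [mem_roots (masserCubic_ne_zero u v)] at hq
    have hqeq : q ^ 3 = 3 * (v : ℚ) ^ 2 * q - 2 * (u : ℚ) ^ 3 := by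
      have : (masserCubic u v).eval q = 0 := hq
      rw [masserCubic_eval] at this
      linear_combination this
    have hrD : ¬ ((2 : ℕ) : ℤ) ∣ NumberField.discr ℚ := by
      rw [Rat.numberField_discr]; norm_num
    have hn : 1 ≤ 3 * e := by omega
    haveI : Fact (Irreducible (rootPolyK ℚ (3 * e) 2)) :=
      ⟨irreducible_rootPolyK hn Nat.prime_two hrD⟩
    obtain ⟨hfin, hD, a, b, c, ha, hb, hc, habc, hH, hS⟩ :=
      exists_field_three_core_rat hu hv hcop hn hqeq
    refine ⟨BaseChangeField ℚ (3 * e) 2, inferInstance, inferInstance, hfin, ?_,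
      a, b, c, ha, hb, hc, habc, hH, hS⟩
    calc (NumberField.discr (BaseChangeField ℚ (3 * e) 2)).natAbs
        ≤ (3 * e) ^ (3 * e) * 2 ^ (3 * e - 1) := hD
      _ ≤ (3 * e) ^ (3 * e) * (2 * r) ^ (3 * e) * (108 * k) ^ e := by
        have h1 : 2 ^ (3 * e - 1) ≤ (2 * r) ^ (3 * e) :=
          le_trans (Nat.pow_le_pow_right (by norm_num) (by omega))
            (Nat.pow_le_pow_left (by have := hr.two_le; omega) _)
        have h2 : 1 ≤ (108 * k) ^ e := Nat.one_le_pow _ _ (by omega)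
        calc (3 * e) ^ (3 * e) * 2 ^ (3 * e - 1) ≤ (3 * e) ^ (3 * e) * (2 * r) ^ (3 * e) :=
              Nat.mul_le_mul_left _ h1
          _ = (3 * e) ^ (3 * e) * (2 * r) ^ (3 * e) * 1 := (mul_one _).symm
          _ ≤ (3 * e) ^ (3 * e) * (2 * r) ^ (3 * e) * (108 * k) ^ e := Nat.mul_le_mul_left _ h2

end CubicCore

/-! ### Bookkeeping and assembly in base degree `3` -/

section CubicAssembly

open Finset Chebyshev

/-- The primes `p` with `3 < p ≤ Y` (Masser's primes `q < p ≤ y` with `q = 3`).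
[cite: Masser2002, §3] -/
def primesGT3LE (Y : ℕ) : Finset ℕ := (Finset.range (Y + 1)).filter (fun p => p.Prime ∧ 3 < p)

/-- Members of `primesGT3LE Y` are primes `p` with `3 < p ≤ Y`. [folklore] -/
theorem mem_primesGT3LE {Y p : ℕ} : p ∈ primesGT3LE Y ↔ p ≤ Y ∧ p.Prime ∧ 3 < p := by
  simp [primesGT3LE]

/-- `5 ∈ primesGT3LE Y` for `Y ≥ 5`. [folklore] -/
theorem five_mem_primesGT3LE {Y : ℕ} (hY : 5 ≤ Y) : 5 ∈ primesGT3LE Y :=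
  mem_primesGT3LE.mpr ⟨hY, Nat.prime_five, by norm_num⟩

/-- `#(primesGT3LE Y) ≤ Y`. [folklore] -/
theorem card_primesGT3LE_le (Y : ℕ) : (primesGT3LE Y).card ≤ Y := by
  have hsub : primesGT3LE Y ⊆ Finset.Icc 2 Y := by
    intro p hp
    rw [mem_primesGT3LE] at hp
    simp only [Finset.mem_Icc]
    exact ⟨hp.2.1.two_le, hp.1⟩
  refine le_trans (Finset.card_le_card hsub) ?_
  simp

/-- `primesGT3LE Y ⊆ oddPrimesLE Y`. [folklore] -/
theorem primesGT3LE_subset_oddPrimesLE (Y : ℕ) : primesGT3LE Y ⊆ oddPrimesLE Y := by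
  intro p hp
  rw [mem_primesGT3LE] at hp
  exact mem_oddPrimesLE.mpr ⟨hp.1, hp.2.1, by omega⟩

/-- The radical of `3v² · 2u³` is at most `primorial Y` when all prime factors of `uv` are primes
`3 < p ≤ Y` and `Y ≥ 3`. [folklore] -/
theorem rad_le_primorial3 {u v Y : ℕ} (hY : 3 ≤ Y)
    (huv : ∀ q : ℕ, q.Prime → q ∣ u * v → q ∈ primesGT3LE Y) :
    ∏ p ∈ (3 * v ^ 2 * (2 * u ^ 3)).primeFactors, p ≤ primorial Y := by
  unfold primorial
  apply Finset.prod_le_prod_of_subset_of_one_le'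
  · intro p hp
    have hpprime := Nat.prime_of_mem_primeFactors hp
    have hpdvd := Nat.dvd_of_mem_primeFactors hp
    simp only [Finset.mem_filter, Finset.mem_range]
    refine ⟨?_, hpprime⟩
    have key : p ∣ 3 ∨ p ∣ v ∨ p ∣ 2 ∨ p ∣ u := by
      rcases (Nat.Prime.dvd_mul hpprime).mp hpdvd with h3v | h2u
      · rcases (Nat.Prime.dvd_mul hpprime).mp h3v with h3 | hv2
        · exact Or.inl h3
        · exact Or.inr (Or.inl (hpprime.dvd_of_dvd_pow hv2))
      · rcases (Nat.Prime.dvd_mul hpprime).mp h2u with h2 | hu3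
        · exact Or.inr (Or.inr (Or.inl h2))
        · exact Or.inr (Or.inr (Or.inr (hpprime.dvd_of_dvd_pow hu3)))
    rcases key with h3 | hv' | h2 | hu'
    · have := (Nat.prime_dvd_prime_iff_eq hpprime Nat.prime_three).mp h3; omega
    · have := (mem_primesGT3LE.mp (huv p hpprime (Dvd.dvd.mul_left hv' u))).1; omega
    · have := (Nat.prime_dvd_prime_iff_eq hpprime Nat.prime_two).mp h2; omega
    · have := (mem_primesGT3LE.mp (huv p hpprime (Dvd.dvd.mul_right hu' v))).1; omega
  · intro p hp _
    exact (Finset.mem_filter.mp hp).2.one_lt.le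

/-- `gcd(3v², 2u³) = 1` when `u, v` are coprime, `3 ∤ u` and `2 ∤ v`. [folklore] -/
theorem coprime_three_mul_sq {u v : ℕ} (hcop : Nat.Coprime u v) (h3 : ¬ 3 ∣ u) (h2 : ¬ 2 ∣ v) :
    Nat.Coprime (3 * v ^ 2) (2 * u ^ 3) := by
  apply Nat.Coprime.mul_left
  · apply Nat.Coprime.mul_right
    · norm_num
    · exact Nat.Coprime.pow_right _ ((Nat.Prime.coprime_iff_not_dvd Nat.prime_three).mpr h3)
  · apply Nat.Coprime.pow_left
    apply Nat.Coprime.mul_right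
    · exact ((Nat.Prime.coprime_iff_not_dvd Nat.prime_two).mpr h2).symm
    · exact Nat.Coprime.pow_right _ hcop.symm

/-- From `m^d ∣ v − u` we get `(m^{d/2})² ∣ v − u`. [folklore] -/
theorem sq_pow_half_dvd' {m d u v : ℕ} (h : m ^ d ∣ v - u) : (m ^ (d / 2)) ^ 2 ∣ v - u := by
  have h1 : (m ^ (d / 2)) ^ 2 ∣ m ^ d := by
    rw [← pow_mul]
    exact Nat.pow_dvd_pow m (by omega)
  exact dvd_trans h1 h

/-- The final linear bookkeeping of logarithms in base degree `3` (pure real arithmetic).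
[folklore] -/
theorem final_log_ineq3 {logC logD frac llogS logH logv logM logr logT A e4 e2 k1 F G eR nR l2Y : ℝ}
    (he : 0 ≤ eR) (hn : nR = 3 * eR)
    (hlogH : nR * Real.log 3 + 6 * eR * logv ≤ logH)
    (hlogD : logD ≤ A + nR * logr + e4 + 6 * eR * logv - 2 * eR * logM)
    (hrT : logr ≤ logT) (hfrac : frac ≤ F) (hlS : llogS ≤ G)
    (hM : eR * (k1 - e2 - 2 * l2Y) ≤ 2 * eR * logM)
    (hneed : logC + F + A + nR * logT + e4 + eR * e2 + 2 * eR * l2Y + G < eR * k1) :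
    logC + logD + frac + llogS < logH := by
  have h1 : nR * logr ≤ nR * logT := mul_le_mul_of_nonneg_left hrT (by linarith)
  have h2 : 0 ≤ nR * Real.log 3 := mul_nonneg (by linarith) (Real.log_nonneg (by norm_num))
  subst hn
  linear_combination hlogD + h1 + hfrac + hlS + hM + hneed + hlogH + h2

/-- `log (n^n (2r)^n (108 v⁶/M²)^e) = n log n + n log(2r) + e log 108 + 6e log v − 2e log M`.
[folklore] -/
theorem log_discr_bound_eq3 {n e r : ℕ} {v M : ℝ} (hn : 1 ≤ n) (hr : 1 ≤ r) (hv : 0 < v)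
    (hM : 0 < M) :
    Real.log ((n : ℝ) ^ n * (2 * (r : ℝ)) ^ n * (108 * (v ^ 6 / M ^ 2)) ^ e) =
      n * Real.log n + n * Real.log (2 * (r : ℝ)) + e * Real.log 108 + 6 * e * Real.log v -
        2 * e * Real.log M := by
  have hnR : (0 : ℝ) < n := by exact_mod_cast hn
  have hrR : (0 : ℝ) < r := by exact_mod_cast hr
  have h4 : Real.log (108 * (v ^ 6 / M ^ 2)) = Real.log 108 + 6 * Real.log v - 2 * Real.log M := by
    rw [Real.log_mul (by norm_num) (by positivity), Real.log_div (by positivity) (by positivity),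
      Real.log_pow, Real.log_pow]
    push_cast; ring
  rw [Real.log_mul (by positivity) (by positivity), Real.log_mul (by positivity) (by positivity),
    Real.log_pow, Real.log_pow, Real.log_pow, h4]
  ring

/-- The final step in base degree `3`: from the core field and the numerical hypothesis to the
strict inequality `C · D · φ_ν(D) · S^λ < H`. [cite: Masser2002, §3 (3.10)] -/
theorem three_final_step {e : ℕ} (he : 1 ≤ e) (l ν C : ℝ) (hl : 1 ≤ l) {Y E T : ℕ}
    (hY : 5 ≤ Y)
    (hneed : Real.log C +
        ((Real.log 3) ^ ν +
          ((3 * e : ℕ) * Real.log (3 * e : ℕ) + (3 * e : ℕ) * Real.log (2 * (T : ℝ)) +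
            e * Real.log 108 + 6 * e * ((Y : ℝ) * E * Real.log Y)) ^ ν) / Real.log (Real.log 3) +
        (3 * e : ℕ) * Real.log (3 * e : ℕ) + (3 * e : ℕ) * Real.log (2 * (T : ℝ)) +
        e * Real.log 108 + e * Real.log 2 + 2 * e * Real.log (2 * (Y : ℝ)) +
        l * (3 * e : ℕ) * θ (Y : ℝ) <
        e * ((primesGT3LE Y).card * Real.log ((E : ℝ) + 1)))
    {m : ℕ} (hmprime : m.Prime) (hm2Y : m ≤ 2 * Y) (hB : 2 ≤ (E + 1) ^ (primesGT3LE Y).card)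
    {u v r : ℕ} (hv : 0 < v) (hsmooth : ∀ q : ℕ, q.Prime → q ∣ u * v → q ∈ primesGT3LE Y)
    (hrT : r ≤ T) (hr : r.Prime)
    {L : Type*} [Field L] [NumberField L] (hfin : Module.finrank ℚ L = 3 * e)
    (hD : (NumberField.discr L).natAbs ≤
      (3 * e) ^ (3 * e) * (2 * r) ^ (3 * e) *
        (108 * ((v ^ 6 - u ^ 6) / (m ^ (Nat.log m ((E + 1) ^ (primesGT3LE Y).card - 1) / 2)) ^ 2)) ^ e)
    {a b c : L} (hH : ((3 * v ^ 2 : ℕ) : ℝ) ^ (3 * e) ≤ mulHeight ![a, b, c])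
    (hS : masserSupport a b c ≤ (∏ p ∈ (3 * v ^ 2 * (2 * u ^ 3)).primeFactors, p) ^ (3 * e))
    (hlogv : Real.log v ≤ (Y : ℝ) * E * Real.log Y)
    (hMpos : 0 < m ^ (Nat.log m ((E + 1) ^ (primesGT3LE Y).card - 1) / 2)) :
    C * |(NumberField.discr L : ℝ)| * masserPhi ν |(NumberField.discr L : ℝ)| *
        (masserSupport a b c : ℝ) ^ l < mulHeight ![a, b, c] := by
  -- notation for the real quantities
  set M : ℕ := m ^ (Nat.log m ((E + 1) ^ (primesGT3LE Y).card - 1) / 2) with hMdef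
  set H : ℝ := mulHeight ![a, b, c] with hHdef
  set D : ℝ := |((NumberField.discr L : ℤ) : ℝ)| with hDdef
  set S : ℝ := (masserSupport a b c : ℝ) with hSdef
  have hvR : (0 : ℝ) < v := by exact_mod_cast hv
  have hHpos : 0 < H := lt_of_lt_of_le (by positivity) hH
  have hS1 : (1 : ℝ) ≤ S := by rw [hSdef]; exact_mod_cast one_le_masserSupport a b c
  have hSpos : 0 < S := by linarith
  have hDnat : D = ((NumberField.discr L).natAbs : ℝ) := by
    rw [hDdef, Nat.cast_natAbs, Int.cast_abs]
  have hD3 : (3 : ℝ) ≤ D := by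
    have h2 : (2 : ℤ) < |NumberField.discr L| := NumberField.abs_discr_gt_two (by omega)
    have : ((3 : ℤ) : ℝ) ≤ ((|NumberField.discr L| : ℤ) : ℝ) := by exact_mod_cast h2
    simpa [hDdef, Int.cast_abs] using this
  have hDpos' : 0 < D := by linarith
  have hφpos : 0 < masserPhi ν D := masserPhi_pos ν D
  -- Case `C ≤ 0`
  rcases le_or_gt C 0 with hC | hC
  · have : C * D * masserPhi ν D * S ^ l ≤ 0 := by
      have h1 : C * D ≤ 0 := mul_nonpos_of_nonpos_of_nonneg hC hDpos'.le
      have h2 : C * D * masserPhi ν D ≤ 0 := mul_nonpos_of_nonpos_of_nonneg h1 hφpos.le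
      exact mul_nonpos_of_nonpos_of_nonneg h2 (Real.rpow_nonneg hSpos.le l)
    exact lt_of_le_of_lt this hHpos
  -- Case `C > 0`: compare logarithms.
  have hLHSpos : 0 < C * D * masserPhi ν D * S ^ l := by positivity
  rw [← Real.log_lt_log_iff hLHSpos hHpos]
  have hlogLHS : Real.log (C * D * masserPhi ν D * S ^ l) =
      Real.log C + Real.log D + Real.log D ^ ν / Real.log (Real.log D) + l * Real.log S := by
    rw [Real.log_mul (by positivity) (by positivity), Real.log_mul (by positivity) hφpos.ne',
      Real.log_mul hC.ne' hDpos'.ne', Real.log_rpow hSpos]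
    unfold masserPhi
    rw [Real.log_exp]
  rw [hlogLHS]
  -- lower bound for `log H`
  have hlogH : ((3 * e : ℕ) : ℝ) * Real.log 3 + 6 * (e : ℝ) * Real.log v ≤ Real.log H := by
    have h1 : Real.log (((3 * v ^ 2 : ℕ) : ℝ) ^ (3 * e)) ≤ Real.log H :=
      Real.log_le_log (by positivity) hH
    rw [Real.log_pow] at h1
    push_cast at h1 ⊢
    rw [Real.log_mul (by norm_num) (by positivity), Real.log_pow] at h1
    push_cast at h1
    linarith
  -- upper bound for `D`
  have hMR : (0 : ℝ) < M := by exact_mod_cast hMpos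
  have hkk : (((v ^ 6 - u ^ 6) / M ^ 2 : ℕ) : ℝ) ≤ (v : ℝ) ^ 6 / (M : ℝ) ^ 2 := by
    rw [le_div_iff₀ (by positivity)]
    have h1 : (v ^ 6 - u ^ 6) / M ^ 2 * M ^ 2 ≤ v ^ 6 :=
      le_trans (Nat.div_mul_le_self _ _) (Nat.sub_le _ _)
    exact_mod_cast h1
  have hDle : D ≤ ((3 * e : ℕ) : ℝ) ^ (3 * e) * (2 * (r : ℝ)) ^ (3 * e) *
      (108 * ((v : ℝ) ^ 6 / (M : ℝ) ^ 2)) ^ e := by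
    rw [hDnat]
    have h1 : ((NumberField.discr L).natAbs : ℝ) ≤
        (((3 * e) ^ (3 * e) * (2 * r) ^ (3 * e) * (108 * ((v ^ 6 - u ^ 6) / M ^ 2)) ^ e : ℕ) : ℝ) := by
      exact_mod_cast hD
    refine le_trans h1 ?_
    push_cast
    gcongr
  have hlogD : Real.log D ≤ ((3 * e : ℕ) : ℝ) * Real.log (3 * e : ℕ) +
      (3 * e : ℕ) * Real.log (2 * (r : ℝ)) + e * Real.log 108 + 6 * e * Real.log v -
        2 * e * Real.log M := by
    have h1 := Real.log_le_log hDpos' hDle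
    rwa [log_discr_bound_eq3 (by omega) hr.one_lt.le hvR hMR] at h1
  have hlogr : Real.log (2 * (r : ℝ)) ≤ Real.log (2 * (T : ℝ)) := by
    apply Real.log_le_log (by have := hr.pos; positivity)
    exact_mod_cast Nat.mul_le_mul_left 2 hrT
  -- `(log D)^ν / log log D ≤ ((log 3)^ν + Λ^ν) / log log 3`
  have hlogD0 : 0 ≤ Real.log D := Real.log_nonneg (by linarith)
  have hlogM0 : 0 ≤ Real.log M := Real.log_nonneg (by exact_mod_cast hMpos)
  have hlogDΛ : Real.log D ≤ ((3 * e : ℕ) : ℝ) * Real.log (3 * e : ℕ) +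
      (3 * e : ℕ) * Real.log (2 * (T : ℝ)) + e * Real.log 108 + 6 * e * ((Y : ℝ) * E * Real.log Y) := by
    have h1 : ((3 * e : ℕ) : ℝ) * Real.log (2 * (r : ℝ)) ≤ (3 * e : ℕ) * Real.log (2 * (T : ℝ)) :=
      mul_le_mul_of_nonneg_left hlogr (by positivity)
    have h2 : 6 * (e : ℝ) * Real.log v ≤ 6 * e * ((Y : ℝ) * E * Real.log Y) :=
      mul_le_mul_of_nonneg_left hlogv (by positivity)
    have h3 : 0 ≤ 2 * (e : ℝ) * Real.log M := by positivity
    linarith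
  have hlog3 : 0 < Real.log 3 := Real.log_pos (by norm_num)
  have hΛ0 : 0 ≤ ((3 * e : ℕ) : ℝ) * Real.log (3 * e : ℕ) +
      (3 * e : ℕ) * Real.log (2 * (T : ℝ)) + e * Real.log 108 + 6 * e * ((Y : ℝ) * E * Real.log Y) :=
    le_trans hlogD0 hlogDΛ
  have hpowν : Real.log D ^ ν ≤ Real.log 3 ^ ν + (((3 * e : ℕ) : ℝ) * Real.log (3 * e : ℕ) +
      (3 * e : ℕ) * Real.log (2 * (T : ℝ)) + e * Real.log 108 + 6 * e * ((Y : ℝ) * E * Real.log Y)) ^ ν := by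
    rcases le_or_gt 0 ν with hν | hν
    · have := Real.rpow_le_rpow hlogD0 hlogDΛ hν
      have h0 : 0 ≤ Real.log 3 ^ ν := Real.rpow_nonneg hlog3.le ν
      linarith
    · have hle : Real.log 3 ≤ Real.log D := Real.log_le_log (by norm_num) hD3
      have := Real.rpow_le_rpow_of_nonpos hlog3 hle hν.le
      have h0 := Real.rpow_nonneg hΛ0 ν
      linarith
  have hll : Real.log (Real.log 3) ≤ Real.log (Real.log D) :=
    Real.log_le_log hlog3 (Real.log_le_log (by norm_num) hD3)
  have hfrac : Real.log D ^ ν / Real.log (Real.log D) ≤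
      (Real.log 3 ^ ν + (((3 * e : ℕ) : ℝ) * Real.log (3 * e : ℕ) +
      (3 * e : ℕ) * Real.log (2 * (T : ℝ)) + e * Real.log 108 + 6 * e * ((Y : ℝ) * E * Real.log Y)) ^ ν) /
        Real.log (Real.log 3) := by
    apply div_le_div₀ _ hpowν log_log_three_pos hll
    exact add_nonneg (Real.rpow_nonneg hlog3.le ν) (Real.rpow_nonneg hΛ0 ν)
  -- `l log S ≤ l n θ(Y)`
  have hlogS : Real.log S ≤ ((3 * e : ℕ) : ℝ) * θ (Y : ℝ) := by
    have h1 : masserSupport a b c ≤ (primorial Y) ^ (3 * e) :=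
      le_trans hS (Nat.pow_le_pow_left (rad_le_primorial3 (by omega) hsmooth) _)
    have h2 : S ≤ ((primorial Y : ℕ) : ℝ) ^ (3 * e) := by rw [hSdef]; exact_mod_cast h1
    calc Real.log S ≤ Real.log (((primorial Y : ℕ) : ℝ) ^ (3 * e)) := Real.log_le_log hSpos h2
      _ = ((3 * e : ℕ) : ℝ) * Real.log ((primorial Y : ℕ) : ℝ) := by rw [Real.log_pow]
      _ = ((3 * e : ℕ) : ℝ) * θ (Y : ℝ) := by rw [theta_eq_log_primorial, Nat.floor_natCast]
  have hlθ : l * Real.log S ≤ l * ((3 * e : ℕ) : ℝ) * θ (Y : ℝ) := by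
    have := mul_le_mul_of_nonneg_left hlogS (show (0 : ℝ) ≤ l by linarith)
    linarith
  -- `2 e log M ≥ e (k log (E+1) − log 2 − 2 log 2Y)`
  have hMlog := log_modulus_ge (E := E) (k := (primesGT3LE Y).card) hm2Y hmprime.two_le hB
  have hMlog' : (e : ℝ) * (((primesGT3LE Y).card : ℝ) * Real.log ((E : ℝ) + 1) - Real.log 2 -
      2 * Real.log (2 * (Y : ℝ))) ≤ 2 * e * Real.log M := by
    have := mul_le_mul_of_nonneg_left hMlog (show (0 : ℝ) ≤ e by positivity)
    rw [hMdef]; push_cast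
    linarith
  have hn : ((3 * e : ℕ) : ℝ) = 3 * (e : ℝ) := by push_cast; ring
  exact final_log_ineq3 (by positivity) hn hlogH hlogD hlogr hfrac hlθ hMlog' hneed

/-- **Masser's theorem in base degree `3`, deterministic part.** [cite: Masser2002, §3 (3.4)–(3.10)] -/
theorem three_assembly {e : ℕ} (he : 1 ≤ e) (l ν C : ℝ) (hl : 1 ≤ l) {Y E T : ℕ}
    (hY : 5 ≤ Y) (hE : 1 ≤ E)
    (hT : Real.log 6 + 6 * (Y : ℝ) * E * Real.log Y < θ (T : ℝ))
    (hneed : Real.log C +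
        ((Real.log 3) ^ ν +
          ((3 * e : ℕ) * Real.log (3 * e : ℕ) + (3 * e : ℕ) * Real.log (2 * (T : ℝ)) +
            e * Real.log 108 + 6 * e * ((Y : ℝ) * E * Real.log Y)) ^ ν) / Real.log (Real.log 3) +
        (3 * e : ℕ) * Real.log (3 * e : ℕ) + (3 * e : ℕ) * Real.log (2 * (T : ℝ)) +
        e * Real.log 108 + e * Real.log 2 + 2 * e * Real.log (2 * (Y : ℝ)) +
        l * (3 * e : ℕ) * θ (Y : ℝ) <
        e * ((primesGT3LE Y).card * Real.log ((E : ℝ) + 1))) :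
    ∃ (K : Type) (_ : Field K) (_ : NumberField K),
      Module.finrank ℚ K = 3 * e ∧
        ∃ a b c : K, a ≠ 0 ∧ b ≠ 0 ∧ c ≠ 0 ∧ a + b + c = 0 ∧
          C * |(NumberField.discr K : ℝ)| * masserPhi ν |(NumberField.discr K : ℝ)| *
              (masserSupport a b c : ℝ) ^ l <
            mulHeight ![a, b, c] := by
  classical
  have hPprime : ∀ p ∈ primesGT3LE Y, p.Prime := fun p hp => (mem_primesGT3LE.mp hp).2.1
  have hPY : ∀ p ∈ primesGT3LE Y, p ≤ Y := fun p hp => (mem_primesGT3LE.mp hp).1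
  have hk1 : 1 ≤ (primesGT3LE Y).card := Finset.card_pos.mpr ⟨5, five_mem_primesGT3LE hY⟩
  have hkY : (primesGT3LE Y).card ≤ Y := card_primesGT3LE_le Y
  have hB : 2 ≤ (E + 1) ^ (primesGT3LE Y).card :=
    calc 2 ≤ E + 1 := by omega
      _ = (E + 1) ^ 1 := (pow_one _).symm
      _ ≤ (E + 1) ^ (primesGT3LE Y).card := Nat.pow_le_pow_right (by omega) hk1
  obtain ⟨m, hmprime, hYm, hm2Y⟩ := Nat.exists_prime_lt_and_le_two_mul Y (by omega)
  have hQpos : 0 < m ^ Nat.log m ((E + 1) ^ (primesGT3LE Y).card - 1) := pow_pos hmprime.pos _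
  have hQlt : m ^ Nat.log m ((E + 1) ^ (primesGT3LE Y).card - 1) < (E + 1) ^ (primesGT3LE Y).card := by
    have := Nat.pow_log_le_self m (show (E + 1) ^ (primesGT3LE Y).card - 1 ≠ 0 by omega)
    omega
  have hQP : ∀ p ∈ primesGT3LE Y, ¬ p ∣ m ^ Nat.log m ((E + 1) ^ (primesGT3LE Y).card - 1) := by
    intro p hp hdvd
    have hpm : p ∣ m := (hPprime p hp).dvd_of_dvd_pow hdvd
    have := (Nat.prime_dvd_prime_iff_eq (hPprime p hp) hmprime).mp hpm
    have := hPY p hp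
    omega
  obtain ⟨u, v, hu, huv, hvle, hcop, hsmooth, hQdvd⟩ :=
    exists_coprime_smooth_pair hPprime hPY hQpos hQP hQlt
  have hv : 0 < v := lt_trans hu huv
  have hMpos : 0 < m ^ (Nat.log m ((E + 1) ^ (primesGT3LE Y).card - 1) / 2) := pow_pos hmprime.pos _
  have hMdvd := sq_pow_half_dvd' hQdvd
  -- `gcd(3v², 2u³) = 1`
  have h3u : ¬ 3 ∣ u := by
    intro h3
    have := (mem_primesGT3LE.mp (hsmooth 3 Nat.prime_three (Dvd.dvd.mul_right h3 v))).2.2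
    omega
  have h2v : ¬ 2 ∣ v := by
    intro h2
    have := (mem_primesGT3LE.mp (hsmooth 2 Nat.prime_two (Dvd.dvd.mul_left h2 u))).2.2
    omega
  have hcop2 : Nat.Coprime (3 * v ^ 2) (2 * u ^ 3) := coprime_three_mul_sq hcop h3u h2v
  -- the auxiliary prime `r`
  have huv6 : u ^ 6 < v ^ 6 := Nat.pow_lt_pow_left huv (by norm_num)
  have hDpos : 0 < 3 * (v ^ 6 - u ^ 6) := by omega
  have hYR : (1 : ℝ) < Y := by exact_mod_cast (show 1 < Y by omega)
  have hlogY : 0 < Real.log Y := Real.log_pos hYR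
  have hlogv : Real.log v ≤ (Y : ℝ) * E * Real.log Y := by
    have h1 : (v : ℝ) ≤ (Y : ℝ) ^ ((primesGT3LE Y).card * E) := by exact_mod_cast hvle
    calc Real.log v ≤ Real.log ((Y : ℝ) ^ ((primesGT3LE Y).card * E)) :=
          Real.log_le_log (by exact_mod_cast hv) h1
      _ = ((primesGT3LE Y).card * E : ℕ) * Real.log Y := by rw [Real.log_pow]
      _ ≤ (Y : ℝ) * E * Real.log Y := by
          apply mul_le_mul_of_nonneg_right _ hlogY.le
          have : (((primesGT3LE Y).card * E : ℕ) : ℝ) ≤ ((Y * E : ℕ) : ℝ) := by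
            exact_mod_cast Nat.mul_le_mul_right E hkY
          push_cast at this ⊢; exact this
  have hθT : Real.log (2 * ((3 * (v ^ 6 - u ^ 6) : ℕ) : ℝ)) < θ (T : ℝ) := by
    refine lt_of_le_of_lt ?_ hT
    have h1 : ((3 * (v ^ 6 - u ^ 6) : ℕ) : ℝ) ≤ 3 * (v : ℝ) ^ 6 := by
      have : 3 * (v ^ 6 - u ^ 6) ≤ 3 * v ^ 6 := Nat.mul_le_mul_left 3 (Nat.sub_le _ _)
      exact_mod_cast this
    calc Real.log (2 * ((3 * (v ^ 6 - u ^ 6) : ℕ) : ℝ)) ≤ Real.log (6 * (v : ℝ) ^ 6) := by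
          apply Real.log_le_log (by positivity)
          linarith
      _ = Real.log 6 + 6 * Real.log v := by
          rw [Real.log_mul (by norm_num) (by positivity), Real.log_pow]; push_cast; ring
      _ ≤ Real.log 6 + 6 * ((Y : ℝ) * E * Real.log Y) := by linarith
      _ = Real.log 6 + 6 * (Y : ℝ) * E * Real.log Y := by ring
  obtain ⟨r, hr, hr2, hrT, hrdvd⟩ := exists_odd_prime_not_dvd hDpos hθT
  have hr3 : r ≠ 3 := by
    rintro rfl
    exact hrdvd (Dvd.intro _ rfl)
  have hrdvd' : ¬ r ∣ v ^ 6 - u ^ 6 := fun h => hrdvd (Dvd.dvd.mul_left h 3)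
  -- the field
  obtain ⟨L, iF, iN, hfin, hD, a, b, c, ha, hb, hc, habc, hH, hS⟩ :=
    exists_field_three_core (e := e) (r := r) hu huv hcop2 hMpos.ne' hMdvd he hr hr2 hr3 hrdvd'
  refine ⟨L, iF, iN, hfin, a, b, c, ha, hb, hc, habc, ?_⟩
  exact three_final_step he l ν C hl hY hneed hmprime hm2Y hB hv hsmooth hrT hr hfin hD hH hS
    hlogv hMpos

end CubicAssembly

/-! ### Choice of the parameters and Masser's theorem in degrees divisible by `3` -/

section CubicMain

open Filter Asymptotics Topology Chebyshev Finset

/-- `primorial Y ≤ 6 · ∏_{3 < p ≤ Y} p`. [folklore] -/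
theorem primorial_le_six_mul_prod_primesGT3LE (Y : ℕ) :
    primorial Y ≤ 6 * ∏ p ∈ primesGT3LE Y, p := by
  classical
  unfold primorial
  have hsplit : (Finset.range (Y + 1)).filter Nat.Prime =
      ((Finset.range (Y + 1)).filter (fun p => p.Prime ∧ p ≤ 3)) ∪ primesGT3LE Y := by
    ext p
    simp only [primesGT3LE, Finset.mem_filter, Finset.mem_union, Finset.mem_range]
    constructor
    · rintro ⟨h1, h2⟩
      rcases le_or_gt p 3 with h | h
      · exact Or.inl ⟨h1, h2, h⟩
      · exact Or.inr ⟨h1, h2, h⟩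
    · rintro (⟨h1, h2, _⟩ | ⟨h1, h2, _⟩) <;> exact ⟨h1, h2⟩
  have hdisj : Disjoint ((Finset.range (Y + 1)).filter (fun p => p.Prime ∧ p ≤ 3))
      (primesGT3LE Y) := by
    rw [Finset.disjoint_left]
    intro p hp hp'
    simp only [primesGT3LE, Finset.mem_filter] at hp hp'
    omega
  rw [hsplit, Finset.prod_union hdisj]
  apply Nat.mul_le_mul_right
  have hsub : (Finset.range (Y + 1)).filter (fun p => p.Prime ∧ p ≤ 3) ⊆ {2, 3} := by
    intro p hp
    simp only [Finset.mem_filter] at hp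
    have h2 := hp.2.1.two_le
    have : p = 2 ∨ p = 3 := by omega
    simp [this]
  calc ∏ p ∈ (Finset.range (Y + 1)).filter (fun p => p.Prime ∧ p ≤ 3), p
      ≤ ∏ p ∈ ({2, 3} : Finset ℕ), p := by
        apply Finset.prod_le_prod_of_subset_of_one_le' hsub
        intro p hp _
        simp only [Finset.mem_insert, Finset.mem_singleton] at hp
        omega
    _ = 6 := by simp

/-- `θ(Y) ≤ log 6 + k log Y` with `k = #{primes 3 < p ≤ Y}`. [folklore] -/
theorem theta_le_log_six_add {Y : ℕ} (hY : 1 ≤ Y) :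
    θ (Y : ℝ) ≤ Real.log 6 + (primesGT3LE Y).card * Real.log Y := by
  rw [theta_eq_log_primorial, Nat.floor_natCast]
  have h1 : (primorial Y : ℝ) ≤ ((6 * ∏ p ∈ primesGT3LE Y, p : ℕ) : ℝ) := by
    exact_mod_cast primorial_le_six_mul_prod_primesGT3LE Y
  have h2 : ∏ p ∈ primesGT3LE Y, p ≤ Y ^ (primesGT3LE Y).card := by
    calc ∏ p ∈ primesGT3LE Y, p ≤ ∏ _p ∈ primesGT3LE Y, Y :=
          Finset.prod_le_prod' fun p hp => (mem_primesGT3LE.mp hp).1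
      _ = Y ^ (primesGT3LE Y).card := Finset.prod_const Y
  have h3 : (primorial Y : ℝ) ≤ 6 * (Y : ℝ) ^ (primesGT3LE Y).card := by
    refine le_trans h1 ?_
    have : ((6 * ∏ p ∈ primesGT3LE Y, p : ℕ) : ℝ) ≤ ((6 * Y ^ (primesGT3LE Y).card : ℕ) : ℝ) := by
      exact_mod_cast Nat.mul_le_mul_left 6 h2
    push_cast at this ⊢
    exact this
  have hY' : (0 : ℝ) < Y := by exact_mod_cast hY
  calc Real.log (primorial Y : ℝ) ≤ Real.log (6 * (Y : ℝ) ^ (primesGT3LE Y).card) :=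
        Real.log_le_log (by exact_mod_cast primorial_pos Y) h3
    _ = Real.log 6 + (primesGT3LE Y).card * Real.log Y := by
        rw [Real.log_mul (by norm_num) (by positivity), Real.log_pow]

/-- Choice of the slack `σ > 0` with `ν (3λ + 2σ + 1) < 1` (possible as `ν < 1/(3λ+1)`).
[folklore] -/
theorem exists_slack3 {l ν : ℝ} (hl : 1 ≤ l) (hν : ν < 1 / (3 * l + 1)) :
    ∃ σ : ℝ, 0 < σ ∧ ν * (3 * l + 2 * σ + 1) < 1 := by
  rcases le_or_gt ν 0 with h | h
  · refine ⟨1, one_pos, ?_⟩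
    have : ν * (3 * l + 2 * 1 + 1) ≤ 0 := mul_nonpos_of_nonpos_of_nonneg h (by linarith)
    linarith
  · have hpos : (0 : ℝ) < 3 * l + 1 := by linarith
    have h1 : ν * (3 * l + 1) < 1 := by
      rw [lt_div_iff₀ hpos] at hν; linarith
    refine ⟨(1 - ν * (3 * l + 1)) / (4 * ν), by positivity, ?_⟩
    have : ν * (3 * l + 2 * ((1 - ν * (3 * l + 1)) / (4 * ν)) + 1) =
        ν * (3 * l + 1) + (1 - ν * (3 * l + 1)) / 2 := by
      field_simp
      ring
    rw [this]
    linarith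

/-- The final linear bookkeeping for the choice of parameters in base degree `3`. [folklore] -/
theorem three_need_arith {logC L3ν c₀ Pν Λν J B logY log2T θY kE Y e a l σ nR : ℝ}
    (hnR : nR = 3 * e) (ha : a = 3 * l + 2 * σ)
    (hJ : J = logC + (L3ν + 1) / c₀ + nR * Real.log nR + nR * Real.log 38 +
      e * Real.log 108 + e * Real.log 2 + 2 * e * Real.log 2 + e * a * Real.log 6)
    (hB : B = nR * (a + 2) + 2 * e)
    (hlog2Y : Real.log (2 * Y) = Real.log 2 + logY)
    (hfracle : (L3ν + Λν) / c₀ ≤ (L3ν + 1) / c₀ + Pν / c₀)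
    (hFY : J + B * logY + Pν / c₀ ≤ e * σ / 2 * Y)
    (hRHS : e * a * (θY - Real.log 6) ≤ kE)
    (hmain : e * σ / 2 * Y < 2 * e * σ * θY)
    (h2T : 3 * e * log2T ≤ 3 * e * (Real.log 38 + (a + 2) * logY)) :
    logC + (L3ν + Λν) / c₀ + (3 * e) * Real.log (3 * e) + (3 * e) * log2T +
      e * Real.log 108 + e * Real.log 2 + 2 * e * Real.log (2 * Y) + l * (3 * e) * θY < kE := by
  subst hnR ha hJ hB
  rw [hlog2Y]
  linear_combination hfracle + hFY + hRHS + hmain + h2T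

/-- Elementary bounds for the parameter choice in base degree `3`. [folklore] -/
theorem param_bounds3 {e : ℕ} (he : 1 ≤ e) {a : ℝ} (ha0 : 0 < a) {Y E T : ℕ} (hY3 : 3 ≤ Y)
    (hEle : (E : ℝ) ≤ (Y : ℝ) ^ a) (hT19 : (T : ℝ) ≤ 19 * (Y : ℝ) ^ (a + 2)) (hT1 : (1 : ℝ) ≤ T) :
    Real.log (2 * (T : ℝ)) ≤ Real.log 38 + (a + 2) * Real.log Y ∧
    (1 : ℝ) ≤ (3 * e : ℕ) * Real.log (3 * e : ℕ) + (3 * e : ℕ) * Real.log (2 * (T : ℝ)) +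
      e * Real.log 108 + 6 * e * ((Y : ℝ) * E * Real.log Y) ∧
    ((3 * e : ℕ) * Real.log (3 * e : ℕ) + (3 * e : ℕ) * Real.log (2 * (T : ℝ)) +
      e * Real.log 108 + 6 * e * ((Y : ℝ) * E * Real.log Y) ≤
      ((3 * e : ℕ) * Real.log (3 * e : ℕ) + (3 * e : ℕ) * Real.log 38 + e * Real.log 108 +
        (3 * e : ℕ) * (a + 2) + 6 * e) * (Y : ℝ) ^ (a + 1) * Real.log Y) := by
  have hYR : (3 : ℝ) ≤ Y := by exact_mod_cast hY3
  have hY1 : (1 : ℝ) ≤ Y := by linarith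
  have hY0 : (0 : ℝ) < Y := by linarith
  have heR : (1 : ℝ) ≤ e := by exact_mod_cast he
  have hnR : ((3 * e : ℕ) : ℝ) = 3 * (e : ℝ) := by push_cast; ring
  have hlogY1 : 1 ≤ Real.log Y := by
    rw [Real.le_log_iff_exp_le hY0]
    have := Real.exp_one_lt_d9; linarith
  have hlogY0 : 0 < Real.log Y := by linarith
  have hlogn : 0 ≤ Real.log ((3 * e : ℕ) : ℝ) := Real.log_nonneg (by rw [hnR]; linarith)
  have hlog38 : 0 < Real.log 38 := Real.log_pos (by norm_num)
  have hlog108 : 1 < Real.log 108 := by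
    rw [Real.lt_log_iff_exp_lt (by norm_num)]; have := Real.exp_one_lt_d9; linarith
  have hlog2T : Real.log (2 * (T : ℝ)) ≤ Real.log 38 + (a + 2) * Real.log Y := by
    rw [← Real.log_rpow hY0, ← Real.log_mul (by norm_num) (by positivity)]
    exact Real.log_le_log (by positivity) (by linarith)
  have hlog2T0 : 0 ≤ Real.log (2 * (T : ℝ)) := Real.log_nonneg (by linarith)
  have hYa1' : (1 : ℝ) ≤ (Y : ℝ) ^ (a + 1) := Real.one_le_rpow hY1 (by linarith)
  have hYEl : (Y : ℝ) * E * Real.log Y ≤ (Y : ℝ) ^ (a + 1) * Real.log Y := by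
    apply mul_le_mul_of_nonneg_right _ hlogY0.le
    calc (Y : ℝ) * E ≤ (Y : ℝ) * (Y : ℝ) ^ a := mul_le_mul_of_nonneg_left hEle hY0.le
      _ = (Y : ℝ) ^ (a + 1) := by
          rw [Real.rpow_add hY0, Real.rpow_one]; ring
  set W := (Y : ℝ) ^ (a + 1) * Real.log Y with hW
  have hW1 : 1 ≤ W := by rw [hW]; nlinarith
  have hW0 : 0 ≤ W := by linarith
  refine ⟨hlog2T, ?_, ?_⟩
  · have : 0 ≤ ((3 * e : ℕ) : ℝ) * Real.log ((3 * e : ℕ) : ℝ) := by positivity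
    have : 0 ≤ ((3 * e : ℕ) : ℝ) * Real.log (2 * (T : ℝ)) := by positivity
    have : 0 ≤ 6 * (e : ℝ) * ((Y : ℝ) * E * Real.log Y) := by positivity
    nlinarith
  · have t1 : ((3 * e : ℕ) : ℝ) * Real.log ((3 * e : ℕ) : ℝ) ≤
        ((3 * e : ℕ) : ℝ) * Real.log ((3 * e : ℕ) : ℝ) * W := le_mul_of_one_le_right (by positivity) hW1
    have t21 : ((3 * e : ℕ) : ℝ) * Real.log 38 ≤ ((3 * e : ℕ) : ℝ) * Real.log 38 * W :=
      le_mul_of_one_le_right (by positivity) hW1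
    have t22 : (a + 2) * Real.log Y ≤ (a + 2) * W := by
      apply mul_le_mul_of_nonneg_left _ (by linarith)
      rw [hW]; exact le_mul_of_one_le_left hlogY0.le hYa1'
    have t2 : ((3 * e : ℕ) : ℝ) * Real.log (2 * (T : ℝ)) ≤
        ((3 * e : ℕ) : ℝ) * Real.log 38 * W + ((3 * e : ℕ) : ℝ) * (a + 2) * W := by
      have := mul_le_mul_of_nonneg_left hlog2T (show (0 : ℝ) ≤ ((3 * e : ℕ) : ℝ) by positivity)
      have := mul_le_mul_of_nonneg_left t22 (show (0 : ℝ) ≤ ((3 * e : ℕ) : ℝ) by positivity)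
      linarith
    have t3 : (e : ℝ) * Real.log 108 ≤ e * Real.log 108 * W :=
      le_mul_of_one_le_right (by positivity) hW1
    have t4 : 6 * (e : ℝ) * ((Y : ℝ) * E * Real.log Y) ≤ 6 * e * W :=
      mul_le_mul_of_nonneg_left hYEl (by positivity)
    have hexp : (((3 * e : ℕ) : ℝ) * Real.log ((3 * e : ℕ) : ℝ) + ((3 * e : ℕ) : ℝ) * Real.log 38 +
        e * Real.log 108 + ((3 * e : ℕ) : ℝ) * (a + 2) + 6 * e) * (Y : ℝ) ^ (a + 1) * Real.log Y =
        ((3 * e : ℕ) : ℝ) * Real.log ((3 * e : ℕ) : ℝ) * W + ((3 * e : ℕ) : ℝ) * Real.log 38 * W +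
        e * Real.log 108 * W + ((3 * e : ℕ) : ℝ) * (a + 2) * W + 6 * e * W := by
      rw [hW]; ring
    rw [hexp]
    linarith

set_option maxHeartbeats 800000 in
/-- **Existence of good parameters** `Y, E, T` for the assembly in base degree `3`.
[cite: Masser2002, §3, Lemma and (3.10)] -/
theorem exists_good_params3 {e : ℕ} (he : 1 ≤ e) (l ν C : ℝ) (hl : 1 ≤ l)
    (hν : ν < 1 / (3 * l + 1)) :
    ∃ Y E T : ℕ, 5 ≤ Y ∧ 1 ≤ E ∧
      Real.log 6 + 6 * (Y : ℝ) * E * Real.log Y < θ (T : ℝ) ∧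
      Real.log C +
        ((Real.log 3) ^ ν +
          ((3 * e : ℕ) * Real.log (3 * e : ℕ) + (3 * e : ℕ) * Real.log (2 * (T : ℝ)) +
            e * Real.log 108 + 6 * e * ((Y : ℝ) * E * Real.log Y)) ^ ν) / Real.log (Real.log 3) +
        (3 * e : ℕ) * Real.log (3 * e : ℕ) + (3 * e : ℕ) * Real.log (2 * (T : ℝ)) +
        e * Real.log 108 + e * Real.log 2 + 2 * e * Real.log (2 * (Y : ℝ)) +
        l * (3 * e : ℕ) * θ (Y : ℝ) <
        e * ((primesGT3LE Y).card * Real.log ((E : ℝ) + 1)) := by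
  obtain ⟨σ, hσ, hσν⟩ := exists_slack3 hl hν
  obtain ⟨a, hadef⟩ : ∃ a : ℝ, a = 3 * l + 2 * σ := ⟨_, rfl⟩
  have ha0 : 0 < a := by rw [hadef]; linarith
  have hνa : ν * (a + 1) < 1 := by rw [hadef]; linarith
  have hnR : ((3 * e : ℕ) : ℝ) = 3 * (e : ℝ) := by push_cast; ring
  have heR : (1 : ℝ) ≤ e := by exact_mod_cast he
  have hc₀ : 0 < Real.log (Real.log 3) := log_log_three_pos
  obtain ⟨A, hAdef⟩ : ∃ A : ℝ, A = (3 * e : ℕ) * Real.log (3 * e : ℕ) + (3 * e : ℕ) * Real.log 38 +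
      e * Real.log 108 + (3 * e : ℕ) * (a + 2) + 6 * e := ⟨_, rfl⟩
  have hlogn : 0 ≤ Real.log ((3 * e : ℕ) : ℝ) := Real.log_nonneg (by rw [hnR]; linarith)
  have hlog38 : 0 < Real.log 38 := Real.log_pos (by norm_num)
  have hlog108 : 0 < Real.log 108 := Real.log_pos (by norm_num)
  have hlog2 : 0 < Real.log 2 := Real.log_pos (by norm_num)
  have hlog6 : 0 < Real.log 6 := Real.log_pos (by norm_num)
  have hA : 0 < A := by rw [hAdef]; positivity
  obtain ⟨J, hJdef⟩ : ∃ J : ℝ, J = Real.log C + (Real.log 3 ^ ν + 1) / Real.log (Real.log 3) +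
      (3 * (e : ℝ)) * Real.log (3 * (e : ℝ)) + (3 * (e : ℝ)) * Real.log 38 +
      e * Real.log 108 + e * Real.log 2 + 2 * e * Real.log 2 + e * a * Real.log 6 := ⟨_, rfl⟩
  obtain ⟨B, hBdef⟩ : ∃ B : ℝ, B = (3 * (e : ℝ)) * (a + 2) + 2 * e := ⟨_, rfl⟩
  -- Chebyshev and the sublinear error
  obtain ⟨T₀, hT₀⟩ := eventually_theta_ge_half
  have hF := (isLittleO_errorFun (J := J) (B := B) (ν := ν) (c₀ := Real.log (Real.log 3)) hA
    (by linarith) hνa).def (show (0 : ℝ) < e * σ / 2 by positivity)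
  rw [Filter.eventually_atTop] at hF
  obtain ⟨y₀, hy₀⟩ := hF
  -- the parameter `Y`
  obtain ⟨Y, hYdef⟩ : ∃ Y : ℕ, Y = max (max T₀ 5) (Nat.ceil (max y₀ 0)) := ⟨_, rfl⟩
  have hY5 : 5 ≤ Y := hYdef ▸ le_trans (le_max_right _ _) (le_max_left _ _)
  have hYT₀ : T₀ ≤ Y := hYdef ▸ le_trans (le_max_left _ _) (le_max_left _ _)
  have hYy₀ : y₀ ≤ (Y : ℝ) := by
    calc y₀ ≤ max y₀ 0 := le_max_left _ _
      _ ≤ (Nat.ceil (max y₀ 0) : ℝ) := Nat.le_ceil _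
      _ ≤ (Y : ℝ) := by rw [hYdef]; exact_mod_cast le_max_right _ _
  have hYR : (5 : ℝ) ≤ Y := by exact_mod_cast hY5
  have hY1 : (1 : ℝ) ≤ Y := by linarith
  have hY0 : (0 : ℝ) < Y := by linarith
  have hlogY0 : 0 < Real.log Y := Real.log_pos (by linarith)
  have hYa1 : (1 : ℝ) ≤ (Y : ℝ) ^ a := Real.one_le_rpow hY1 ha0.le
  -- the parameter `E`
  obtain ⟨E, hEdef⟩ : ∃ E : ℕ, E = Nat.floor ((Y : ℝ) ^ a) := ⟨_, rfl⟩
  have hE1 : 1 ≤ E := hEdef ▸ Nat.le_floor (by simpa using hYa1)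
  have hEle : (E : ℝ) ≤ (Y : ℝ) ^ a := hEdef ▸ Nat.floor_le (by positivity)
  have hElt : (Y : ℝ) ^ a < (E : ℝ) + 1 := hEdef ▸ Nat.lt_floor_add_one _
  -- the parameter `T`
  obtain ⟨X, hXdef⟩ : ∃ X : ℝ, X = Real.log 6 + 6 * ((Y : ℝ) * E * Real.log Y) := ⟨_, rfl⟩
  have hX0 : 0 < X := by rw [hXdef]; positivity
  obtain ⟨T, hTdef⟩ : ∃ T : ℕ, T = max T₀ (Nat.ceil (2 * X) + 1) := ⟨_, rfl⟩
  have hTT₀ : T₀ ≤ T := hTdef ▸ le_max_left _ _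
  have hTX : 2 * X + 1 ≤ (T : ℝ) := by
    have h1 : ((Nat.ceil (2 * X) + 1 : ℕ) : ℝ) ≤ (T : ℝ) := by
      rw [hTdef]; exact_mod_cast le_max_right _ _
    push_cast at h1
    linarith [Nat.le_ceil (2 * X)]
  have hT : X < θ (T : ℝ) := by
    have := hT₀ T hTT₀
    linarith
  refine ⟨Y, E, T, hY5, hE1, ?_, ?_⟩
  · have : 6 * (Y : ℝ) * E * Real.log Y = 6 * ((Y : ℝ) * E * Real.log Y) := by ring
    rw [this, ← hXdef]; exact hT
  -- facts for `hneed`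
  have f1 : (Y : ℝ) / 2 ≤ θ (Y : ℝ) := hT₀ Y hYT₀
  have f2 : θ (Y : ℝ) ≤ Real.log 6 + (primesGT3LE Y).card * Real.log Y :=
    theta_le_log_six_add (by omega)
  have f3 : a * Real.log Y ≤ Real.log ((E : ℝ) + 1) := by
    rw [← Real.log_rpow hY0]
    exact Real.log_le_log (by positivity) hElt.le
  -- `T ≤ 19 Y^(a+2)`
  have hYpow : (Y : ℝ) ≤ (Y : ℝ) ^ (a + 2) := by
    calc (Y : ℝ) = (Y : ℝ) ^ (1 : ℝ) := (Real.rpow_one _).symm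
      _ ≤ (Y : ℝ) ^ (a + 2) := Real.rpow_le_rpow_of_exponent_le hY1 (by linarith)
  have hYEa2 : (Y : ℝ) * E * Real.log Y ≤ (Y : ℝ) ^ (a + 2) := by
    have hlogYY : Real.log Y ≤ (Y : ℝ) := Real.log_le_self hY0.le
    calc (Y : ℝ) * E * Real.log Y ≤ (Y : ℝ) * (Y : ℝ) ^ a * Y := by
          apply mul_le_mul (mul_le_mul_of_nonneg_left hEle hY0.le) hlogYY hlogY0.le (by positivity)
      _ = (Y : ℝ) ^ (a + 2) := by
          rw [show a + 2 = 1 + a + 1 by ring, Real.rpow_add hY0 (1 + a) 1, Real.rpow_add hY0 1 a,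
            Real.rpow_one]
  have hT19 : (T : ℝ) ≤ 19 * (Y : ℝ) ^ (a + 2) := by
    have h1 : (T : ℝ) ≤ T₀ + (Nat.ceil (2 * X) + 1 : ℕ) := by
      rw [hTdef]; exact_mod_cast max_le_add_of_nonneg (Nat.zero_le _) (Nat.zero_le _)
    have h2 : ((Nat.ceil (2 * X) + 1 : ℕ) : ℝ) ≤ 2 * X + 2 := by
      push_cast; linarith [Nat.ceil_lt_add_one (show 0 ≤ 2 * X by positivity)]
    have h3 : (T₀ : ℝ) ≤ Y := by exact_mod_cast hYT₀
    have h5 : Real.log 6 < 2 := by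
      have : Real.log 6 < Real.log (Real.exp 2) := by
        apply Real.log_lt_log (by norm_num)
        have h := Real.exp_one_gt_d9
        have : Real.exp 2 = Real.exp 1 * Real.exp 1 := by rw [← Real.exp_add]; norm_num
        nlinarith
      rwa [Real.log_exp] at this
    have h6 : (1 : ℝ) ≤ (Y : ℝ) ^ (a + 2) := le_trans hY1 hYpow
    have hXle : X ≤ Real.log 6 + 6 * (Y : ℝ) ^ (a + 2) := by rw [hXdef]; linarith
    linarith
  have hT1 : (1 : ℝ) ≤ T := by linarith
  obtain ⟨hlog2T, hΛ1, hΛle⟩ := param_bounds3 he ha0 (by omega) hEle hT19 hT1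
  rw [← hAdef] at hΛle
  have hΛν : ((3 * e : ℕ) * Real.log (3 * e : ℕ) + (3 * e : ℕ) * Real.log (2 * (T : ℝ)) +
      e * Real.log 108 + 6 * e * ((Y : ℝ) * E * Real.log Y)) ^ ν ≤
      1 + (A * (Y : ℝ) ^ (a + 1) * Real.log Y) ^ ν := by
    have hpos : 0 ≤ (A * (Y : ℝ) ^ (a + 1) * Real.log Y) ^ ν := Real.rpow_nonneg (by positivity) ν
    rcases le_or_gt 0 ν with hν0 | hν0
    · have := Real.rpow_le_rpow (by linarith) hΛle hν0
      linarith
    · have := Real.rpow_le_one_of_one_le_of_nonpos hΛ1 hν0.le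
      linarith
  -- the sublinear bound at `Y`
  have hFY := hy₀ Y hYy₀
  rw [Real.norm_of_nonneg hY0.le] at hFY
  rw [Real.norm_eq_abs] at hFY
  have hFY' : J + B * Real.log Y + (A * (Y : ℝ) ^ (a + 1) * Real.log Y) ^ ν / Real.log (Real.log 3) ≤
      e * σ / 2 * Y := le_trans (le_abs_self _) hFY
  -- assemble `hneed`
  have hk0 : (0 : ℝ) ≤ (primesGT3LE Y).card := Nat.cast_nonneg _
  have hRHS : (e : ℝ) * a * (θ (Y : ℝ) - Real.log 6) ≤
      e * ((primesGT3LE Y).card * Real.log ((E : ℝ) + 1)) := by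
    have h1 : ((primesGT3LE Y).card : ℝ) * (a * Real.log Y) ≤
        (primesGT3LE Y).card * Real.log ((E : ℝ) + 1) := mul_le_mul_of_nonneg_left f3 hk0
    have h2 : a * (θ (Y : ℝ) - Real.log 6) ≤ (primesGT3LE Y).card * (a * Real.log Y) := by
      have := mul_le_mul_of_nonneg_left f2 ha0.le
      linarith
    have := mul_le_mul_of_nonneg_left (le_trans h2 h1) (show (0 : ℝ) ≤ e by positivity)
    linarith
  have hfracle : (Real.log 3 ^ ν + ((3 * e : ℕ) * Real.log (3 * e : ℕ) +
      (3 * e : ℕ) * Real.log (2 * (T : ℝ)) + e * Real.log 108 + 6 * e * ((Y : ℝ) * E * Real.log Y)) ^ ν) /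
        Real.log (Real.log 3) ≤
      (Real.log 3 ^ ν + 1) / Real.log (Real.log 3) +
        (A * (Y : ℝ) ^ (a + 1) * Real.log Y) ^ ν / Real.log (Real.log 3) := by
    rw [← add_div]
    apply div_le_div_of_nonneg_right _ hc₀.le
    linarith
  have hlog2Y : Real.log (2 * (Y : ℝ)) = Real.log 2 + Real.log Y :=
    Real.log_mul (by norm_num) hY0.ne'
  have hmain : (e : ℝ) * σ / 2 * Y < 2 * e * σ * θ (Y : ℝ) := by
    have h1 : (e : ℝ) * σ * Y ≤ 2 * e * σ * θ (Y : ℝ) := by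
      have := mul_le_mul_of_nonneg_left f1 (show (0 : ℝ) ≤ 2 * e * σ by positivity)
      linarith
    have h2 : (0 : ℝ) < e * σ * Y := by positivity
    linarith
  have h2T : 3 * (e : ℝ) * Real.log (2 * (T : ℝ)) ≤ 3 * e * (Real.log 38 + (a + 2) * Real.log Y) :=
    mul_le_mul_of_nonneg_left hlog2T (by positivity)
  rw [hnR] at hfracle ⊢
  exact three_need_arith rfl hadef hJdef hBdef hlog2Y hfracle hFY' hRHS hmain h2T

/-- **Masser's theorem (`UniformABCDiscriminantSharp`) in every degree divisible by `3`**, via the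
cubic base field `ℚ[X]/(X³ − 3v²X + 2u³)` (irreducible, or with a rational root) and the base
change `K ↦ K(r^{1/e})`, `n = 3e`. [cite: Masser2002, Theorem and §3] -/
theorem uniformABCDiscriminantSharp_three :
    ∀ n : ℕ, 2 ≤ n → 3 ∣ n → ∀ l : ℝ, 1 ≤ l → ∀ ν : ℝ, ν < 1 / (l * n + 1) → ∀ C : ℝ,
      ∃ (K : Type) (_ : Field K) (_ : NumberField K),
        Module.finrank ℚ K = n ∧
          ∃ a b c : K, a ≠ 0 ∧ b ≠ 0 ∧ c ≠ 0 ∧ a + b + c = 0 ∧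
            C * |(NumberField.discr K : ℝ)| * masserPhi ν |(NumberField.discr K : ℝ)| *
                (masserSupport a b c : ℝ) ^ l <
              mulHeight ![a, b, c] := by
  intro n hn h3 l hl ν hν C
  obtain ⟨e, he3⟩ := h3
  have he : 1 ≤ e := by omega
  have hν' : ν < 1 / (3 * l + 1) := by
    refine lt_of_lt_of_le hν ?_
    apply one_div_le_one_div_of_le (by linarith)
    have : (3 : ℝ) ≤ n := by exact_mod_cast (show 3 ≤ n by omega)
    nlinarith
  obtain ⟨Y, E, T, hY, hE, hT, hneed⟩ := exists_good_params3 he l ν C hl hν'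
  obtain ⟨K, iF, iN, hfin, a, b, c, ha, hb, hc, habc, hlt⟩ :=
    three_assembly he l ν C hl hY hE hT hneed
  exact ⟨K, iF, iN, hfin.trans he3.symm, a, b, c, ha, hb, hc, habc, hlt⟩

/-- **Masser's theorem in every degree not coprime to `6`.** The conclusion of the barrier fact
`UniformABCDiscriminantSharp` holds for every `n ≥ 2` with `gcd(n, 6) ≠ 1`, i.e. `2 ∣ n` or
`3 ∣ n`; the remaining degrees (`n = 5, 7, 11, …, 25, …`) would require the irreducibility of
Masser's trinomial in a prime degree `≥ 5`, which Masser obtains from Hilbert irreducibility via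
Faltings' theorem. [cite: Masser2002, Theorem and §2–§3] -/
theorem uniformABCDiscriminantSharp_of_not_coprime_six {n : ℕ} (hn : 2 ≤ n)
    (h6 : ¬ Nat.Coprime n 6) {l : ℝ} (hl : 1 ≤ l) {ν : ℝ} (hν : ν < 1 / (l * n + 1)) (C : ℝ) :
    ∃ (K : Type) (_ : Field K) (_ : NumberField K),
      Module.finrank ℚ K = n ∧
        ∃ a b c : K, a ≠ 0 ∧ b ≠ 0 ∧ c ≠ 0 ∧ a + b + c = 0 ∧
          C * |(NumberField.discr K : ℝ)| * masserPhi ν |(NumberField.discr K : ℝ)| *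
              (masserSupport a b c : ℝ) ^ l <
            mulHeight ![a, b, c] := by
  by_cases h2 : 2 ∣ n
  · exact uniformABCDiscriminantSharp_even n hn (even_iff_two_dvd.mpr h2) l hl ν hν C
  · have h3 : 3 ∣ n := by
      by_contra h3
      apply h6
      have h2' : Nat.Coprime n 2 := (Nat.Prime.coprime_iff_not_dvd Nat.prime_two).mpr h2 |>.symm
      have h3' : Nat.Coprime n 3 := (Nat.Prime.coprime_iff_not_dvd Nat.prime_three).mpr h3 |>.symm
      rw [show (6 : ℕ) = 2 * 3 by norm_num]
      exact Nat.Coprime.mul_right h2' h3'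
    exact uniformABCDiscriminantSharp_three n hn h3 l hl ν hν C

end CubicMain

end Literature.Barriers.ABC

end
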